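import Literature.NumberTheory.Transcendental.CijsouwWaldschmidt1977Liouville
import Literature.NumberTheory.Transcendental.CijsouwWaldschmidt1977Steps
import Literature.NumberTheory.Transcendental.Waldschmidt1980EndgameCW
import Literature.NumberTheory.Transcendental.PadicLiouvilleInequality
import Literature.NumberTheory.Transcendental.Waldschmidt1980KStep
import Literature.NumberTheory.Transcendental.PadicCW77Functions
import HarnessLib

/-!
# The `p`-adic Cijsouw–Waldschmidt/Waldschmidt 2-descent for principal units of `ℚ_p`, Ia: the multiquadratic algebra, the sign-free set-up and its rational cores, one descent step, integrality, the `p`-adic Liouville inequalities, the half step (re-homed cell library `abc-stewartyu`)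

**Part Ia of V.** RE-HOMED into `Literature/` by the Hodge foundations lane (`lit-hodgefound`, prover p20, generation 39): VERBATIM MODULE
ports (every declaration of every source module, in source order; the short list of deliberate omissions is printed below) of
the cell library `Summits/ABC/StewartYu/*.lean` (cell `abc-stewartyu`: the kernel `p`-adic Baker bound for logarithms of rational
primes and its abc consequences), namespace `Summit.ABC.StewartYu` re-rooted to `Literature.NumberTheory.Transcendental.StewartYu`;
the declarations the cell had placed inside the Literature namespaces `Literature.NumberTheory.Transcendental.PadicCW77.Setup` /
`….CW77.Setup` (dot-notation helpers on the tree's set-up records) keep their namespace and get a trailing prime (`toQ'`,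
`Φ_half'`, `SizeHyp.abs_γ_le_p'`, …) because their un-primed names are taken by the Summits twins (gate `dedup.fqn-exists`);
imports from `Literature/` and Mathlib only; one `section PartK` per source module in dependency order; no `sorry`, no new axiom,
NO named fact (D-0026) — every declaration is a definition with a body or a proved theorem.

PROVENANCE CONVENTION of these files.  Docstrings are carried byte-for-byte.  The cell tags most of its declarations
`[folklore]` («nothing here is claimed to be in print»: they are ITS OWN `p`-adic transcription of printed archimedean arguments,
or elementary plumbing); the 25-odd declarations the cell itself cites (`[cite: Waldschmidt1980, …]`,
`[cite: CijsouwWaldschmidt1977, …]`, …) keep exactly those tags.  The Literature gate no longer admits a public theorem on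
`[folklore]` alone (`lint.literature-cited-only`), so every `[folklore]` declaration KEEPS that tag and additionally carries
`[cite: <Key>, <locator> (source FOLLOWED …; this declaration is the cell's adaptation, NOT a printed statement)]` — the printed
argument the source module says it transcribes (its own module docstring names it), worded so that the tag does not claim the
declaration is printed there.
Sources followed by the cell: M. Waldschmidt, *A lower bound for linear forms in logarithms*, Acta Arith. 37 (1980) 257–283,
§3 [Waldschmidt1980]; P. L. Cijsouw, M. Waldschmidt, *Linear forms and simultaneous approximations* (1977) [CijsouwWaldschmidt1977];
K. Yu, *Linear forms in p-adic logarithms* I–II, Acta Arith. 53 (1989), Compositio Math. 74 (1990) [Yu1989] [Yu1990];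
C. L. Stewart, R. Tijdeman, *On the Oesterlé–Masser conjecture*, Monatsh. Math. 102 (1986) [StewartTijdeman1986];
T. N. Shorey, R. Tijdeman, *Exponential Diophantine Equations* (1986) Ch. 1 [ShoreyTijdeman1986]; C. L. Stewart, K. Yu, Math. Ann.
291 (1991) §3 [StewartYu1991]; J.-H. Evertse, K. Győry, *Unit Equations in Diophantine Number Theory* (2015) Thm 4.3.3
[EvertseGyory2015]; L. Babai, Combinatorica 6 (1986) [Babai1986].

THIS FILE (8 source modules, every declaration: `PadicMultiquadratic`, `DescentSetupQ`, `DescentStepQ`, `DescentIntegralityQ`,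
`PadicMultiquadraticLiouville`, `PadicMultiquadraticLiouvilleSharp`, `DescentLiouvilleQ`, `PadicCW77HalfStep`): the coefficient-vector
algebra of `ℚ(√α₁,…,√α_k)` in any field of characteristic `0` and its `p`-adic Liouville inequalities; the sign-free set-up `SetupQ`
of Baker's 2-descent with its SIGNED rational cores and the bridges to the tree's archimedean `CW77.Setup`; one step of the descent
and the integrality of the cores; the bridge `PadicCW77.Setup.toQ'` and the HALF STEP in `ℚ_p` (class sums vanish below the
Liouville bound).  Omitted declarations: none.

WHAT THIS IS NOT: nothing about abc yet (Parts Ib–V and `Literature/Barriers/ABC/BakerMethodBoundsPadicPrincipalCoreHolds.lean`).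
-/

noncomputable section

/-!
## Part 1 — port of `Summits/ABC/StewartYu/PadicMultiquadratic.lean`

# Cell abc-stewartyu, WP-A3 (i): the multiquadratic algebra `ℚ(√α₁, …, √αₖ)` inside an ARBITRARY
# field of characteristic zero (e.g. `ℚ_p`) — evaluation, multiplicativity, linear independence

`Summits/ABC/StewartYu/PadicMultiquadratic.lean` — cell `abc-stewartyu` (HOME
`run/shared/lean/pub/abc-stewartyu/`, seat p3, work package WP-A3 of `HOME/p2/PADIC-CORE.md`;
theorems and two plain definitions, no named fact).

The tree's Cijsouw–Waldschmidt 1977 development (`Literature.NumberTheory.Transcendental.CW77`,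
file `CijsouwWaldschmidt1977Liouville.lean`) expresses the values of the auxiliary functions at the
half points of Baker's `2`-descent on the monomials `∏_{j ∈ S} √αⱼ` of REAL square roots of positive
rationals, with coefficient vectors `c : Finset (Fin k) → ℚ`, the convolution product `CW77.cmul`,
and the evaluation `CW77.ev α c = ∑_S c_S ∏_{j∈S} √αⱼ ∈ ℝ`. For the `p`-adic port (blueprint
`PADIC-CORE.md` §3, dictionary row "values at points are algebraic") the square roots live in `ℚ_p`
(principal units `αⱼ ≡ 1 (mod p)` have `p`-adic square roots) and may be roots of NEGATIVE
rationals (the sign-normalised generators `α̃ⱼ` of WP-M), so positivity and `Real.sqrt` are not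
available. This file redoes the coefficient-vector algebra for an arbitrary field `L` of
characteristic zero and an arbitrary family of square roots `s : Fin k → L`, `sⱼ · sⱼ = αⱼ`:

* `monoL s S = ∏_{j∈S} sⱼ`, `evL s c = ∑_S c_S · monoL s S`; linearity; `evL_cmul`:
  `evL s (cmul α c d) = evL s c · evL s d` (from `monoL S · monoL T = (∏_{S∩T} αⱼ) · monoL (S Δ T)`);
* `finrank_adjoin_root_eq_two_pow`, `linearIndependent_monoL`: under the `2`-Kummer condition
  (no product of a non-empty subfamily of the `αⱼ` is a square in `ℚ`) the `2ᵏ` monomials are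
  `ℚ`-linearly independent in `L` — the tree's abstract `Literature.Barriers.ABC.Multiquadratic.
  finrank_adjoin_image_sqrt_and_sq` (any fields `K ⊆ L`, `char ≠ 2`) specialised to `K = ℚ`, with
  the given roots in place of `Real.sqrt`;
* `evL_ne_zero` (`c ≠ 0 ⇒ evL s c ≠ 0`), `evL_succ`, `evL_conjLast` (splitting off the last root).

The `p`-adic Liouville inequality built on this is in `PadicMultiquadraticLiouville.lean`.
Everything is [folklore]; nothing here is claimed to be in print.
-/

section Part1

open _root_.Finset _root_.IntermediateField
open Literature.NumberTheory.Transcendental.CW77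

namespace Literature.NumberTheory.Transcendental.StewartYu

namespace Multiquad

variable {L : Type*} [Field L] [CharZero L]
variable {k : ℕ}

/-! ### Monomials and evaluation in a field of characteristic zero -/

/-- The monomial `∏_{j ∈ S} sⱼ` of a family of (square) roots `s : Fin k → L`. [folklore]
[cite: CijsouwWaldschmidt1977, §3 (source FOLLOWED for Baker’s 2-descent whose multiquadratic algebra this module re-does in an arbitrary field of characteristic 0; the cell’s own algebra, NOT a printed statement)] -/
def monoL (s : Fin k → L) (S : Finset (Fin k)) : L := ∏ j ∈ S, s j

/-- Evaluation of a rational coefficient vector on the monomials: `∑_S c_S ∏_{j∈S} sⱼ`. [folklore]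
[cite: CijsouwWaldschmidt1977, §3 (source FOLLOWED for Baker’s 2-descent whose multiquadratic algebra this module re-does in an arbitrary field of characteristic 0; the cell’s own algebra, NOT a printed statement)] -/
def evL (s : Fin k → L) (c : Finset (Fin k) → ℚ) : L := ∑ S, (c S : L) * monoL s S

/-- `evL` is additive. [folklore]
[cite: CijsouwWaldschmidt1977, §3 (source FOLLOWED for Baker’s 2-descent whose multiquadratic algebra this module re-does in an arbitrary field of characteristic 0; the cell’s own algebra, NOT a printed statement)] -/
theorem evL_add (s : Fin k → L) (c d : Finset (Fin k) → ℚ) :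
    evL s (c + d) = evL s c + evL s d := by
  unfold evL; rw [← Finset.sum_add_distrib]
  refine Finset.sum_congr rfl fun S _ => ?_
  simp only [Pi.add_apply, Rat.cast_add]; ring

/-- `evL` respects subtraction. [folklore]
[cite: CijsouwWaldschmidt1977, §3 (source FOLLOWED for Baker’s 2-descent whose multiquadratic algebra this module re-does in an arbitrary field of characteristic 0; the cell’s own algebra, NOT a printed statement)] -/
theorem evL_sub (s : Fin k → L) (c d : Finset (Fin k) → ℚ) :
    evL s (c - d) = evL s c - evL s d := by
  unfold evL; rw [← Finset.sum_sub_distrib]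
  refine Finset.sum_congr rfl fun S _ => ?_
  simp only [Pi.sub_apply, Rat.cast_sub]; ring

/-- `evL` is `ℚ`-homogeneous. [folklore]
[cite: CijsouwWaldschmidt1977, §3 (source FOLLOWED for Baker’s 2-descent whose multiquadratic algebra this module re-does in an arbitrary field of characteristic 0; the cell’s own algebra, NOT a printed statement)] -/
theorem evL_smul (s : Fin k → L) (q : ℚ) (c : Finset (Fin k) → ℚ) :
    evL s (q • c) = (q : L) * evL s c := by
  unfold evL; rw [Finset.mul_sum]
  refine Finset.sum_congr rfl fun S _ => ?_
  simp only [Pi.smul_apply, smul_eq_mul, Rat.cast_mul]; ring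

omit [CharZero L] in
/-- `evL s 0 = 0`. [folklore]
[cite: CijsouwWaldschmidt1977, §3 (source FOLLOWED for Baker’s 2-descent whose multiquadratic algebra this module re-does in an arbitrary field of characteristic 0; the cell’s own algebra, NOT a printed statement)] -/
theorem evL_zero (s : Fin k → L) : evL s 0 = 0 := by
  unfold evL; simp

/-- `evL s (-c) = -evL s c`. [folklore]
[cite: CijsouwWaldschmidt1977, §3 (source FOLLOWED for Baker’s 2-descent whose multiquadratic algebra this module re-does in an arbitrary field of characteristic 0; the cell’s own algebra, NOT a printed statement)] -/
theorem evL_neg (s : Fin k → L) (c : Finset (Fin k) → ℚ) : evL s (-c) = -evL s c := by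
  have h := evL_sub s 0 c
  rw [zero_sub, evL_zero, zero_sub] at h
  exact h

/-- Products of root monomials: `(∏_S sⱼ)(∏_T sⱼ) = (∏_{S∩T} αⱼ) · ∏_{S Δ T} sⱼ` when `sⱼ² = αⱼ`.
[folklore]
[cite: CijsouwWaldschmidt1977, §3 (source FOLLOWED for Baker’s 2-descent whose multiquadratic algebra this module re-does in an arbitrary field of characteristic 0; the cell’s own algebra, NOT a printed statement)] -/
theorem monoL_mul_monoL (α : Fin k → ℚ) (s : Fin k → L) (hs : ∀ j, s j * s j = (α j : L))
    (S T : Finset (Fin k)) :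
    monoL s S * monoL s T = ((∏ j ∈ S ∩ T, α j : ℚ) : L) * monoL s (symmDiff S T) := by
  classical
  unfold monoL
  have hS : ∏ j ∈ S, s j = (∏ j ∈ S \ T, s j) * ∏ j ∈ S ∩ T, s j := by
    rw [← Finset.prod_union (Finset.disjoint_sdiff_inter S T), Finset.sdiff_union_inter]
  have hT : ∏ j ∈ T, s j = (∏ j ∈ T \ S, s j) * ∏ j ∈ S ∩ T, s j := by
    rw [Finset.inter_comm, ← Finset.prod_union (Finset.disjoint_sdiff_inter T S),
      Finset.sdiff_union_inter]
  have hsq : (∏ j ∈ S ∩ T, s j) * (∏ j ∈ S ∩ T, s j) = ((∏ j ∈ S ∩ T, α j : ℚ) : L) := by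
    rw [← Finset.prod_mul_distrib, Rat.cast_prod]
    exact Finset.prod_congr rfl fun j _ => hs j
  have hΔ : ∏ j ∈ symmDiff S T, s j = (∏ j ∈ S \ T, s j) * ∏ j ∈ T \ S, s j := by
    rw [symmDiff_def, Finset.sup_eq_union, Finset.prod_union disjoint_sdiff_sdiff]
  rw [hS, hT, hΔ, ← hsq]; ring

/-- **`evL` is multiplicative for the convolution product `CW77.cmul`.** [folklore]
[cite: CijsouwWaldschmidt1977, §3 (source FOLLOWED for Baker’s 2-descent whose multiquadratic algebra this module re-does in an arbitrary field of characteristic 0; the cell’s own algebra, NOT a printed statement)] -/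
theorem evL_cmul (α : Fin k → ℚ) (s : Fin k → L) (hs : ∀ j, s j * s j = (α j : L))
    (c d : Finset (Fin k) → ℚ) :
    evL s (cmul α c d) = evL s c * evL s d := by
  classical
  unfold evL cmul
  rw [Finset.sum_mul_sum]
  have lhs : ∑ U, ((∑ S, ∑ T, (if symmDiff S T = U then (∏ j ∈ S ∩ T, α j) * (c S * d T) else 0)
      : ℚ) : L) * monoL s U =
      ∑ S, ∑ T, ((∏ j ∈ S ∩ T, α j : ℚ) : L) * ((c S : L) * (d T : L)) * monoL s (symmDiff S T) := by
    simp only [Rat.cast_sum, Finset.sum_mul]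
    rw [Finset.sum_comm]
    refine Finset.sum_congr rfl fun S _ => ?_
    rw [Finset.sum_comm]
    refine Finset.sum_congr rfl fun T _ => ?_
    rw [Finset.sum_eq_single (symmDiff S T)]
    · simp
    · intro U _ hU; rw [if_neg (Ne.symm hU)]; simp
    · intro h; exact absurd (Finset.mem_univ _) h
  rw [lhs]
  refine Finset.sum_congr rfl fun S _ => Finset.sum_congr rfl fun T _ => ?_
  have key := monoL_mul_monoL α s hs S T
  calc ((∏ j ∈ S ∩ T, α j : ℚ) : L) * ((c S : L) * (d T : L)) * monoL s (symmDiff S T)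
      = ((c S : L) * (d T : L)) * (((∏ j ∈ S ∩ T, α j : ℚ) : L) * monoL s (symmDiff S T)) := by
        ring
    _ = ((c S : L) * (d T : L)) * (monoL s S * monoL s T) := by rw [key]
    _ = (c S : L) * monoL s S * ((d T : L) * monoL s T) := by ring

/-! ### Linear independence of the monomials under the `2`-Kummer condition -/

/-- **`[ℚ(s₀, …, s_{n-1}) : ℚ] = 2ⁿ`** for roots `sⱼ ∈ L`, `sⱼ² = αⱼ ∈ ℚ`, when no product of a
non-empty subfamily of the `αⱼ` is a square in `ℚ` — in ANY field `L` of characteristic zero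
(the tree's `Multiquadratic.finrank_adjoin_image_sqrt_and_sq` specialised to `K = ℚ`). [folklore]
[cite: CijsouwWaldschmidt1977, §3 (source FOLLOWED for Baker’s 2-descent whose multiquadratic algebra this module re-does in an arbitrary field of characteristic 0; the cell’s own algebra, NOT a printed statement)] -/
theorem finrank_adjoin_root_eq_two_pow {n : ℕ} (α : Fin n → ℚ)
    (hind : ∀ T : Finset (Fin n), T.Nonempty → ¬ IsSquare (∏ j ∈ T, α j))
    (s : Fin n → L) (hs : ∀ j, s j * s j = (α j : L)) :
    Module.finrank ℚ ↥(IntermediateField.adjoin ℚ (Set.range s)) = 2 ^ n := by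
  classical
  set c : ℕ → ℚ := fun i => if h : i < n then α ⟨i, h⟩ else 0 with hc
  set y : ℕ → L := fun i => if h : i < n then s ⟨i, h⟩ else 0 with hy
  have hyc : ∀ i, algebraMap ℚ L (c i) = y i * y i := by
    intro i
    rw [eq_ratCast]
    simp only [hc, hy]
    split_ifs with h
    · exact (hs _).symm
    · simp
  have hrange : Set.range s = (y '' {i | i < n}) := by
    ext z
    simp only [Set.mem_range, Set.mem_image, Set.mem_setOf_eq]
    constructor
    · rintro ⟨j, rfl⟩
      refine ⟨j, j.2, ?_⟩
      simp [hy, j.2]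
    · rintro ⟨i, hi, rfl⟩
      refine ⟨⟨i, hi⟩, ?_⟩
      simp [hy, hi]
  have hind' : ∀ T : Finset ℕ, (∀ i ∈ T, i < n) → T.Nonempty → ¬ IsSquare (∏ i ∈ T, c i) := by
    intro T hT hTne hsq
    set T' : Finset (Fin n) := Finset.univ.filter fun j => (j : ℕ) ∈ T with hT'
    have hmap : T'.map Fin.valEmbedding = T := by
      ext i
      simp only [Finset.mem_map, Finset.mem_filter, Finset.mem_univ, true_and,
        Fin.valEmbedding_apply, hT']
      constructor
      · rintro ⟨j, hj, rfl⟩; exact hj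
      · intro hi; exact ⟨⟨i, hT i hi⟩, hi, rfl⟩
    have hprod : ∏ i ∈ T, c i = ∏ j ∈ T', α j := by
      rw [← hmap, Finset.prod_map]
      refine Finset.prod_congr rfl fun j _ => ?_
      simp [hc, j.2]
    have hT'ne : T'.Nonempty := by
      obtain ⟨i, hi⟩ := hTne
      exact ⟨⟨i, hT i hi⟩, by simp [hT', hi]⟩
    exact hind T' hT'ne (hprod ▸ hsq)
  rw [hrange]
  exact (Literature.Barriers.ABC.Multiquadratic.finrank_adjoin_image_sqrt_and_sq two_ne_zero y c
    hyc n hind' n le_rfl).1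

/-- **The root monomials are `ℚ`-linearly independent in `L`** under the `2`-Kummer condition
(their `ℚ`-span is a subalgebra containing the roots, hence the field `ℚ(s₀, …, s_{n-1})` of degree
`2ⁿ`). [folklore]
[cite: CijsouwWaldschmidt1977, §3 (source FOLLOWED for Baker’s 2-descent whose multiquadratic algebra this module re-does in an arbitrary field of characteristic 0; the cell’s own algebra, NOT a printed statement)] -/
theorem linearIndependent_monoL {n : ℕ} (α : Fin n → ℚ)
    (hind : ∀ T : Finset (Fin n), T.Nonempty → ¬ IsSquare (∏ j ∈ T, α j))
    (s : Fin n → L) (hs : ∀ j, s j * s j = (α j : L)) :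
    LinearIndependent ℚ (fun S : Finset (Fin n) => monoL s S) := by
  classical
  set v : Finset (Fin n) → L := fun S => monoL s S with hv
  set E : IntermediateField ℚ L := IntermediateField.adjoin ℚ (Set.range s) with hE
  have hfin : Module.finrank ℚ ↥E = 2 ^ n := finrank_adjoin_root_eq_two_pow α hind s hs
  set V : Submodule ℚ L := Submodule.span ℚ (Set.range v) with hV
  have hVmul : ∀ x y, x ∈ V → y ∈ V → x * y ∈ V := by
    intro x y hx hy
    have hxy : x * y ∈ V * V := Submodule.mul_mem_mul hx hy
    rw [hV, Submodule.span_mul_span] at hxy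
    refine (Submodule.span_le.mpr ?_) hxy
    rintro _ ⟨a, ⟨S, rfl⟩, b, ⟨T, rfl⟩, rfl⟩
    show v S * v T ∈ Submodule.span ℚ (Set.range v)
    have hprod : v S * v T = (∏ j ∈ S ∩ T, α j : ℚ) • v (symmDiff S T) := by
      rw [Rat.smul_def]
      exact monoL_mul_monoL α s hs S T
    rw [hprod]
    exact Submodule.smul_mem _ _ (Submodule.subset_span ⟨symmDiff S T, rfl⟩)
  have h1 : (1 : L) ∈ V := Submodule.subset_span ⟨∅, by simp [hv, monoL]⟩
  set A : Subalgebra ℚ L := V.toSubalgebra h1 hVmul with hA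
  have halg : ∀ x ∈ Set.range s, IsAlgebraic ℚ x := by
    rintro _ ⟨j, rfl⟩
    have hint : IsIntegral ℚ (s j ^ 2) := by
      have : s j ^ 2 = algebraMap ℚ L (α j) := by rw [sq, hs j, eq_ratCast]
      rw [this]; exact isIntegral_algebraMap
    exact (hint.of_pow two_pos).isAlgebraic
  have hEA : E.toSubalgebra ≤ A := by
    rw [hE, IntermediateField.adjoin_toSubalgebra_of_isAlgebraic halg]
    refine Algebra.adjoin_le ?_
    rintro _ ⟨j, rfl⟩
    show s j ∈ V
    exact Submodule.subset_span ⟨{j}, by simp [hv, monoL]⟩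
  have hVE : V = Subalgebra.toSubmodule E.toSubalgebra := by
    apply le_antisymm
    · rw [hV, Submodule.span_le]
      rintro _ ⟨S, rfl⟩
      show v S ∈ E
      exact prod_mem fun j _ => IntermediateField.subset_adjoin ℚ _ ⟨j, rfl⟩
    · intro x hx; exact hEA hx
  rw [linearIndependent_iff_card_eq_finrank_span, Fintype.card_finset, Fintype.card_fin]
  show 2 ^ n = Module.finrank ℚ ↥(Submodule.span ℚ (Set.range v))
  rw [← hV, hVE, Subalgebra.finrank_toSubmodule]
  exact hfin.symm

/-- **A non-zero coefficient vector has a non-zero evaluation** (under the `2`-Kummer condition).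
[folklore]
[cite: CijsouwWaldschmidt1977, §3 (source FOLLOWED for Baker’s 2-descent whose multiquadratic algebra this module re-does in an arbitrary field of characteristic 0; the cell’s own algebra, NOT a printed statement)] -/
theorem evL_ne_zero (α : Fin k → ℚ)
    (hind : ∀ T : Finset (Fin k), T.Nonempty → ¬ IsSquare (∏ j ∈ T, α j))
    (s : Fin k → L) (hs : ∀ j, s j * s j = (α j : L))
    {c : Finset (Fin k) → ℚ} (hc : c ≠ 0) : evL s c ≠ 0 := by
  intro h0
  apply hc
  have hli := linearIndependent_monoL α hind s hs
  rw [linearIndependent_iff'] at hli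
  have h0' : ∑ S ∈ (univ : Finset (Finset (Fin k))), c S • monoL s S = 0 := by
    rw [← h0]; unfold evL
    refine Finset.sum_congr rfl fun S _ => ?_
    rw [Rat.smul_def]
  funext S
  exact hli univ c h0' S (Finset.mem_univ S)

/-! ### Splitting off the last root -/

variable (s' : Fin (k + 1) → L)

/-- The first `k` roots. [folklore]
[cite: CijsouwWaldschmidt1977, §3 (source FOLLOWED for Baker’s 2-descent whose multiquadratic algebra this module re-does in an arbitrary field of characteristic 0; the cell’s own algebra, NOT a printed statement)] -/
abbrev initL : Fin k → L := fun j => s' (Fin.castSucc j)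

omit [CharZero L] in
/-- Monomials without the last root. [folklore]
[cite: CijsouwWaldschmidt1977, §3 (source FOLLOWED for Baker’s 2-descent whose multiquadratic algebra this module re-does in an arbitrary field of characteristic 0; the cell’s own algebra, NOT a printed statement)] -/
theorem monoL_map (S : Finset (Fin k)) : monoL s' (S.map Fin.castSuccEmb) = monoL (initL s') S := by
  unfold monoL initL
  rw [Finset.prod_map]
  rfl

omit [CharZero L] in
/-- Monomials with the last root: `monoL (insert last S) = s_k · monoL S`. [folklore]
[cite: CijsouwWaldschmidt1977, §3 (source FOLLOWED for Baker’s 2-descent whose multiquadratic algebra this module re-does in an arbitrary field of characteristic 0; the cell’s own algebra, NOT a printed statement)] -/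
theorem monoL_insert (S : Finset (Fin k)) :
    monoL s' (insert (Fin.last k) (S.map Fin.castSuccEmb)) = s' (Fin.last k) * monoL (initL s') S := by
  rw [← monoL_map s' S]
  unfold monoL
  rw [Finset.prod_insert (last_not_mem_map S)]

omit [CharZero L] in
/-- **`evL s' c = evL s (lo c) + s_k · evL s (hi c)`.** [folklore]
[cite: CijsouwWaldschmidt1977, §3 (source FOLLOWED for Baker’s 2-descent whose multiquadratic algebra this module re-does in an arbitrary field of characteristic 0; the cell’s own algebra, NOT a printed statement)] -/
theorem evL_succ (c : Finset (Fin (k + 1)) → ℚ) :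
    evL s' c = evL (initL s') (lo c) + s' (Fin.last k) * evL (initL s') (hi c) := by
  unfold evL
  rw [sum_finset_succ, Finset.mul_sum]
  congr 1
  · refine Finset.sum_congr rfl fun S _ => ?_
    rw [monoL_map]; rfl
  · refine Finset.sum_congr rfl fun S _ => ?_
    rw [monoL_insert]; unfold hi; ring

/-- `evL s' (conjLast c) = evL s (lo c) − s_k · evL s (hi c)`. [folklore]
[cite: CijsouwWaldschmidt1977, §3 (source FOLLOWED for Baker’s 2-descent whose multiquadratic algebra this module re-does in an arbitrary field of characteristic 0; the cell’s own algebra, NOT a printed statement)] -/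
theorem evL_conjLast (c : Finset (Fin (k + 1)) → ℚ) :
    evL s' (conjLast c) = evL (initL s') (lo c) - s' (Fin.last k) * evL (initL s') (hi c) := by
  rw [evL_succ, lo_conjLast, hi_conjLast, evL_neg]; ring

omit [CharZero L] in
/-- The roots of the first `k` generators square to the first `k` generators. [folklore]
[cite: CijsouwWaldschmidt1977, §3 (source FOLLOWED for Baker’s 2-descent whose multiquadratic algebra this module re-does in an arbitrary field of characteristic 0; the cell’s own algebra, NOT a printed statement)] -/
theorem initL_sq (α' : Fin (k + 1) → ℚ) (hs : ∀ j, s' j * s' j = (α' j : L)) (j : Fin k) :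
    initL s' j * initL s' j = (init α' j : L) := hs _

end Multiquad

end Literature.NumberTheory.Transcendental.StewartYu

end Part1

/-!
## Part 2 — port of `Summits/ABC/StewartYu/DescentSetupQ.lean`

# Cell abc-stewartyu, WP-A3 (iv): the SIGN-FREE set-up of the `2`-descent and its rational cores

`Summits/ABC/StewartYu/DescentSetupQ.lean` — cell `abc-stewartyu` (HOME
`run/shared/lean/pub/abc-stewartyu/`, seat p3; work package WP-A3 / the "copy-port" of
`HOME/plan/PORT-MAP.md` §0-ERRATUM; plain definitions and theorems, no named fact).

The tree's Cijsouw–Waldschmidt 1977 / Waldschmidt 1980 development over `ℚ`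
(`Literature.NumberTheory.Transcendental.CW77`, files `CijsouwWaldschmidt1977{Setup,Steps}.lean`,
`Waldschmidt1980*.lean`) is written on `CW77.Setup`, whose generators `αⱼ, θ` are POSITIVE
rationals (fields `α_pos`, `θ_pos`): positivity is what makes the real logarithms and the real
square roots of the archimedean proof available.  The `p`-adic port (blueprint
`HOME/p2/PADIC-CORE.md`) works with the principal-unit generators delivered by WP-M, which are
sign-normalised (`αⱼ ≡ 1 (mod p)`) and are NEGATIVE exactly when `−1 ∈ ⟨q₁, …, q_m⟩ ≤ (ℤ/p)ˣ`
(planner's FLAG F-plan-2), so `CW77.Setup` cannot be instantiated.  This file provides the sign-free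
data and the SIGNED rational cores, re-using every sign-blind object of the tree through the
"flattening" `S♭ = ⟨|α|, |θ|, b, b_θ⟩ : CW77.Setup`:

* `SetupQ` — `d` non-zero rationals `αⱼ`, a non-zero rational `θ`, integers `bⱼ`, `b_θ ≠ 0`
  (`CW77.Setup` with `α_pos/θ_pos` weakened to `α_ne/θ_ne`; NO `p`-adic field: the `p`-adic data
  of WP-A2 are a `SetupQ` plus `p` and `ord_p(αⱼ − 1) ≥ 1`); `SetupQ.flat = S♭`;
* sign-blind objects are those of `S♭`, used as `Q.flat.qΔ`, `Q.flat.qA`, `Q.flat.γ`, `Q.flat.box`,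
  `Q.flat.reidx`, `Q.flat.halve`, `Q.flat.expn`, `Q.flat.Sset`, `Q.flat.Dclear`, `Q.flat.Dhalf`, …
  (they depend on the generators only through `d`, `b`, `b_θ` and the denominators);
* SIGNED objects (this file): `all = (α, θ)`, `qE = ∏ αⱼ^{λⱼ s} θ^{λ_θ s}`, `qTerm = qΔ · qA · qE`,
  `coreSum = ∑ p(u) qTerm`, `qEh = ∏ allᵢ^{⌊expnᵢ/2⌋}`, `rHalf = qΔ_{J+1} · qA · qEh`, the class sums
  `classVec`, `Kfac`; and the bridges `|qE| = qE♭`, `|qEh| = qEh♭`, `|qTerm| = |qTerm♭|`,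
  `|rHalf| = |rHalf♭|` by which every archimedean SIZE estimate of the tree (`Waldschmidt1980Sizes*`)
  transfers verbatim;
* the re-indexing identities `qEh_reidx`, `rHalf_reidx` (proofs of the tree verbatim);
* **the place-free half-point identity** (`prod_root_pow_expn`, `sum_half_eq_evL_classVec`): in ANY
  field `L` of characteristic `0` with chosen square roots `rᵢ² = allᵢ`,
  `∏ᵢ rᵢ^{expnᵢ(u,s)} = qEh(u,s) · ∏_{i ∈ Sset(u,s)} rᵢ` and hence
  `∑_u p(u) · c(u) · ∏ᵢ rᵢ^{expnᵢ} = evL r (class sums of p·c)` — the algebraic content of the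
  tree's `CW77.Setup.cexp_ψ_half` / `Φ_half'` (there `L = ℝ ⊂ ℂ`, `rᵢ = √allᵢ`); `p`-adically
  `L = ℚ_p` and `rᵢ = psqrt(allᵢ)` (`PadicPrincipalUnitSqrt.lean`).

Nothing here is claimed to be in print; the objects are those of [CijsouwWaldschmidt1977, §4] with
signs allowed.  Everything is [folklore].
-/

section Part2

open _root_.Finset
open Literature.NumberTheory.Transcendental
open Literature.NumberTheory.Transcendental.CW77
open Literature.NumberTheory.Transcendental.CW77.Setup (Idx Tau tauNorm scale)

namespace Literature.NumberTheory.Transcendental.StewartYu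

/-- **The sign-free data of the `2`-descent**: `d` non-zero rationals `αⱼ`, the eliminated non-zero
rational `θ`, and the integer coefficients `bⱼ`, `b_θ ≠ 0` of the linear form
`∑ bⱼ log αⱼ + b_θ log θ` (`CW77.Setup` without positivity). [folklore]
[cite: CijsouwWaldschmidt1977, §§2–3 with Waldschmidt1980, §3.2 (sources FOLLOWED: the archimedean set-up of the 2-descent, transcribed sign-free by the cell; the cell’s adaptation, NOT a printed statement)] -/
structure SetupQ where
  /-- the number of free generators -/
  d : ℕ
  /-- the free generators -/
  α : Fin d → ℚ
  /-- the eliminated generator -/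
  θ : ℚ
  /-- non-vanishing -/
  α_ne : ∀ j, α j ≠ 0
  /-- non-vanishing -/
  θ_ne : θ ≠ 0
  /-- the coefficients of the free logarithms -/
  b : Fin d → ℤ
  /-- the coefficient of `log θ` -/
  bθ : ℤ
  /-- it is non-zero -/
  bθ_ne : bθ ≠ 0

namespace SetupQ

variable (Q : SetupQ) {h Lb : ℕ}

/-! ### The flattening `S♭ = ⟨|α|, |θ|⟩` and the signed generators -/

/-- The flattened POSITIVE set-up `S♭ = ⟨d, |α|, |θ|, b, b_θ⟩ : CW77.Setup`; all sign-blind objects of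
the descent are taken from it. [folklore]
[cite: CijsouwWaldschmidt1977, §§2–3 with Waldschmidt1980, §3.2 (sources FOLLOWED: the archimedean set-up of the 2-descent, transcribed sign-free by the cell; the cell’s adaptation, NOT a printed statement)] -/
abbrev flat : CW77.Setup where
  d := Q.d
  α := fun j => |Q.α j|
  θ := |Q.θ|
  α_pos := fun j => abs_pos.mpr (Q.α_ne j)
  θ_pos := abs_pos.mpr Q.θ_ne
  b := Q.b
  bθ := Q.bθ
  bθ_ne := Q.bθ_ne

/-- All `d + 1` signed generators: `αⱼ` (`j < d`) and `θ` (last). [folklore]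
[cite: CijsouwWaldschmidt1977, §§2–3 with Waldschmidt1980, §3.2 (sources FOLLOWED: the archimedean set-up of the 2-descent, transcribed sign-free by the cell; the cell’s adaptation, NOT a printed statement)] -/
def all : Fin (Q.d + 1) → ℚ := Fin.snoc Q.α Q.θ

/-- The signed generators are non-zero. [folklore]
[cite: CijsouwWaldschmidt1977, §§2–3 with Waldschmidt1980, §3.2 (sources FOLLOWED: the archimedean set-up of the 2-descent, transcribed sign-free by the cell; the cell’s adaptation, NOT a printed statement)] -/
theorem all_ne (i : Fin (Q.d + 1)) : Q.all i ≠ 0 := by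
  unfold all
  refine Fin.lastCases ?_ (fun j => ?_) i
  · rw [Fin.snoc_last]; exact Q.θ_ne
  · rw [Fin.snoc_castSucc]; exact Q.α_ne j

/-- `all♭ᵢ = |allᵢ|`. [folklore]
[cite: CijsouwWaldschmidt1977, §§2–3 with Waldschmidt1980, §3.2 (sources FOLLOWED: the archimedean set-up of the 2-descent, transcribed sign-free by the cell; the cell’s adaptation, NOT a printed statement)] -/
theorem flat_all (i : Fin (Q.d + 1)) : Q.flat.all i = |Q.all i| := by
  unfold CW77.Setup.all all
  refine Fin.lastCases ?_ (fun j => ?_) i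
  · simp only [Fin.snoc_last]
  · simp only [Fin.snoc_castSucc]

/-- Components of `expn♭` (restated with `Q.d` in the index type, for rewriting). [folklore]
[cite: CijsouwWaldschmidt1977, §§2–3 with Waldschmidt1980, §3.2 (sources FOLLOWED: the archimedean set-up of the 2-descent, transcribed sign-free by the cell; the cell’s adaptation, NOT a printed statement)] -/
@[simp] theorem flat_expn_castSucc (u : Idx Q.d h Lb) (s : ℕ) (j : Fin Q.d) :
    Q.flat.expn u s (Fin.castSucc j) = u.2.1 j * s := CW77.Setup.expn_castSucc Q.flat u s j

/-- Components of `expn♭`. [folklore]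
[cite: CijsouwWaldschmidt1977, §§2–3 with Waldschmidt1980, §3.2 (sources FOLLOWED: the archimedean set-up of the 2-descent, transcribed sign-free by the cell; the cell’s adaptation, NOT a printed statement)] -/
@[simp] theorem flat_expn_last (u : Idx Q.d h Lb) (s : ℕ) : Q.flat.expn u s (Fin.last Q.d) = u.2.2 * s :=
  CW77.Setup.expn_last Q.flat u s

/-- Components of `resVec♭`. [folklore]
[cite: CijsouwWaldschmidt1977, §§2–3 with Waldschmidt1980, §3.2 (sources FOLLOWED: the archimedean set-up of the 2-descent, transcribed sign-free by the cell; the cell’s adaptation, NOT a printed statement)] -/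
@[simp] theorem flat_resVec_castSucc (ε : Fin Q.d → ℕ) (εθ : ℕ) (j : Fin Q.d) :
    Q.flat.resVec ε εθ (Fin.castSucc j) = ε j := CW77.Setup.resVec_castSucc Q.flat ε εθ j

/-- Components of `resVec♭`. [folklore]
[cite: CijsouwWaldschmidt1977, §§2–3 with Waldschmidt1980, §3.2 (sources FOLLOWED: the archimedean set-up of the 2-descent, transcribed sign-free by the cell; the cell’s adaptation, NOT a printed statement)] -/
@[simp] theorem flat_resVec_last (ε : Fin Q.d → ℕ) (εθ : ℕ) : Q.flat.resVec ε εθ (Fin.last Q.d) = εθ :=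
  CW77.Setup.resVec_last Q.flat ε εθ

/-- Components of `reidx♭`. [folklore]
[cite: CijsouwWaldschmidt1977, §§2–3 with Waldschmidt1980, §3.2 (sources FOLLOWED: the archimedean set-up of the 2-descent, transcribed sign-free by the cell; the cell’s adaptation, NOT a printed statement)] -/
@[simp] theorem flat_reidx_fst (ε : Fin Q.d → ℕ) (εθ : ℕ) (v : Idx Q.d h Lb) :
    (Q.flat.reidx ε εθ v).1 = v.1 := rfl

/-- Components of `reidx♭`. [folklore]
[cite: CijsouwWaldschmidt1977, §§2–3 with Waldschmidt1980, §3.2 (sources FOLLOWED: the archimedean set-up of the 2-descent, transcribed sign-free by the cell; the cell’s adaptation, NOT a printed statement)] -/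
@[simp] theorem flat_reidx_snd_fst (ε : Fin Q.d → ℕ) (εθ : ℕ) (v : Idx Q.d h Lb) (j : Fin Q.d) :
    (Q.flat.reidx ε εθ v).2.1 j = ε j + 2 * v.2.1 j := rfl

/-- Components of `reidx♭`. [folklore]
[cite: CijsouwWaldschmidt1977, §§2–3 with Waldschmidt1980, §3.2 (sources FOLLOWED: the archimedean set-up of the 2-descent, transcribed sign-free by the cell; the cell’s adaptation, NOT a printed statement)] -/
@[simp] theorem flat_reidx_snd_snd (ε : Fin Q.d → ℕ) (εθ : ℕ) (v : Idx Q.d h Lb) :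
    (Q.flat.reidx ε εθ v).2.2 = εθ + 2 * v.2.2 := rfl

/-! ### The signed rational cores at the natural points -/

/-- `qE(u, s) = ∏ⱼ αⱼ^{λⱼ s} · θ^{λ_θ s}` (signed). [folklore]
[cite: CijsouwWaldschmidt1977, §§2–3 with Waldschmidt1980, §3.2 (sources FOLLOWED: the archimedean set-up of the 2-descent, transcribed sign-free by the cell; the cell’s adaptation, NOT a printed statement)] -/
def qE (u : Idx Q.d h Lb) (s : ℕ) : ℚ := (∏ j, Q.α j ^ (u.2.1 j * s)) * Q.θ ^ (u.2.2 * s)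

/-- `qE = ∏ᵢ allᵢ^{expnᵢ}` over all `d + 1` generators. [folklore]
[cite: CijsouwWaldschmidt1977, §§2–3 with Waldschmidt1980, §3.2 (sources FOLLOWED: the archimedean set-up of the 2-descent, transcribed sign-free by the cell; the cell’s adaptation, NOT a printed statement)] -/
theorem qE_eq_prod_all (u : Idx Q.d h Lb) (s : ℕ) : Q.qE u s = ∏ i, Q.all i ^ Q.flat.expn u s i := by
  unfold qE all CW77.Setup.expn
  rw [Fin.prod_univ_castSucc]
  simp only [Fin.snoc_castSucc, Fin.snoc_last]

/-- `qE ≠ 0`. [folklore]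
[cite: CijsouwWaldschmidt1977, §§2–3 with Waldschmidt1980, §3.2 (sources FOLLOWED: the archimedean set-up of the 2-descent, transcribed sign-free by the cell; the cell’s adaptation, NOT a printed statement)] -/
theorem qE_ne (u : Idx Q.d h Lb) (s : ℕ) : Q.qE u s ≠ 0 := by
  rw [Q.qE_eq_prod_all]
  exact prod_ne_zero_iff.mpr fun i _ => pow_ne_zero _ (Q.all_ne i)

/-- **Bridge**: `|qE(u,s)| = qE♭(u,s)`. [folklore]
[cite: CijsouwWaldschmidt1977, §§2–3 with Waldschmidt1980, §3.2 (sources FOLLOWED: the archimedean set-up of the 2-descent, transcribed sign-free by the cell; the cell’s adaptation, NOT a printed statement)] -/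
theorem abs_qE (u : Idx Q.d h Lb) (s : ℕ) : |Q.qE u s| = Q.flat.qE u s := by
  unfold qE CW77.Setup.qE
  rw [abs_mul, abs_prod]
  simp only [abs_pow]

/-- `qE♭ > 0`. [folklore]
[cite: CijsouwWaldschmidt1977, §§2–3 with Waldschmidt1980, §3.2 (sources FOLLOWED: the archimedean set-up of the 2-descent, transcribed sign-free by the cell; the cell’s adaptation, NOT a printed statement)] -/
theorem flat_qE_pos (u : Idx Q.d h Lb) (s : ℕ) : 0 < Q.flat.qE u s := by
  unfold CW77.Setup.qE
  exact mul_pos (prod_pos fun j _ => pow_pos (Q.flat.α_pos j) _) (pow_pos Q.flat.θ_pos _)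

/-- `qEh♭ > 0`. [folklore]
[cite: CijsouwWaldschmidt1977, §§2–3 with Waldschmidt1980, §3.2 (sources FOLLOWED: the archimedean set-up of the 2-descent, transcribed sign-free by the cell; the cell’s adaptation, NOT a printed statement)] -/
theorem flat_qEh_pos (u : Idx Q.d h Lb) (s : ℕ) : 0 < Q.flat.qEh u s := by
  unfold CW77.Setup.qEh
  exact prod_pos fun i _ => pow_pos (Q.flat.all_pos i) _

/-- The signed rational core of one term at a natural point: `qΔ♭ · qA♭ · qE`. [folklore]
[cite: CijsouwWaldschmidt1977, §§2–3 with Waldschmidt1980, §3.2 (sources FOLLOWED: the archimedean set-up of the 2-descent, transcribed sign-free by the cell; the cell’s adaptation, NOT a printed statement)] -/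
def qTerm (J₀ J : ℕ) (u : Idx Q.d h Lb) (τ : Tau Q.d) (s : ℕ) : ℚ :=
  Q.flat.qΔ J₀ J u τ.1 s * Q.flat.qA u τ.2 * Q.qE u s

/-- **Bridge**: `|qTerm| = |qTerm♭|`. [folklore]
[cite: CijsouwWaldschmidt1977, §§2–3 with Waldschmidt1980, §3.2 (sources FOLLOWED: the archimedean set-up of the 2-descent, transcribed sign-free by the cell; the cell’s adaptation, NOT a printed statement)] -/
theorem abs_qTerm (J₀ J : ℕ) (u : Idx Q.d h Lb) (τ : Tau Q.d) (s : ℕ) :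
    |Q.qTerm J₀ J u τ s| = |Q.flat.qTerm J₀ J u τ s| := by
  unfold qTerm CW77.Setup.qTerm
  rw [abs_mul, abs_mul, Q.abs_qE, abs_mul, abs_mul, abs_of_pos (Q.flat_qE_pos u s)]

/-- **The signed rational core of `φ_{J,τ}(s)`**: `coreSum = ∑_u p(u) · qTerm`. [folklore]
[cite: CijsouwWaldschmidt1977, §§2–3 with Waldschmidt1980, §3.2 (sources FOLLOWED: the archimedean set-up of the 2-descent, transcribed sign-free by the cell; the cell’s adaptation, NOT a printed statement)] -/
def coreSum (J₀ J : ℕ) (box : Finset (Idx Q.d h Lb)) (p : Idx Q.d h Lb → ℤ) (τ : Tau Q.d) (s : ℕ) : ℚ :=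
  ∑ u ∈ box, (p u : ℚ) * Q.qTerm J₀ J u τ s

/-! ### The signed rational cores at the half points -/

/-- The rational part `qEh = ∏ᵢ allᵢ^{⌊expnᵢ/2⌋}` of the value at `s/2` (signed). [folklore]
[cite: CijsouwWaldschmidt1977, §§2–3 with Waldschmidt1980, §3.2 (sources FOLLOWED: the archimedean set-up of the 2-descent, transcribed sign-free by the cell; the cell’s adaptation, NOT a printed statement)] -/
def qEh (u : Idx Q.d h Lb) (s : ℕ) : ℚ := ∏ i, Q.all i ^ (Q.flat.expn u s i / 2)

/-- `qEh ≠ 0`. [folklore]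
[cite: CijsouwWaldschmidt1977, §§2–3 with Waldschmidt1980, §3.2 (sources FOLLOWED: the archimedean set-up of the 2-descent, transcribed sign-free by the cell; the cell’s adaptation, NOT a printed statement)] -/
theorem qEh_ne (u : Idx Q.d h Lb) (s : ℕ) : Q.qEh u s ≠ 0 :=
  prod_ne_zero_iff.mpr fun i _ => pow_ne_zero _ (Q.all_ne i)

/-- **Bridge**: `|qEh(u,s)| = qEh♭(u,s)`. [folklore]
[cite: CijsouwWaldschmidt1977, §§2–3 with Waldschmidt1980, §3.2 (sources FOLLOWED: the archimedean set-up of the 2-descent, transcribed sign-free by the cell; the cell’s adaptation, NOT a printed statement)] -/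
theorem abs_qEh (u : Idx Q.d h Lb) (s : ℕ) : |Q.qEh u s| = Q.flat.qEh u s := by
  unfold qEh CW77.Setup.qEh
  rw [abs_prod]
  refine prod_congr rfl fun i _ => ?_
  rw [abs_pow, Q.flat_all]

/-- The signed coefficient of one unknown at `s/2`: `rHalf = qΔ♭_{J+1} · qA♭ · qEh`. [folklore]
[cite: CijsouwWaldschmidt1977, §§2–3 with Waldschmidt1980, §3.2 (sources FOLLOWED: the archimedean set-up of the 2-descent, transcribed sign-free by the cell; the cell’s adaptation, NOT a printed statement)] -/
def rHalf (J₀ J : ℕ) (u : Idx Q.d h Lb) (τ : Tau Q.d) (s : ℕ) : ℚ :=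
  Q.flat.qΔ J₀ (J + 1) u τ.1 s * Q.flat.qA u τ.2 * Q.qEh u s

/-- **Bridge**: `|rHalf| = |rHalf♭|`. [folklore]
[cite: CijsouwWaldschmidt1977, §§2–3 with Waldschmidt1980, §3.2 (sources FOLLOWED: the archimedean set-up of the 2-descent, transcribed sign-free by the cell; the cell’s adaptation, NOT a printed statement)] -/
theorem abs_rHalf (J₀ J : ℕ) (u : Idx Q.d h Lb) (τ : Tau Q.d) (s : ℕ) :
    |Q.rHalf J₀ J u τ s| = |Q.flat.rHalf J₀ J u τ s| := by
  unfold rHalf CW77.Setup.rHalf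
  rw [abs_mul, abs_mul, Q.abs_qEh, abs_mul, abs_mul]
  congr 1
  exact (abs_of_pos (Q.flat_qEh_pos u s)).symm

/-- **The signed class sums**: the coefficient of the monomial `∏_{i∈T'} rᵢ` in the value at `s/2`.
[folklore]
[cite: CijsouwWaldschmidt1977, §§2–3 with Waldschmidt1980, §3.2 (sources FOLLOWED: the archimedean set-up of the 2-descent, transcribed sign-free by the cell; the cell’s adaptation, NOT a printed statement)] -/
def classVec (J₀ J : ℕ) (box : Finset (Idx Q.d h Lb)) (p : Idx Q.d h Lb → ℤ) (τ : Tau Q.d) (s : ℕ)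
    (T' : Finset (Fin (Q.d + 1))) : ℚ :=
  ∑ u ∈ box with Q.flat.Sset u s = T', (p u : ℚ) * Q.rHalf J₀ J u τ s

/-- `∑_{T'} |classVec(T')| ≤ ∑_u |p(u)| |rHalf(u)|`. [folklore]
[cite: CijsouwWaldschmidt1977, §§2–3 with Waldschmidt1980, §3.2 (sources FOLLOWED: the archimedean set-up of the 2-descent, transcribed sign-free by the cell; the cell’s adaptation, NOT a printed statement)] -/
theorem sum_abs_classVec_le (J₀ J : ℕ) (box : Finset (Idx Q.d h Lb)) (p : Idx Q.d h Lb → ℤ)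
    (τ : Tau Q.d) (s : ℕ) :
    ∑ T', |(Q.classVec J₀ J box p τ s T' : ℝ)| ≤ ∑ u ∈ box, |(p u : ℝ)| * |(Q.rHalf J₀ J u τ s : ℝ)| := by
  classical
  unfold classVec
  push_cast
  calc ∑ T', |∑ u ∈ box with Q.flat.Sset u s = T', (p u : ℝ) * (Q.rHalf J₀ J u τ s : ℝ)|
      ≤ ∑ T', ∑ u ∈ box with Q.flat.Sset u s = T', |(p u : ℝ) * (Q.rHalf J₀ J u τ s : ℝ)| :=
        sum_le_sum fun T' _ => abs_sum_le_sum_abs _ _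
    _ = ∑ u ∈ box, |(p u : ℝ) * (Q.rHalf J₀ J u τ s : ℝ)| :=
        Finset.sum_fiberwise box (fun u => Q.flat.Sset u s) _
    _ = ∑ u ∈ box, |(p u : ℝ)| * |(Q.rHalf J₀ J u τ s : ℝ)| := sum_congr rfl fun u _ => abs_mul _ _

/-! ### The effect of the re-indexing `λ = λ⁰ + 2μ` on the signed coefficients -/

/-- The constant factor `Kfac = ∏ᵢ allᵢ^{⌊εᵢ s/2⌋}` pulled out of `qEh` (signed). [folklore]
[cite: CijsouwWaldschmidt1977, §§2–3 with Waldschmidt1980, §3.2 (sources FOLLOWED: the archimedean set-up of the 2-descent, transcribed sign-free by the cell; the cell’s adaptation, NOT a printed statement)] -/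
def Kfac (ε : Fin Q.d → ℕ) (εθ s : ℕ) : ℚ := ∏ i : Fin (Q.d + 1), Q.all i ^ (Q.flat.resVec ε εθ i * s / 2)

/-- `Kfac ≠ 0`. [folklore]
[cite: CijsouwWaldschmidt1977, §§2–3 with Waldschmidt1980, §3.2 (sources FOLLOWED: the archimedean set-up of the 2-descent, transcribed sign-free by the cell; the cell’s adaptation, NOT a printed statement)] -/
theorem Kfac_ne (ε : Fin Q.d → ℕ) (εθ s : ℕ) : Q.Kfac ε εθ s ≠ 0 :=
  prod_ne_zero_iff.mpr fun i _ => pow_ne_zero _ (Q.all_ne i)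

/-- **`qEh(reidx v, s) = Kfac · qE(v, s)`** (`((ε + 2μ)s)/2 = (εs)/2 + μs`). [folklore]
[cite: CijsouwWaldschmidt1977, §§2–3 with Waldschmidt1980, §3.2 (sources FOLLOWED: the archimedean set-up of the 2-descent, transcribed sign-free by the cell; the cell’s adaptation, NOT a printed statement)] -/
theorem qEh_reidx (ε : Fin Q.d → ℕ) (εθ : ℕ) (v : Idx Q.d h Lb) (s : ℕ) :
    Q.qEh (Q.flat.reidx ε εθ v) s = Q.Kfac ε εθ s * Q.qE v s := by
  unfold qEh Kfac qE
  rw [Fin.prod_univ_castSucc, Fin.prod_univ_castSucc]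
  simp only [flat_expn_castSucc, flat_expn_last, flat_resVec_castSucc, flat_resVec_last,
    flat_reidx_snd_fst, flat_reidx_snd_snd]
  unfold all
  simp only [Fin.snoc_castSucc, Fin.snoc_last]
  have hsplit : ∀ (a : ℚ) (e m : ℕ), a ^ ((e + 2 * m) * s / 2) = a ^ (e * s / 2) * a ^ (m * s) := by
    intro a e m
    rw [← pow_add]; congr 1
    rw [show (e + 2 * m) * s = e * s + 2 * (m * s) by ring, Nat.add_mul_div_left _ _ two_pos]
  simp_rw [hsplit]
  rw [prod_mul_distrib]
  ring

/-- **`rHalf(reidx v) = (2^{|τ'|} Kfac) · qΔ♭_{J+1}(v) qE(v) · ∏ (γ♭ⱼ(v) + cⱼ)^{τ'ⱼ}`.** [folklore]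
[cite: CijsouwWaldschmidt1977, §§2–3 with Waldschmidt1980, §3.2 (sources FOLLOWED: the archimedean set-up of the 2-descent, transcribed sign-free by the cell; the cell’s adaptation, NOT a printed statement)] -/
theorem rHalf_reidx (J₀ J : ℕ) (ε : Fin Q.d → ℕ) (εθ : ℕ) (v : Idx Q.d h Lb) (τ : Tau Q.d) (s : ℕ) :
    Q.rHalf J₀ J (Q.flat.reidx ε εθ v) τ s =
      (2 ^ (∑ j, τ.2 j) * Q.Kfac ε εθ s) *
        ((Q.flat.qΔ J₀ (J + 1) v τ.1 s * Q.qE v s) * ∏ j, (Q.flat.γ v j + Q.flat.cγ ε εθ j) ^ τ.2 j) := by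
  unfold rHalf
  rw [Q.flat.qΔ_reidx, Q.qEh_reidx, Q.flat.qA_reidx]
  ring

/-! ### The place-free half-point identity -/

section HalfPoint

variable {L : Type*} [Field L] [CharZero L]

omit [CharZero L] in
/-- `r^n = (r·r)^{⌊n/2⌋} · (r if n is odd, else 1)`. [folklore]
[cite: CijsouwWaldschmidt1977, §§2–3 with Waldschmidt1980, §3.2 (sources FOLLOWED: the archimedean set-up of the 2-descent, transcribed sign-free by the cell; the cell’s adaptation, NOT a printed statement)] -/
theorem pow_eq_pow_div_two_mul (r : L) (n : ℕ) :
    r ^ n = (r * r) ^ (n / 2) * (if n % 2 = 1 then r else 1) := by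
  rw [← sq, ← pow_mul]
  conv_lhs => rw [← Nat.div_add_mod n 2, pow_add]
  rcases Nat.mod_two_eq_zero_or_one n with h0 | h1
  · rw [h0, if_neg (by omega), pow_zero]
  · rw [h1, if_pos rfl, pow_one]

/-- **`∏ᵢ rᵢ^{expnᵢ(u,s)} = qEh(u,s) · ∏_{i ∈ Sset(u,s)} rᵢ`** for square roots `rᵢ² = allᵢ` in any
field of characteristic zero (the algebraic content of `CW77.Setup.cexp_ψ_half`). [folklore]
[cite: CijsouwWaldschmidt1977, §§2–3 with Waldschmidt1980, §3.2 (sources FOLLOWED: the archimedean set-up of the 2-descent, transcribed sign-free by the cell; the cell’s adaptation, NOT a printed statement)] -/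
theorem prod_root_pow_expn (r : Fin (Q.d + 1) → L) (hr : ∀ i, r i * r i = (Q.all i : L))
    (u : Idx Q.d h Lb) (s : ℕ) :
    ∏ i, r i ^ Q.flat.expn u s i = (Q.qEh u s : L) * Multiquad.monoL r (Q.flat.Sset u s) := by
  unfold qEh Multiquad.monoL CW77.Setup.Sset
  rw [Rat.cast_prod, Finset.prod_filter, ← prod_mul_distrib]
  refine prod_congr rfl fun i _ => ?_
  rw [pow_eq_pow_div_two_mul (r i), hr i, Rat.cast_pow]

/-- **The value at a half point is the evaluation of the class sums**: for any rational weights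
`c(u)`, `∑_{u ∈ box} p(u) c(u) ∏ᵢ rᵢ^{expnᵢ(u,s)} = evL r (T' ↦ ∑_{u : Sset u s = T'} p(u) c(u) qEh(u,s))`
(the algebraic content of `CW77.Setup.Φ_half'`). [folklore]
[cite: CijsouwWaldschmidt1977, §§2–3 with Waldschmidt1980, §3.2 (sources FOLLOWED: the archimedean set-up of the 2-descent, transcribed sign-free by the cell; the cell’s adaptation, NOT a printed statement)] -/
theorem sum_prod_root_pow_eq_evL (r : Fin (Q.d + 1) → L) (hr : ∀ i, r i * r i = (Q.all i : L))
    (box : Finset (Idx Q.d h Lb)) (p : Idx Q.d h Lb → ℤ) (c : Idx Q.d h Lb → ℚ) (s : ℕ) :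
    ∑ u ∈ box, (p u : L) * (c u : L) * ∏ i, r i ^ Q.flat.expn u s i =
      Multiquad.evL r (fun T' => ∑ u ∈ box with Q.flat.Sset u s = T', (p u : ℚ) * (c u * Q.qEh u s)) := by
  classical
  unfold Multiquad.evL
  have hfib : ∑ u ∈ box, (p u : L) * (c u : L) * ∏ i, r i ^ Q.flat.expn u s i =
      ∑ u ∈ box, ((p u : ℚ) * (c u * Q.qEh u s) : ℚ) * Multiquad.monoL r (Q.flat.Sset u s) := by
    refine sum_congr rfl fun u _ => ?_
    rw [Q.prod_root_pow_expn r hr]; push_cast; ring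
  rw [hfib, ← Finset.sum_fiberwise box (fun u => Q.flat.Sset u s)
    (fun u => (((p u : ℚ) * (c u * Q.qEh u s) : ℚ) : L) * Multiquad.monoL r (Q.flat.Sset u s))]
  refine sum_congr rfl fun T' _ => ?_
  rw [Rat.cast_sum, sum_mul]
  refine sum_congr rfl fun u hu => ?_
  rw [(Finset.mem_filter.mp hu).2]

/-- **`∑_u p(u) · (qΔ♭_{J+1} qA♭)(u) · ∏ᵢ rᵢ^{expnᵢ(u,s)} = evL r (classVec_{J,τ,s})`** — the form in
which the `p`-adic function layer meets the class sums (`c(u) = qΔ♭_{J+1}(u) qA♭(u)`). [folklore]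
[cite: CijsouwWaldschmidt1977, §§2–3 with Waldschmidt1980, §3.2 (sources FOLLOWED: the archimedean set-up of the 2-descent, transcribed sign-free by the cell; the cell’s adaptation, NOT a printed statement)] -/
theorem sum_half_eq_evL_classVec (r : Fin (Q.d + 1) → L) (hr : ∀ i, r i * r i = (Q.all i : L))
    (J₀ J : ℕ) (box : Finset (Idx Q.d h Lb)) (p : Idx Q.d h Lb → ℤ) (τ : Tau Q.d) (s : ℕ) :
    ∑ u ∈ box, (p u : L) * ((Q.flat.qΔ J₀ (J + 1) u τ.1 s * Q.flat.qA u τ.2 : ℚ) : L) *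
        ∏ i, r i ^ Q.flat.expn u s i =
      Multiquad.evL r (Q.classVec J₀ J box p τ s) := by
  rw [Q.sum_prod_root_pow_eq_evL r hr]
  unfold classVec rHalf
  rfl

end HalfPoint

end SetupQ

end Literature.NumberTheory.Transcendental.StewartYu

end Part2

/-!
## Part 3 — port of `Summits/ABC/StewartYu/DescentStepQ.lean`

# Cell abc-stewartyu, WP-A3 (v): one step of the `2`-descent and the endgame, sign-free

`Summits/ABC/StewartYu/DescentStepQ.lean` — cell `abc-stewartyu` (HOME
`run/shared/lean/pub/abc-stewartyu/`, seat p3; the "copy-port" of `HOME/plan/PORT-MAP.md`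
§0-ERRATUM, continued; theorems and one `Prop`-structure, no named fact), sequel to
`DescentSetupQ.lean`.

On the sign-free data `Q : SetupQ` (generators `αⱼ, θ ≠ 0` of either sign) with the SIGNED rational
cores `Q.coreSum`, `Q.classVec` of `DescentSetupQ.lean` and the sign-blind boxes / re-indexing of the
flattening `Q.flat : CW77.Setup`:

* `SetupQ.Inv` — the induction invariant of the descent at level `J` (the tree's `CW77.Setup.Inv`
  with the signed `coreSum`): integers `p(u)` supported in the box of level `J`, not all zero,
  `|p(u)| ≤ P`, and `coreSum_{J,τ}(s) = 0` for all odd `s < 2ᴶ S₀`, `|τ| < T/2ᴶ`;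
* `SetupQ.descent_algebra` — **the algebraic half of one step**, PLACE-FREE: from the invariant at
  level `J` and the vanishing of the CLASS SUMS `classVec_{J,τ,s} = 0` (odd `s < 2^{J+1} S₀`,
  `|τ| < T/2^{J+1}`) to the invariant at level `J + 1`.  This is the tree's
  `CW77.Setup.descent_algebra` [cite: CijsouwWaldschmidt1977, §4 Step 2 (pp. 189–191)] with its
  hypothesis `φ_{J,τ}(s/2) = 0` replaced by what it was used for (`classVec = 0`, there obtained from
  the real square roots via `classVec_eq_zero`); in the `p`-adic proof the class sums are killed
  directly by the `p`-adic Liouville inequality (`PadicMultiquadraticLiouvilleSharp.lean`) and the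
  linear independence of the `p`-adic root monomials (`PadicMultiquadratic.evL_ne_zero`), so neither
  positivity nor the Kummer condition enters THIS file.  Proof text: the tree's, verbatim up to names;
* `SetupQ.coreSum_top_eq`, `SetupQ.w80_endgame` — Waldschmidt's asymmetric endgame at the top level
  `L_θ < 2^{J₀}` (the tree's `CW77.Setup.w80_endgame` [cite: Waldschmidt1980, §3.5 (p. 274)], whose
  abstract core `Waldschmidt1980.endgame` only needs `αⱼ ≠ 0`).

Everything is [folklore] (our own book-keeping on published arguments; nothing new is claimed).
-/

section Part3

open _root_.Finset _root_.Polynomial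
open Literature.NumberTheory.Transcendental
open Literature.NumberTheory.Transcendental.CW77
open Literature.NumberTheory.Transcendental.CW77.Setup (Idx Tau tauNorm scale)

namespace Literature.NumberTheory.Transcendental.StewartYu

namespace SetupQ

variable (Q : SetupQ) {h Lb : ℕ}

/-! ### The invariant -/

/-- **The induction invariant of the descent at level `J`** (signed version of `CW77.Setup.Inv`):
integers `p(u)`, supported in the box of level `J`, not all zero, bounded by `P`, with the relations
`coreSum_{J,τ}(s) = 0` for all odd `s < 2ᴶ S₀` and `|τ| < T/2ᴶ`. [folklore]
[cite: CijsouwWaldschmidt1977, §3 (source FOLLOWED for the descent step; the cell’s sign-free transcription, NOT a printed statement)] -/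
structure Inv (J₀ : ℕ) (L : Fin Q.d → ℕ) (Lθ S₀ T : ℕ) (P : ℤ) (J : ℕ) (p : Idx Q.d h Lb → ℤ) : Prop where
  /-- support in the box of level `J` -/
  supp : ∀ u, p u ≠ 0 → u ∈ Q.flat.box (h := h) (Lb := Lb) L Lθ J
  /-- not all zero -/
  nonzero : ∃ u, p u ≠ 0
  /-- the size bound -/
  bound : ∀ u, |p u| ≤ P
  /-- the relations -/
  rel : ∀ s, s < 2 ^ J * S₀ → Odd s → ∀ τ : Tau Q.d, tauNorm τ < T / 2 ^ J →
    Q.coreSum J₀ J (Q.flat.box (h := h) (Lb := Lb) L Lθ J) p τ s = 0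

/-! ### One step of the descent: the algebra -/

/-- **Step 2, the algebraic half (place-free).** From the invariant at level `J` and the vanishing of
all class sums `classVec_{J,τ,s}` (`s` odd `< 2^{J+1} S₀`, `|τ| < T/2^{J+1}`) to the invariant at level
`J + 1`: choose `u₀` with `p(u₀) ≠ 0`, let `(ε, ε_θ)` be its residues mod `2`, re-index the class of
`u₀` by `λ = ε + 2μ` (`p'(v) = p(ε + 2v)`), pull the constant `2^{|τ'|} Kfac` out of `rHalf`, and
recentre the binomials `(γⱼ + cⱼ)^{τ'ⱼ}` (`CW77.sum_mul_prod_pow_eq_zero_of_shift`).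
[folklore]
[cite: CijsouwWaldschmidt1977, §3 (source FOLLOWED for the descent step; the cell’s sign-free transcription, NOT a printed statement)] -/
theorem descent_algebra {J₀ J : ℕ} {L : Fin Q.d → ℕ} {Lθ S₀ T : ℕ} {P : ℤ}
    {p : Idx Q.d h Lb → ℤ} (inv : Q.Inv J₀ L Lθ S₀ T P J p)
    (half : ∀ s, s < 2 ^ (J + 1) * S₀ → Odd s → ∀ τ : Tau Q.d, tauNorm τ < T / 2 ^ (J + 1) →
      Q.classVec J₀ J (Q.flat.box (h := h) (Lb := Lb) L Lθ J) p τ s = 0) :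
    ∃ p' : Idx Q.d h Lb → ℤ, Q.Inv J₀ L Lθ S₀ T P (J + 1) p' := by
  classical
  obtain ⟨u₀, hu₀⟩ := inv.nonzero
  set ε : Fin Q.d → ℕ := fun j => u₀.2.1 j % 2 with hεdef
  set εθ : ℕ := u₀.2.2 % 2 with hεθdef
  have hε : ∀ j, ε j ≤ 1 := fun j => by simp only [hεdef]; omega
  have hεθ : εθ ≤ 1 := by simp only [hεθdef]; omega
  set p' : Idx Q.d h Lb → ℤ := fun v => p (Q.flat.reidx ε εθ v) with hp'
  set boxJ := Q.flat.box (h := h) (Lb := Lb) L Lθ J with hboxJ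
  set boxJ1 := Q.flat.box (h := h) (Lb := Lb) L Lθ (J + 1) with hboxJ1
  refine ⟨p', ⟨?_, ?_, ?_, ?_⟩⟩
  · -- support
    intro v hv
    exact Q.flat.mem_box_succ_of_reidx (inv.supp _ hv)
  · -- not all zero
    refine ⟨Q.flat.halve u₀, ?_⟩
    simp only [hp']
    rw [Q.flat.reidx_halve u₀ (fun j => rfl) rfl]
    exact hu₀
  · -- bound
    intro v; exact inv.bound _
  · -- the relations at level `J + 1`
    intro s hs hodd τ hτ
    -- the class sums of the residue class `(ε, εθ)` vanish
    have hcv : ∀ τ' : Fin Q.d → ℕ, τ.1 + ∑ j, τ' j < T / 2 ^ (J + 1) →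
        Q.classVec J₀ J boxJ p (τ.1, τ') s (Q.flat.Tpat ε εθ) = 0 := by
      intro τ' hτ'
      have h0 := half s hs hodd (τ.1, τ') (by unfold tauNorm; exact hτ')
      exact congrFun h0 _
    -- the set of new unknowns coming from old ones
    set Vs := boxJ1.filter fun v => Q.flat.reidx ε εθ v ∈ boxJ with hVs
    set W : Idx Q.d h Lb → ℚ := fun v => (p' v : ℚ) * (Q.flat.qΔ J₀ (J + 1) v τ.1 s * Q.qE v s) with hW
    -- the shifted relations
    have hshift : ∀ τ' : Fin Q.d → ℕ, ∑ j, τ' j < T / 2 ^ (J + 1) - τ.1 →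
        ∑ v ∈ Vs, W v * ∏ j, (Q.flat.γ v j + Q.flat.cγ ε εθ j) ^ τ' j = 0 := by
      intro τ' hτ'
      have h1 := hcv τ' (by omega)
      unfold classVec at h1
      rw [Q.flat.sum_class_eq_sum_reidx hodd hε hεθ L Lθ J] at h1
      -- `h1 : ∑ v ∈ Vs, p (reidx v) * rHalf (reidx v) = 0`
      simp_rw [Q.rHalf_reidx] at h1
      have hK : (2 : ℚ) ^ (∑ j, τ' j) * Q.Kfac ε εθ s ≠ 0 :=
        mul_ne_zero (pow_ne_zero _ two_ne_zero) (Q.Kfac_ne ε εθ s)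
      have h2 : ∑ v ∈ Vs, (p (Q.flat.reidx ε εθ v) : ℚ) *
          ((2 : ℚ) ^ (∑ j, τ' j) * Q.Kfac ε εθ s * ((Q.flat.qΔ J₀ (J + 1) v τ.1 s * Q.qE v s) *
            ∏ j, (Q.flat.γ v j + Q.flat.cγ ε εθ j) ^ τ' j)) =
          ((2 : ℚ) ^ (∑ j, τ' j) * Q.Kfac ε εθ s) *
            ∑ v ∈ Vs, W v * ∏ j, (Q.flat.γ v j + Q.flat.cγ ε εθ j) ^ τ' j := by
        rw [mul_sum]
        refine sum_congr rfl fun v _ => ?_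
        simp only [hW, hp']; ring
      rw [h2] at h1
      exact (mul_eq_zero.mp h1).resolve_left hK
    -- recentring
    have hrel := sum_mul_prod_pow_eq_zero_of_shift (d := Q.d) Vs W (fun v j => Q.flat.γ v j)
      (Q.flat.cγ ε εθ) _ hshift τ.2 (by unfold tauNorm at hτ; omega)
    -- `coreSum_{J+1} = ∑_{Vs} W ∏ γ^τ'`
    have hcore : Q.coreSum J₀ (J + 1) boxJ1 p' τ s = ∑ v ∈ Vs, W v * ∏ j, Q.flat.γ v j ^ τ.2 j := by
      unfold coreSum
      rw [hVs, sum_filter]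
      refine sum_congr rfl fun v hv => ?_
      by_cases hvb : Q.flat.reidx ε εθ v ∈ boxJ
      · rw [if_pos hvb]
        unfold qTerm CW77.Setup.qA
        simp only [hW]; ring
      · rw [if_neg hvb]
        have : p' v = 0 := by
          simp only [hp']
          by_contra hne
          exact hvb (inv.supp _ hne)
        rw [this]; simp
    rw [hcore]; exact hrel

/-! ### The top level: Waldschmidt's asymmetric endgame -/

/-- At `λ_θ = 0` the signed `qE` is `∏ⱼ αⱼ^{λⱼ s}`. [folklore]
[cite: CijsouwWaldschmidt1977, §3 (source FOLLOWED for the descent step; the cell’s sign-free transcription, NOT a printed statement)] -/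
theorem qE_of_zero (ρ : Fin h × Fin Lb) (lam : Fin Q.d → ℕ) (s : ℕ) :
    Q.qE ((ρ, (lam, 0)) : Idx Q.d h Lb) s = ∏ j, Q.α j ^ (lam j * s) := by
  unfold qE; simp

/-- **The signed rational core at the top level, as a double sum over `ρ` and the box
`∏ⱼ [0, ⌊Lⱼ/2^{J₀}⌋]`** (`L_θ < 2^{J₀}`, so `λ_θ = 0`, `γⱼ = λⱼ`):
`coreSum_{J₀,τ}(s) = τ₀! ∑_ρ ∑_λ p(ρ,λ,0) ((1/τ₀!)d^{τ₀}w_ρ)(s) ∏ⱼ (αⱼ^{sλⱼ} λⱼ^{τⱼ})`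
(the tree's `CW77.Setup.coreSum_top_eq`, signs allowed). [folklore]
[cite: CijsouwWaldschmidt1977, §3 (source FOLLOWED for the descent step; the cell’s sign-free transcription, NOT a printed statement)] -/
theorem coreSum_top_eq {L : Fin Q.d → ℕ} {Lθ J₀ : ℕ} (hLθ : Lθ < 2 ^ J₀)
    (p : Idx Q.d h Lb → ℤ) (τ : Tau Q.d) (s : ℕ) :
    Q.coreSum J₀ J₀ (Q.flat.box (h := h) (Lb := Lb) L Lθ J₀) p τ s =
      (τ.1.factorial : ℚ) * ∑ ρ : Fin h × Fin Lb, ∑ lam : ∀ j : Fin Q.d, Fin (L j / 2 ^ J₀ + 1),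
        (p (ρ, (fun j => ((lam j : ℕ)), 0)) : ℚ) *
          (hasseDeriv τ.1 (Waldschmidt1980.wPolyQ (ρ.1 : ℕ) (ρ.2 : ℕ) h)).eval (s : ℚ) *
          ∏ j, ((Q.α j) ^ (s * (lam j : ℕ)) * (((lam j : ℕ) : ℚ)) ^ (τ.2 j)) := by
  classical
  unfold coreSum CW77.Setup.box
  rw [Nat.div_eq_of_lt hLθ, zero_add, Finset.sum_product, Finset.mul_sum]
  refine Finset.sum_congr rfl fun ρ _ => ?_
  rw [Finset.sum_product, Finset.mul_sum]
  simp only [Finset.sum_range_one]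
  -- the sum over `piFinset` as a sum over the dependent box
  symm
  refine Finset.sum_bij' (fun lam _ => fun j => ((lam j : ℕ)))
    (fun μ hμ => fun j => ⟨μ j, mem_range.mp (Fintype.mem_piFinset.mp hμ j)⟩) ?_ ?_ ?_ ?_ ?_
  · intro lam _; exact Fintype.mem_piFinset.mpr fun j => mem_range.mpr (lam j).isLt
  · intro μ _; exact mem_univ _
  · intro lam _; rfl
  · intro μ _; rfl
  · intro lam _
    unfold qTerm CW77.Setup.qA CW77.Setup.γ
    rw [Q.flat.qΔ_top_eq, Q.qE_of_zero]
    simp only [Nat.cast_zero, zero_mul, add_zero]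
    rw [Finset.prod_mul_distrib]
    have hcomm : ∀ j : Fin Q.d, (Q.α j) ^ ((lam j : ℕ) * s) = (Q.α j) ^ (s * (lam j : ℕ)) := by
      intro j; rw [mul_comm]
    simp_rw [hcomm]
    ring

/-- **Waldschmidt 1980, §3.5 — the contradiction at the top of the descent (signs allowed).** If the
invariant holds at the level `J₀` where the range of the eliminated exponent is empty (`L_θ < 2^{J₀}`),
the derivative budget `⌊T/2^{J₀}⌋` covers `τ₀ < T'`, `τⱼ ≤ ⌊Lⱼ/2^{J₀}⌋`, and
`h · Lb < T' · #{odd s < 2^{J₀} S₀}`, then all `p(u)` vanish — contradiction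
(`Waldschmidt1980.endgame`, which needs only `αⱼ ≠ 0`). [folklore]
[cite: CijsouwWaldschmidt1977, §3 (source FOLLOWED for the descent step; the cell’s sign-free transcription, NOT a printed statement)] -/
theorem w80_endgame {J₀ : ℕ} {L : Fin Q.d → ℕ} {Lθ S₀ T : ℕ} {P : ℤ} {p : Idx Q.d h Lb → ℤ}
    (inv : Q.Inv J₀ L Lθ S₀ T P J₀ p) (hLθ : Lθ < 2 ^ J₀) {T' : ℕ}
    (hT' : T' + ∑ j, L j / 2 ^ J₀ ≤ T / 2 ^ J₀)
    (hcount : h * Lb < T' * ((range (2 ^ J₀ * S₀)).filter Odd).card) : False := by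
  classical
  set L' : Fin Q.d → ℕ := fun j => L j / 2 ^ J₀ with hL'
  set boxJ := Q.flat.box (h := h) (Lb := Lb) L Lθ J₀ with hboxJ
  set pts : Finset ℕ := (range (2 ^ J₀ * S₀)).filter Odd with hpts
  set p' : (Fin h × Fin Lb) → (∀ j : Fin Q.d, Fin (L' j + 1)) → ℚ :=
    fun ρ lam => (p (ρ, (fun j => ((lam j : ℕ)), 0)) : ℚ) with hp'
  -- the vanishing in the form of `Waldschmidt1980.endgame`
  have hvan : ∀ s ∈ pts, ∀ k < T', ∀ τb : ∀ j : Fin Q.d, Fin (L' j + 1),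
      ∑ ρ : Fin h × Fin Lb, ∑ lam : ∀ j : Fin Q.d, Fin (L' j + 1),
        p' ρ lam * (hasseDeriv k (Waldschmidt1980.wPolyQ (ρ.1 : ℕ) (ρ.2 : ℕ) h)).eval ((fun n : ℕ => (n : ℚ)) s) *
          ∏ j, ((Q.α j) ^ (s * (lam j : ℕ)) * (((lam j : ℕ) : ℚ)) ^ ((τb j : ℕ))) = 0 := by
    intro s hs k hk τb
    rw [hpts, mem_filter, mem_range] at hs
    set τ : Tau Q.d := (k, fun j => (τb j : ℕ)) with hτ
    have hτn : tauNorm τ < T / 2 ^ J₀ := by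
      show k + ∑ j, (τb j : ℕ) < T / 2 ^ J₀
      have hle : ∑ j, (τb j : ℕ) ≤ ∑ j, L' j :=
        Finset.sum_le_sum fun j _ => Nat.lt_succ_iff.mp (τb j).isLt
      have hT'' : T' + ∑ j, L' j ≤ T / 2 ^ J₀ := hT'
      omega
    have hrel := inv.rel s hs.1 hs.2 τ hτn
    rw [Q.coreSum_top_eq hLθ p τ s] at hrel
    have hk0 : (k.factorial : ℚ) ≠ 0 := by exact_mod_cast (Nat.factorial_pos k).ne'
    have h0 := (mul_eq_zero.mp hrel).resolve_left hk0
    simpa [hp', hτ] using h0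
  have hend := Waldschmidt1980.endgame (K := ℚ) (fun ρ : Fin h × Fin Lb => Waldschmidt1980.wPolyQ (ρ.1 : ℕ) (ρ.2 : ℕ) h)
    (fun ρ => Waldschmidt1980.wPolyQ_ne_zero _ _ _) (CW77.Setup.injective_natDegree_wPolyQ h Lb) (N := h * Lb)
    (fun ρ => by
      rw [Waldschmidt1980.natDegree_wPolyQ]
      have h1 := ρ.1.isLt; have h2 := ρ.2.isLt
      have h3 : ((ρ.2 : ℕ) + 1) * h = (ρ.2 : ℕ) * h + h := by ring
      have h4 : ((ρ.2 : ℕ) + 1) * h ≤ Lb * h := Nat.mul_le_mul_right h h2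
      rw [mul_comm h Lb]; omega)
    L' (fun j => Q.α j) (fun j => Q.α_ne j) pts (fun n : ℕ => (n : ℚ))
    (fun a _ b _ hab => Nat.cast_injective (R := ℚ) hab) T' hcount p' hvan
  -- all `p(u)` vanish
  apply (inv.nonzero).elim
  intro u hu
  by_cases hmem : u ∈ boxJ
  · rw [Q.flat.mem_box_top_iff hLθ] at hmem
    obtain ⟨hμ, hθ⟩ := hmem
    have hlam : p' u.1 (fun j => ⟨u.2.1 j, Nat.lt_succ_of_le (hμ j)⟩) = 0 := by
      rw [hend]; rfl
    simp only [hp'] at hlam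
    have hu_eq : u = (u.1, (fun j => u.2.1 j, 0)) := by
      rcases u with ⟨ρ, μ, lθ⟩
      simp only at hθ ⊢
      rw [hθ]
    rw [hu_eq] at hu
    exact hu (by exact_mod_cast hlam)
  · exact hmem (inv.supp u hu)

end SetupQ

end Literature.NumberTheory.Transcendental.StewartYu

end Part3

/-!
## Part 4 — port of `Summits/ABC/StewartYu/DescentIntegralityQ.lean`

# Cell abc-stewartyu, WP-A3 (vi): integrality of the signed cores and Siegel's lemma, sign-free

`Summits/ABC/StewartYu/DescentIntegralityQ.lean` — cell `abc-stewartyu` (HOME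
`run/shared/lean/pub/abc-stewartyu/`, seat p3; the "copy-port" of `HOME/plan/PORT-MAP.md`
§0-ERRATUM, concluded; theorems only, no named fact), sequel to `DescentStepQ.lean`.

On `Q : SetupQ` with the clearing denominators of the flattening (`Q.flat.Dclear`, `Q.flat.Dhalf`:
they involve only `ν`, `|b_θ|` and the denominators `den |αⱼ| = den αⱼ`):

* `exists_int_qE`, `exists_int_Dclear_mul_qTerm` — the cleared SIGNED coefficients of the level-`0`
  equations are integers (the tree's `CW77.Setup.exists_int_qE`, `exists_int_Dclear_mul_qTerm`);
* `siegel_step` — **Step 1**: Siegel's lemma (Mathlib `Int.Matrix.exists_ne_zero_int_vec_norm_le`)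
  produces the invariant `SetupQ.Inv` at level `0` from a count of unknowns vs equations and a bound
  `Amax` on the cleared coefficients (the tree's `CW77.Setup.siegel_step`
  [cite: CijsouwWaldschmidt1977, §4 Step 1 (pp. 185–186)], proof verbatim); since
  `|qTerm| = |qTerm♭|` (`SetupQ.abs_qTerm`) the bound is supplied by the tree's archimedean size
  estimates (`Waldschmidt1980Sizes*`) applied to `Q.flat`;
* `exists_int_qEh`, `exists_int_Dhalf_mul_rHalf`, `exists_int_Dhalf_mul_classVec` — integrality of the
  cleared signed class sums at the half points (the input of the `p`-adic Liouville inequality).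

Everything is [folklore]; proof texts are the tree's with `α_pos ↦ α_ne`.
-/

section Part4

open _root_.Finset
open Literature.NumberTheory.Transcendental
open Literature.NumberTheory.Transcendental.Baker1975.Ch3 (nuBound nuBound_pos)
open Literature.NumberTheory.Transcendental.CW77
open Literature.NumberTheory.Transcendental.CW77.Setup (Idx Tau tauNorm scale tauSet mem_tauSet)

namespace Literature.NumberTheory.Transcendental.StewartYu

attribute [local instance] Matrix.seminormedAddCommGroup

namespace SetupQ

variable (Q : SetupQ) {h Lb : ℕ}

/-- `den |αⱼ| = den αⱼ`. [folklore]
[cite: CijsouwWaldschmidt1977, §3 (source FOLLOWED; integrality bookkeeping of the cell’s signed cores, NOT a printed statement)] -/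
@[simp] theorem flat_α_den (j : Fin Q.d) : (Q.flat.α j).den = (Q.α j).den := Rat.den_abs_eq_den _

/-- `den |θ| = den θ`. [folklore]
[cite: CijsouwWaldschmidt1977, §3 (source FOLLOWED; integrality bookkeeping of the cell’s signed cores, NOT a printed statement)] -/
@[simp] theorem flat_θ_den : Q.flat.θ.den = Q.θ.den := Rat.den_abs_eq_den _

/-! ### Integrality at the natural points -/

/-- `(∏ den αⱼ^{Lⱼ s}) den θ^{L_θ s} · qE ∈ ℤ` on the box (`λⱼ ≤ Lⱼ`, `λ_θ ≤ L_θ`). [folklore]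
[cite: CijsouwWaldschmidt1977, §3 (source FOLLOWED; integrality bookkeeping of the cell’s signed cores, NOT a printed statement)] -/
theorem exists_int_qE {L : Fin Q.d → ℕ} {Lθ : ℕ} {u : Idx Q.d h Lb} (hu : (∀ j, u.2.1 j ≤ L j) ∧ u.2.2 ≤ Lθ)
    (s : ℕ) : ∃ z : ℤ, (((∏ j, (Q.α j).den ^ (L j * s)) * Q.θ.den ^ (Lθ * s) : ℕ) : ℚ) * Q.qE u s = z := by
  unfold qE
  -- `den^{L s} α^{λ s} = den^{(L-λ) s} · num^{λ s}`
  have hone : ∀ (q : ℚ) (lam Lq : ℕ), lam ≤ Lq → ∃ z : ℤ, ((q.den ^ (Lq * s) : ℕ) : ℚ) * q ^ (lam * s) = z := by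
    intro q lam Lq hle
    refine ⟨(q.den : ℤ) ^ ((Lq - lam) * s) * q.num ^ (lam * s), ?_⟩
    have hsplit : Lq * s = (Lq - lam) * s + lam * s := by rw [← add_mul, Nat.sub_add_cancel hle]
    rw [hsplit, pow_add]
    push_cast
    rw [mul_assoc, ← mul_pow, Rat.den_mul_eq_num]
  choose zα hzα using fun j => hone (Q.α j) (u.2.1 j) (L j) (hu.1 j)
  obtain ⟨zθ, hzθ⟩ := hone Q.θ u.2.2 Lθ hu.2
  refine ⟨(∏ j, zα j) * zθ, ?_⟩
  have hα' : ∏ j, ((((Q.α j).den : ℚ)) ^ (L j * s) * (Q.α j) ^ (u.2.1 j * s)) = ∏ j, (zα j : ℚ) :=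
    prod_congr rfl fun j _ => by exact_mod_cast hzα j
  push_cast at hzθ ⊢
  calc (∏ j, (((Q.α j).den : ℚ)) ^ (L j * s)) * ((Q.θ.den : ℚ)) ^ (Lθ * s) *
        ((∏ j, Q.α j ^ (u.2.1 j * s)) * Q.θ ^ (u.2.2 * s))
      = (∏ j, ((((Q.α j).den : ℚ)) ^ (L j * s) * (Q.α j) ^ (u.2.1 j * s))) *
          (((Q.θ.den : ℚ)) ^ (Lθ * s) * Q.θ ^ (u.2.2 * s)) := by rw [prod_mul_distrib]; ring
    _ = (∏ j, (zα j : ℚ)) * (zθ : ℚ) := by rw [hα', hzθ]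

/-- The denominator part of `Dclear♭` is that of the signed generators. [folklore]
[cite: CijsouwWaldschmidt1977, §3 (source FOLLOWED; integrality bookkeeping of the cell’s signed cores, NOT a printed statement)] -/
theorem flat_Dclear_eq (J₀ : ℕ) (L : Fin Q.d → ℕ) (Lθ : ℕ) (s : ℕ) (τ : Tau Q.d) :
    Q.flat.Dclear (h := h) J₀ L Lθ s τ =
      nuBound (scale J₀ 0 * s) h ^ τ.1 * Q.bθ.natAbs ^ (∑ j, τ.2 j) *
        ((∏ j, (Q.α j).den ^ (L j * s)) * Q.θ.den ^ (Lθ * s)) := by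
  unfold CW77.Setup.Dclear
  simp only [Rat.den_abs_eq_den]

/-- **The cleared signed coefficients are integers**: `Dclear♭(s,τ) · qTerm ∈ ℤ` on the box of level `0`.
[folklore]
[cite: CijsouwWaldschmidt1977, §3 (source FOLLOWED; integrality bookkeeping of the cell’s signed cores, NOT a printed statement)] -/
theorem exists_int_Dclear_mul_qTerm (J₀ : ℕ) {L : Fin Q.d → ℕ} {Lθ : ℕ} {u : Idx Q.d h Lb}
    (hu : u ∈ Q.flat.box (h := h) (Lb := Lb) L Lθ 0) (τ : Tau Q.d) (s : ℕ) :
    ∃ z : ℤ, ((Q.flat.Dclear (h := h) J₀ L Lθ s τ : ℕ) : ℚ) * Q.qTerm J₀ 0 u τ s = z := by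
  rw [Q.flat.mem_box] at hu
  simp only [pow_zero, Nat.div_one] at hu
  obtain ⟨z₁, hz₁⟩ := Q.flat.exists_int_qΔ J₀ 0 u τ.1 s
  obtain ⟨z₂, hz₂⟩ := Q.flat.exists_int_qA u τ.2
  obtain ⟨z₃, hz₃⟩ := Q.exists_int_qE hu s
  refine ⟨z₁ * z₂ * z₃, ?_⟩
  rw [Q.flat_Dclear_eq]
  unfold qTerm
  push_cast at hz₁ hz₂ hz₃ ⊢
  rw [← hz₁, ← hz₂, ← hz₃]; ring

/-! ### Step 1: Siegel's lemma -/

/-- **Step 1 (Siegel's lemma), sign-free.** If there are more than twice as many unknowns in the box of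
level `0` as equations `(s, τ)` (`s < S₀`, `|τ| < T`, `S₀, T ≥ 1`), and the cleared signed coefficients
are bounded by `Amax ≥ 1`, then there are integers `p(u)`, not all zero, supported in the box, bounded
by `#box · Amax`, satisfying all the relations of level `0`: the invariant `SetupQ.Inv` at `J = 0`.
[folklore]
[cite: CijsouwWaldschmidt1977, §3 (source FOLLOWED; integrality bookkeeping of the cell’s signed cores, NOT a printed statement)] -/
theorem siegel_step (J₀ : ℕ) (L : Fin Q.d → ℕ) (Lθ S₀ T : ℕ) (hS₀ : 1 ≤ S₀) (hT : 1 ≤ T)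
    (hcard : 2 * ((range S₀) ×ˢ tauSet Q.d T).card ≤ (Q.flat.box (h := h) (Lb := Lb) L Lθ 0).card)
    {Amax : ℝ} (hAmax : 1 ≤ Amax)
    (hA : ∀ s, s < S₀ → ∀ τ : Tau Q.d, tauNorm τ < T → ∀ u ∈ Q.flat.box (h := h) (Lb := Lb) L Lθ 0,
      |((Q.flat.Dclear (h := h) J₀ L Lθ s τ : ℕ) : ℝ) * (Q.qTerm J₀ 0 u τ s : ℝ)| ≤ Amax) :
    ∃ p : Idx Q.d h Lb → ℤ,
      Q.Inv J₀ L Lθ S₀ T ⌈((Q.flat.box (h := h) (Lb := Lb) L Lθ 0).card : ℝ) * Amax⌉ 0 p := by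
  classical
  set boxZ := Q.flat.box (h := h) (Lb := Lb) L Lθ 0 with hboxZ
  set eqs := (range S₀) ×ˢ tauSet Q.d T with heqs
  -- the integer matrix
  have hint : ∀ (e : eqs) (u : boxZ), ∃ z : ℤ,
      ((Q.flat.Dclear (h := h) J₀ L Lθ e.1.1 e.1.2 : ℕ) : ℚ) * Q.qTerm J₀ 0 u.1 e.1.2 e.1.1 = z :=
    fun e u => Q.exists_int_Dclear_mul_qTerm J₀ u.2 e.1.2 e.1.1
  choose Az hAz using hint
  set A : Matrix eqs boxZ ℤ := Matrix.of fun e u => Az e u with hAdef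
  -- cardinalities
  have hm : 0 < Fintype.card eqs := by
    rw [Fintype.card_coe]
    refine Finset.card_pos.mpr ⟨(0, ((0 : ℕ), (0 : Fin Q.d → ℕ))), ?_⟩
    rw [heqs, mem_product, mem_range, mem_tauSet]
    unfold tauNorm
    simpa using ⟨hS₀, hT⟩
  have hn : Fintype.card eqs < Fintype.card boxZ := by
    rw [Fintype.card_coe, Fintype.card_coe]
    have : 0 < eqs.card := by rwa [Fintype.card_coe] at hm
    omega
  obtain ⟨t, ht0, hAt, htnorm⟩ := Int.Matrix.exists_ne_zero_int_vec_norm_le A hn hm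
  -- entries of `A` are bounded by `Amax`, hence `‖t‖ ≤ #box · Amax`
  have hAnorm : ‖A‖ ≤ Amax := by
    rw [Matrix.norm_le_iff (by linarith)]
    intro e u
    have h1 := hAz e u
    have hmem : (e : ℕ × Tau Q.d) ∈ range S₀ ×ˢ tauSet Q.d T := e.2
    rw [mem_product, mem_range, mem_tauSet] at hmem
    have h2 := hA e.1.1 hmem.1 e.1.2 hmem.2 u.1 u.2
    have hcast : ((Q.flat.Dclear (h := h) J₀ L Lθ e.1.1 e.1.2 : ℕ) : ℝ) * (Q.qTerm J₀ 0 u.1 e.1.2 e.1.1 : ℝ) =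
        ((Az e u : ℤ) : ℝ) := by
      have := congrArg (fun q : ℚ => (q : ℝ)) h1
      push_cast at this
      exact this
    rw [hAdef, Matrix.of_apply, Int.norm_eq_abs]
    rwa [hcast] at h2
  have htle : ∀ u : boxZ, |(t u : ℝ)| ≤ (boxZ.card : ℝ) * Amax := by
    intro u
    have h1 : ‖t u‖ ≤ ‖t‖ := norm_le_pi_norm t u
    rw [Int.norm_eq_abs] at h1
    refine h1.trans (htnorm.trans ?_)
    have hbase : (1 : ℝ) ≤ (Fintype.card boxZ : ℝ) * max 1 ‖A‖ := by
      have : (1 : ℝ) ≤ Fintype.card boxZ := by exact_mod_cast (show 1 ≤ Fintype.card boxZ by omega)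
      nlinarith [le_max_left (1 : ℝ) ‖A‖]
    have hexp : (Fintype.card eqs : ℝ) / (Fintype.card boxZ - Fintype.card eqs) ≤ 1 := by
      rw [div_le_one (by rw [sub_pos]; exact_mod_cast hn)]
      have : 2 * (Fintype.card eqs : ℝ) ≤ Fintype.card boxZ := by
        rw [Fintype.card_coe, Fintype.card_coe]; exact_mod_cast hcard
      linarith
    calc ((Fintype.card boxZ : ℝ) * max 1 ‖A‖) ^ ((Fintype.card eqs : ℝ) / (Fintype.card boxZ - Fintype.card eqs))
        ≤ ((Fintype.card boxZ : ℝ) * max 1 ‖A‖) ^ (1 : ℝ) :=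
          Real.rpow_le_rpow_of_exponent_le hbase hexp
      _ = (Fintype.card boxZ : ℝ) * max 1 ‖A‖ := Real.rpow_one _
      _ ≤ (boxZ.card : ℝ) * Amax := by
          rw [Fintype.card_coe]
          exact mul_le_mul_of_nonneg_left (max_le hAmax hAnorm) (by positivity)
  -- the vector `p`
  set p : Idx Q.d h Lb → ℤ := fun u => if hu : u ∈ boxZ then t ⟨u, hu⟩ else 0 with hp
  have hp_mem : ∀ u (hu : u ∈ boxZ), p u = t ⟨u, hu⟩ := fun u hu => by simp only [hp, dif_pos hu]
  refine ⟨p, ⟨?_, ?_, ?_, ?_⟩⟩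
  · -- support
    intro u hu
    by_contra hnot
    exact hu (dif_neg hnot)
  · -- not all zero
    obtain ⟨u, hu⟩ := Function.ne_iff.mp ht0
    refine ⟨u.1, ?_⟩
    rw [hp_mem u.1 u.2]; exact hu
  · -- bound
    intro u
    by_cases hu : u ∈ boxZ
    · rw [hp_mem u hu]
      have h1 := htle ⟨u, hu⟩
      have h2 : ((t ⟨u, hu⟩ : ℤ) : ℝ) ≤ ⌈(boxZ.card : ℝ) * Amax⌉ :=
        (le_abs_self _).trans (h1.trans (Int.le_ceil _))
      have h3 : (-(t ⟨u, hu⟩ : ℤ) : ℝ) ≤ ⌈(boxZ.card : ℝ) * Amax⌉ :=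
        (neg_le_abs _).trans (h1.trans (Int.le_ceil _))
      rw [abs_le]
      constructor
      · have : -(⌈(boxZ.card : ℝ) * Amax⌉ : ℤ) ≤ t ⟨u, hu⟩ := by
          exact_mod_cast (by linarith : (-(⌈(boxZ.card : ℝ) * Amax⌉ : ℤ) : ℝ) ≤ t ⟨u, hu⟩)
        exact this
      · exact_mod_cast h2
    · simp only [hp, dif_neg hu, abs_zero]
      exact Int.ceil_nonneg (by positivity)
  · -- relations
    intro s hs _hodd τ hτ
    rw [pow_zero, one_mul] at hs
    rw [pow_zero, Nat.div_one] at hτ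
    have hmem : (s, τ) ∈ eqs := by
      rw [heqs, mem_product, mem_range, mem_tauSet]; exact ⟨hs, hτ⟩
    have hrow := congrFun hAt ⟨(s, τ), hmem⟩
    simp only [Matrix.mulVec, dotProduct, Pi.zero_apply] at hrow
    -- cast to `ℚ` and insert the coefficients
    have hD : ((Q.flat.Dclear (h := h) J₀ L Lθ s τ : ℕ) : ℚ) ≠ 0 := by
      exact_mod_cast (Q.flat.Dclear_pos J₀ L Lθ s τ).ne'
    have hsum : ((Q.flat.Dclear (h := h) J₀ L Lθ s τ : ℕ) : ℚ) * Q.coreSum J₀ 0 boxZ p τ s =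
        ((∑ u : boxZ, A ⟨(s, τ), hmem⟩ u * t u : ℤ) : ℚ) := by
      unfold coreSum
      rw [mul_sum, ← Finset.sum_coe_sort boxZ]
      push_cast
      refine sum_congr rfl fun u _ => ?_
      rw [hAdef, Matrix.of_apply, ← hAz ⟨(s, τ), hmem⟩ u, hp_mem u.1 u.2]
      simp only; ring
    rw [hrow] at hsum
    simp only [Int.cast_zero, mul_eq_zero] at hsum
    exact hsum.resolve_left hD

/-! ### Integrality at the half points -/

/-- `(∏ den αⱼ^{⌊Lⱼ/2^J⌋ s}) den θ^{⌊L_θ/2^J⌋ s} · qEh ∈ ℤ` on the box of level `J` (signed). [folklore]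
[cite: CijsouwWaldschmidt1977, §3 (source FOLLOWED; integrality bookkeeping of the cell’s signed cores, NOT a printed statement)] -/
theorem exists_int_qEh {L : Fin Q.d → ℕ} {Lθ J : ℕ} {u : Idx Q.d h Lb}
    (hu : u ∈ Q.flat.box (h := h) (Lb := Lb) L Lθ J) (s : ℕ) :
    ∃ z : ℤ, (((∏ j, (Q.α j).den ^ (L j / 2 ^ J * s)) * Q.θ.den ^ (Lθ / 2 ^ J * s) : ℕ) : ℚ) * Q.qEh u s = z := by
  rw [Q.flat.mem_box] at hu
  have hone : ∀ (q : ℚ) (e Lq : ℕ), e ≤ Lq * s → ∃ z : ℤ, ((q.den ^ (Lq * s) : ℕ) : ℚ) * q ^ e = z := by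
    intro q e Lq hle
    refine ⟨(q.den : ℤ) ^ (Lq * s - e) * q.num ^ e, ?_⟩
    have hsplit : Lq * s = (Lq * s - e) + e := (Nat.sub_add_cancel hle).symm
    rw [hsplit, pow_add]
    push_cast
    rw [mul_assoc, ← mul_pow, Rat.den_mul_eq_num]
    congr 2; omega
  have hlam : ∀ j, Q.flat.expn u s (Fin.castSucc j) / 2 ≤ L j / 2 ^ J * s := by
    intro j
    rw [Q.flat_expn_castSucc]
    calc u.2.1 j * s / 2 ≤ u.2.1 j * s := Nat.div_le_self _ _
      _ ≤ L j / 2 ^ J * s := Nat.mul_le_mul_right _ (hu.1 j)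
  have hθ' : Q.flat.expn u s (Fin.last Q.d) / 2 ≤ Lθ / 2 ^ J * s := by
    rw [Q.flat_expn_last]
    calc u.2.2 * s / 2 ≤ u.2.2 * s := Nat.div_le_self _ _
      _ ≤ Lθ / 2 ^ J * s := Nat.mul_le_mul_right _ hu.2
  choose zα hzα using fun j => hone (Q.α j) _ (L j / 2 ^ J) (hlam j)
  obtain ⟨zθ, hzθ⟩ := hone Q.θ _ (Lθ / 2 ^ J) hθ'
  refine ⟨(∏ j, zα j) * zθ, ?_⟩
  unfold qEh
  rw [Fin.prod_univ_castSucc]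
  unfold all
  simp only [Fin.snoc_castSucc, Fin.snoc_last]
  have hα' : ∏ j, ((((Q.α j).den : ℚ)) ^ (L j / 2 ^ J * s) * (Q.α j) ^ (Q.flat.expn u s (Fin.castSucc j) / 2)) =
      ∏ j, (zα j : ℚ) :=
    prod_congr rfl fun j _ => by exact_mod_cast hzα j
  push_cast at hzθ ⊢
  calc (∏ j, (((Q.α j).den : ℚ)) ^ (L j / 2 ^ J * s)) * ((Q.θ.den : ℚ)) ^ (Lθ / 2 ^ J * s) *
        ((∏ j, Q.α j ^ (Q.flat.expn u s (Fin.castSucc j) / 2)) * Q.θ ^ (Q.flat.expn u s (Fin.last Q.d) / 2))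
      = (∏ j, ((((Q.α j).den : ℚ)) ^ (L j / 2 ^ J * s) * (Q.α j) ^ (Q.flat.expn u s (Fin.castSucc j) / 2))) *
          (((Q.θ.den : ℚ)) ^ (Lθ / 2 ^ J * s) * Q.θ ^ (Q.flat.expn u s (Fin.last Q.d) / 2)) := by
        rw [prod_mul_distrib]; ring
    _ = (∏ j, (zα j : ℚ)) * (zθ : ℚ) := by rw [hα', hzθ]

/-- The denominator part of `Dhalf♭` is that of the signed generators. [folklore]
[cite: CijsouwWaldschmidt1977, §3 (source FOLLOWED; integrality bookkeeping of the cell’s signed cores, NOT a printed statement)] -/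
theorem flat_Dhalf_eq (J₀ J : ℕ) (L : Fin Q.d → ℕ) (Lθ : ℕ) (s : ℕ) (τ : Tau Q.d) :
    Q.flat.Dhalf (h := h) J₀ J L Lθ s τ =
      nuBound (scale J₀ (J + 1) * s) h ^ τ.1 * Q.bθ.natAbs ^ (∑ j, τ.2 j) *
        ((∏ j, (Q.α j).den ^ (L j / 2 ^ J * s)) * Q.θ.den ^ (Lθ / 2 ^ J * s)) := by
  unfold CW77.Setup.Dhalf
  simp only [Rat.den_abs_eq_den]

/-- **`Dhalf♭ · rHalf ∈ ℤ`** on the box of level `J` (signed). [folklore]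
[cite: CijsouwWaldschmidt1977, §3 (source FOLLOWED; integrality bookkeeping of the cell’s signed cores, NOT a printed statement)] -/
theorem exists_int_Dhalf_mul_rHalf (J₀ J : ℕ) {L : Fin Q.d → ℕ} {Lθ : ℕ} {u : Idx Q.d h Lb}
    (hu : u ∈ Q.flat.box (h := h) (Lb := Lb) L Lθ J) (τ : Tau Q.d) (s : ℕ) :
    ∃ z : ℤ, ((Q.flat.Dhalf (h := h) J₀ J L Lθ s τ : ℕ) : ℚ) * Q.rHalf J₀ J u τ s = z := by
  obtain ⟨z₁, hz₁⟩ := Q.flat.exists_int_qΔ J₀ (J + 1) u τ.1 s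
  obtain ⟨z₂, hz₂⟩ := Q.flat.exists_int_qA u τ.2
  obtain ⟨z₃, hz₃⟩ := Q.exists_int_qEh hu s
  refine ⟨z₁ * z₂ * z₃, ?_⟩
  rw [Q.flat_Dhalf_eq]
  unfold rHalf
  push_cast at hz₁ hz₂ hz₃ ⊢
  rw [← hz₁, ← hz₂, ← hz₃]; ring

/-- `Dhalf♭ · classVec(T') ∈ ℤ` (signed). [folklore]
[cite: CijsouwWaldschmidt1977, §3 (source FOLLOWED; integrality bookkeeping of the cell’s signed cores, NOT a printed statement)] -/
theorem exists_int_Dhalf_mul_classVec (J₀ J : ℕ) (L : Fin Q.d → ℕ) (Lθ : ℕ) {p : Idx Q.d h Lb → ℤ}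
    (τ : Tau Q.d) (s : ℕ) (T' : Finset (Fin (Q.d + 1))) :
    ∃ z : ℤ, ((Q.flat.Dhalf (h := h) J₀ J L Lθ s τ : ℕ) : ℚ) *
      Q.classVec J₀ J (Q.flat.box (h := h) (Lb := Lb) L Lθ J) p τ s T' = z := by
  classical
  unfold classVec
  rw [mul_sum]
  have hterm : ∀ u ∈ (Q.flat.box (h := h) (Lb := Lb) L Lθ J).filter (fun u => Q.flat.Sset u s = T'),
      ∃ z : ℤ, ((Q.flat.Dhalf (h := h) J₀ J L Lθ s τ : ℕ) : ℚ) * ((p u : ℚ) * Q.rHalf J₀ J u τ s) = z := by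
    intro u hu
    obtain ⟨z, hz⟩ := Q.exists_int_Dhalf_mul_rHalf J₀ J (mem_filter.mp hu).1 τ s
    exact ⟨p u * z, by push_cast; rw [← hz]; ring⟩
  choose z hz using hterm
  refine ⟨∑ u ∈ ((Q.flat.box (h := h) (Lb := Lb) L Lθ J).filter (fun u => Q.flat.Sset u s = T')).attach,
    z u.1 u.2, ?_⟩
  push_cast
  rw [← sum_attach]
  exact sum_congr rfl fun u _ => hz u.1 u.2

end SetupQ

end Literature.NumberTheory.Transcendental.StewartYu

end Part4

/-!
## Part 5 — port of `Summits/ABC/StewartYu/PadicMultiquadraticLiouville.lean`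

# Cell abc-stewartyu, WP-A3 (ii): the `p`-adic Liouville inequality in `ℚ(√α₁, …, √αₖ) ⊂ ℚ_p`

`Summits/ABC/StewartYu/PadicMultiquadraticLiouville.lean` — cell `abc-stewartyu` (HOME
`run/shared/lean/pub/abc-stewartyu/`, seat p3, work package WP-A3 of `HOME/p2/PADIC-CORE.md`;
theorems only, no definition, no named fact), sequel to `PadicMultiquadratic.lean`.

The `p`-adic counterpart of the tree's `CW77.abs_ev_ge` (Cijsouw–Waldschmidt 1977, Lemma 10 over
`ℚ`, file `CijsouwWaldschmidt1977Liouville.lean`): for rationals `αⱼ` with `𝔽₂`-independent square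
classes and `p`-adic integers `sⱼ ∈ ℚ_p` with `sⱼ² = αⱼ`, a non-zero coefficient vector `c` with
`D c_S ∈ ℤ` and `∑ |c_S| ≤ M` has

  `‖∑_S c_S ∏_{j∈S} sⱼ‖_p ≥ (2 D M ∏ⱼ max(|num αⱼ|, den αⱼ))^{-4^{k+1}}`   (`norm_evL_ge`).

This is the lower bound needed at the half points of the `2`-descent in the `p`-adic port of the
Cijsouw–Waldschmidt argument (blueprint §3, dictionary row "Liouville at integer & half points").
Proof: induction on `k` through the conjugate `x̄ = u − sₖ v` of `x = u + sₖ v` (`x̄ ≠ 0` by the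
linear independence of the monomials, `PadicMultiquadratic.evL_ne_zero`), the norm
`x x̄ = u² − αₖ v²` (an evaluation over `k` roots, `evL_cmul`), `p`-adic integrality `‖x̄‖_p ≤ D`
(`norm_evL_le_natCast`), and at the bottom `‖z/D‖_p ≥ ‖z‖_p ≥ 1/|z| ≥ 1/(DM)`
(`inv_natCast_le_norm_natCast`); the archimedean sizes (`CW77.l1_cmul_le`, `CW77.exists_int_cmul`)
enter only through the numerator at the bottom. Everything is [folklore]; nothing is claimed in print.
-/

section Part5

open _root_.Finset Literature.NumberTheory.Transcendental.CW77

namespace Literature.NumberTheory.Transcendental.StewartYu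

namespace Multiquad

open Literature.NumberTheory.Transcendental

variable {p : ℕ} [Fact p.Prime] {k : ℕ}

/-- Integrality: a monomial of `p`-adic integers has norm `≤ 1`. [folklore]
[cite: Waldschmidt1980, Lemma 3.5 (p. 271) (source FOLLOWED: the archimedean Liouville step; this p-adic form: the cell’s adaptation, NOT a printed statement)] -/
theorem norm_monoL_le_one (s : Fin k → ℚ_[p]) (hs1 : ∀ j, ‖s j‖ ≤ 1) (S : Finset (Fin k)) :
    ‖monoL s S‖ ≤ 1 := by
  unfold monoL
  rw [norm_prod]
  exact Finset.prod_le_one (fun j _ => norm_nonneg _) fun j _ => hs1 j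

/-- Integrality: a vector with integer coefficients evaluates to a `p`-adic integer. [folklore]
[cite: Waldschmidt1980, Lemma 3.5 (p. 271) (source FOLLOWED: the archimedean Liouville step; this p-adic form: the cell’s adaptation, NOT a printed statement)] -/
theorem norm_evL_le_one_of_int (s : Fin k → ℚ_[p]) (hs1 : ∀ j, ‖s j‖ ≤ 1)
    {c : Finset (Fin k) → ℚ} (hint : ∀ S, ∃ z : ℤ, c S = z) : ‖evL s c‖ ≤ 1 := by
  unfold evL
  refine IsUltrametricDist.norm_sum_le_of_forall_le_of_nonneg zero_le_one fun S _ => ?_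
  obtain ⟨z, hz⟩ := hint S
  rw [norm_mul, hz]
  have h1 : ‖((z : ℚ) : ℚ_[p])‖ ≤ 1 := by
    rw [Rat.cast_intCast]; exact Padic.norm_int_le_one z
  exact mul_le_one₀ h1 (norm_nonneg _) (norm_monoL_le_one s hs1 S)

/-- `‖D‖_p ≥ 1/D` and hence `1/‖D‖_p ≤ D` for a positive integer `D`. [folklore]
[cite: Waldschmidt1980, Lemma 3.5 (p. 271) (source FOLLOWED: the archimedean Liouville step; this p-adic form: the cell’s adaptation, NOT a printed statement)] -/
theorem inv_norm_natCast_le {D : ℕ} (hD : 1 ≤ D) : 1 / ‖(D : ℚ_[p])‖ ≤ D := by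
  have hD0 : D ≠ 0 := by omega
  have h := inv_natCast_le_norm_natCast (p := p) hD0
  have hDpos : (0 : ℝ) < D := by exact_mod_cast Nat.pos_of_ne_zero hD0
  have hnorm : 0 < ‖(D : ℚ_[p])‖ := norm_pos_iff.mpr (Nat.cast_ne_zero.mpr hD0)
  rw [one_div, inv_le_comm₀ hnorm hDpos]
  exact h

/-- A vector `c` with `D c_S ∈ ℤ` evaluates to a `p`-adic number of norm `≤ D`. [folklore]
[cite: Waldschmidt1980, Lemma 3.5 (p. 271) (source FOLLOWED: the archimedean Liouville step; this p-adic form: the cell’s adaptation, NOT a printed statement)] -/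
theorem norm_evL_le_natCast (s : Fin k → ℚ_[p]) (hs1 : ∀ j, ‖s j‖ ≤ 1)
    {c : Finset (Fin k) → ℚ} {D : ℕ} (hD : 1 ≤ D) (hden : ∀ S, ∃ z : ℤ, (D : ℚ) * c S = z) :
    ‖evL s c‖ ≤ D := by
  have hD0 : D ≠ 0 := by omega
  have hint : ∀ S, ∃ z : ℤ, ((D : ℚ) • c) S = z := fun S => by
    obtain ⟨z, hz⟩ := hden S; exact ⟨z, by simpa using hz⟩
  have h1 := norm_evL_le_one_of_int s hs1 hint
  rw [evL_smul, norm_mul, Rat.cast_natCast] at h1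
  have hnorm : 0 < ‖(D : ℚ_[p])‖ := norm_pos_iff.mpr (Nat.cast_ne_zero.mpr hD0)
  have h2 : ‖evL s c‖ ≤ 1 / ‖(D : ℚ_[p])‖ := by
    rw [le_div_iff₀ hnorm]; linarith [h1]
  exact h2.trans (inv_norm_natCast_le hD)

/-- `‖z‖_p ≥ 1/|z|` for a non-zero integer `z`. [folklore]
[cite: Waldschmidt1980, Lemma 3.5 (p. 271) (source FOLLOWED: the archimedean Liouville step; this p-adic form: the cell’s adaptation, NOT a printed statement)] -/
theorem inv_abs_le_norm_intCast {z : ℤ} (hz : z ≠ 0) : 1 / |(z : ℝ)| ≤ ‖(z : ℚ_[p])‖ := by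
  have hn : z.natAbs ≠ 0 := Int.natAbs_ne_zero.mpr hz
  have h := inv_natCast_le_norm_natCast (p := p) hn
  have habs : |(z : ℝ)| = (z.natAbs : ℝ) := by
    rw [← Int.cast_natCast, Int.natCast_natAbs, Int.cast_abs]
  have hnorm : ‖(z : ℚ_[p])‖ = ‖((z.natAbs : ℕ) : ℚ_[p])‖ := by
    rcases Int.natAbs_eq z with h' | h'
    · conv_lhs => rw [h']
      simp
    · conv_lhs => rw [h']
      simp
  rw [habs, hnorm, one_div]
  exact h

/-- The numerical step of the `p`-adic induction. [folklore]
[cite: Waldschmidt1980, Lemma 3.5 (p. 271) (source FOLLOWED: the archimedean Liouville step; this p-adic form: the cell’s adaptation, NOT a printed statement)] -/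
theorem padic_numeric_step {D M H P y x : ℝ} {E : ℕ} (hD : 1 ≤ D) (hM : 1 ≤ M) (hH : 1 ≤ H)
    (hP : 1 ≤ P) (hE : 1 ≤ E)
    (hy : 1 / (4 * D ^ 2 * M ^ 2 * H ^ 2 * P ^ 3) ^ E ≤ y) (hxy : y ≤ x * D) :
    1 / (2 * D * M * (P * H)) ^ (4 * E) ≤ x := by
  set A : ℝ := 4 * D ^ 2 * M ^ 2 * H ^ 2 * P ^ 3 with hA
  have hD2 : 1 ≤ D ^ 2 := one_le_pow₀ hD
  have hM2 : 1 ≤ M ^ 2 := one_le_pow₀ hM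
  have hH2 : 1 ≤ H ^ 2 := one_le_pow₀ hH
  have hP3 : 1 ≤ P ^ 3 := one_le_pow₀ hP
  have hQ1 : 1 ≤ 4 * D ^ 2 * M ^ 2 * H ^ 2 := by
    have := one_le_mul_of_one_le_of_one_le (one_le_mul_of_one_le_of_one_le hD2 hM2) hH2
    linarith
  have hA1 : 1 ≤ A := by rw [hA]; exact one_le_mul_of_one_le_of_one_le hQ1 hP3
  have hAE : 0 < A ^ E := by positivity
  have hD0 : 0 < D := by linarith
  -- `x ≥ 1 / (A^E D)`
  have hx : 1 / (A ^ E * D) ≤ x := by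
    rw [div_le_iff₀ (by positivity)]
    have h1 : 1 / A ^ E ≤ x * D := hy.trans hxy
    calc (1 : ℝ) = 1 / A ^ E * A ^ E := by field_simp
      _ ≤ x * D * A ^ E := mul_le_mul_of_nonneg_right h1 hAE.le
      _ = x * (A ^ E * D) := by ring
  refine le_trans ?_ hx
  -- `A^E D ≤ ((2DMPH)^4)^E`
  set Q : ℝ := 4 * D ^ 2 * M ^ 2 * H ^ 2 * P with hQ
  have hQ1' : 1 ≤ Q := by rw [hQ]; exact one_le_mul_of_one_le_of_one_le hQ1 hP
  have hDQ : D ≤ Q := by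
    have h14 : 1 ≤ 4 * D * M ^ 2 * H ^ 2 * P := by
      have := one_le_mul_of_one_le_of_one_le
        (one_le_mul_of_one_le_of_one_le (one_le_mul_of_one_le_of_one_le hD hM2) hH2) hP
      linarith
    calc D = D * 1 := (mul_one D).symm
      _ ≤ D * (4 * D * M ^ 2 * H ^ 2 * P) := mul_le_mul_of_nonneg_left h14 hD0.le
      _ = Q := by rw [hQ]; ring
  have hDQE : D ≤ Q ^ E := by
    calc D ≤ Q := hDQ
      _ = Q ^ 1 := (pow_one _).symm
      _ ≤ Q ^ E := pow_le_pow_right₀ hQ1' hE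
  have hB : A ^ E * D ≤ (2 * D * M * (P * H)) ^ (4 * E) := by
    calc A ^ E * D ≤ A ^ E * Q ^ E := mul_le_mul_of_nonneg_left hDQE hAE.le
      _ = (A * Q) ^ E := (mul_pow _ _ _).symm
      _ = ((2 * D * M * (P * H)) ^ 4) ^ E := by congr 1; rw [hA, hQ]; ring
      _ = (2 * D * M * (P * H)) ^ (4 * E) := by rw [← pow_mul]
  exact one_div_le_one_div_of_le (by positivity) hB

set_option maxHeartbeats 800000 in
/-- **The `p`-adic Liouville inequality in `ℚ(√α₁, …, √αₖ) ⊂ ℚ_p`.** Let `αⱼ ∈ ℚ` have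
`𝔽₂`-independent square classes (no non-empty sub-product is a square in `ℚ`) and let `sⱼ ∈ ℚ_p` be
`p`-adic integers with `sⱼ² = αⱼ` (e.g. the `p`-adic square roots of principal units). If `c ≠ 0`,
`D c_S ∈ ℤ` for all `S` and `∑ |c_S| ≤ M` (`D, M ≥ 1`), then
`‖∑_S c_S ∏_{j∈S} sⱼ‖_p ≥ (2 D M ∏ⱼ max(|num αⱼ|, den αⱼ))^{-4^{k+1}}`.
Proof: induction on `k` via the conjugate `x̄ = u − s_k v` of `x = u + s_k v`: `x̄ ≠ 0` by the
linear independence of the monomials, `x x̄ = u² − αₖ v²` is an evaluation over `k` roots,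
`‖x̄‖_p ≤ D` (integrality), and at `k = 0` a non-zero rational `z/D` has `‖z/D‖_p ≥ ‖z‖_p ≥ 1/|z|`.
This is the `p`-adic counterpart of `CW77.abs_ev_ge` (Cijsouw–Waldschmidt 1977, Lemma 10 over `ℚ`);
the archimedean sizes enter only through the numerator of the norm at the bottom. [folklore]
[cite: Waldschmidt1980, Lemma 3.5 (p. 271) (source FOLLOWED: the archimedean Liouville step; this p-adic form: the cell’s adaptation, NOT a printed statement)] -/
theorem norm_evL_ge : ∀ (k : ℕ) (α : Fin k → ℚ),
    (∀ T : Finset (Fin k), T.Nonempty → ¬ IsSquare (∏ j ∈ T, α j)) →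
    ∀ (s : Fin k → ℚ_[p]), (∀ j, s j * s j = (α j : ℚ_[p])) → (∀ j, ‖s j‖ ≤ 1) →
    ∀ (c : Finset (Fin k) → ℚ), c ≠ 0 → ∀ (D : ℕ), 1 ≤ D → (∀ S, ∃ z : ℤ, (D : ℚ) * c S = z) →
    ∀ (M : ℝ), 1 ≤ M → ∑ S, |(c S : ℝ)| ≤ M →
    1 / (2 * D * M * heightProd α) ^ (4 ^ (k + 1)) ≤ ‖evL s c‖ := by
  intro k
  induction k with
  | zero =>
    intro α hind s hs hs1 c hc D hD hden M hM hcM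
    -- `evL s c = c ∅`, a non-zero rational with denominator `≤ D`
    have huniv : (univ : Finset (Finset (Fin 0))) = {∅} := by
      ext S
      simp only [Finset.mem_univ, Finset.mem_singleton, true_iff]
      exact Finset.eq_empty_of_isEmpty S
    have hev : evL s c = ((c ∅ : ℚ) : ℚ_[p]) := by
      unfold evL
      rw [huniv, Finset.sum_singleton]
      unfold monoL
      rw [Finset.prod_empty, mul_one]
    have hc0 : c ∅ ≠ 0 := by
      intro h; apply hc; funext S
      have : S = ∅ := Finset.eq_empty_of_isEmpty S
      rw [this, h]; rfl
    obtain ⟨z, hz⟩ := hden ∅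
    have hD0 : (D : ℚ) ≠ 0 := by exact_mod_cast (show D ≠ 0 by omega)
    have hz0 : z ≠ 0 := by
      rintro rfl
      rw [Int.cast_zero, mul_eq_zero] at hz
      rcases hz with h | h
      · exact hD0 h
      · exact hc0 h
    have hcz : c ∅ = (z : ℚ) / D := by
      field_simp; rw [mul_comm]; exact hz
    -- archimedean: `|z| ≤ D M`
    have hcM' : |((c ∅ : ℚ) : ℝ)| ≤ M := by
      have : |((c ∅ : ℚ) : ℝ)| ≤ ∑ S, |(c S : ℝ)| := by
        rw [huniv, Finset.sum_singleton]
      exact this.trans hcM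
    have hDR : (0 : ℝ) < D := by exact_mod_cast (show 0 < D by omega)
    have hzle : |(z : ℝ)| ≤ D * M := by
      have h1 : ((c ∅ : ℚ) : ℝ) = (z : ℝ) / D := by rw [hcz]; push_cast; rfl
      rw [h1, abs_div, abs_of_pos hDR, div_le_iff₀ hDR] at hcM'
      linarith [hcM']
    have hzabs : (0 : ℝ) < |(z : ℝ)| := by
      have : (z : ℝ) ≠ 0 := by exact_mod_cast hz0
      exact abs_pos.mpr this
    -- `p`-adic: `‖c ∅‖ = ‖z‖/‖D‖ ≥ ‖z‖ ≥ 1/|z|`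
    have hnormD : ‖(D : ℚ_[p])‖ ≤ 1 := by
      have := Padic.norm_int_le_one (p := p) (D : ℤ)
      simpa using this
    have hnormD0 : 0 < ‖(D : ℚ_[p])‖ :=
      norm_pos_iff.mpr (Nat.cast_ne_zero.mpr (show D ≠ 0 by omega))
    have hge : ‖((z : ℚ) : ℚ_[p])‖ ≤ ‖evL s c‖ := by
      rw [hev, hcz, Rat.cast_div, Rat.cast_intCast, Rat.cast_natCast, norm_div]
      rw [le_div_iff₀ hnormD0]
      calc ‖((z : ℚ) : ℚ_[p])‖ * ‖(D : ℚ_[p])‖ ≤ ‖((z : ℚ) : ℚ_[p])‖ * 1 :=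
            mul_le_mul_of_nonneg_left hnormD (norm_nonneg _)
        _ = ‖((z : ℤ) : ℚ_[p])‖ := by rw [mul_one, Rat.cast_intCast]
    have hz1 : 1 / |(z : ℝ)| ≤ ‖((z : ℚ) : ℚ_[p])‖ := by
      rw [Rat.cast_intCast]; exact inv_abs_le_norm_intCast hz0
    have hP : heightProd α = 1 := by unfold heightProd; simp
    rw [hP, mul_one]
    have hD1 : (1 : ℝ) ≤ D := by exact_mod_cast hD
    have hDM1 : (1 : ℝ) ≤ D * M := one_le_mul_of_one_le_of_one_le hD1 hM
    have hpow : |(z : ℝ)| ≤ (2 * (D : ℝ) * M) ^ (4 ^ (0 + 1)) := by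
      calc |(z : ℝ)| ≤ D * M := hzle
        _ ≤ 2 * D * M := by nlinarith
        _ = (2 * D * M) ^ 1 := (pow_one _).symm
        _ ≤ (2 * D * M) ^ (4 ^ (0 + 1)) := pow_le_pow_right₀ (by nlinarith) (by norm_num)
    calc 1 / (2 * (D : ℝ) * M) ^ 4 ^ (0 + 1) ≤ 1 / |(z : ℝ)| :=
          one_div_le_one_div_of_le hzabs hpow
      _ ≤ ‖((z : ℚ) : ℚ_[p])‖ := hz1
      _ ≤ ‖evL s c‖ := hge
  | succ k ih =>
    intro α' hind s' hs' hs1' c hc D hD hden M hM hcM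
    set a : ℚ := α' (Fin.last k) with ha
    set α : Fin k → ℚ := init α' with hαdef
    set s : Fin k → ℚ_[p] := initL s' with hsdef
    have hs : ∀ j, s j * s j = (α j : ℚ_[p]) := fun j => hs' _
    have hs1 : ∀ j, ‖s j‖ ≤ 1 := fun j => hs1' _
    have hindα : ∀ T : Finset (Fin k), T.Nonempty → ¬ IsSquare (∏ j ∈ T, α j) := hind_init α' hind
    set H : ℝ := hgt a with hH
    set P : ℝ := heightProd α with hP
    have hH1 : 1 ≤ H := one_le_hgt a
    have hP1 : 1 ≤ P := one_le_heightProd α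
    have hP' : heightProd α' = P * H := by
      rw [hP, hH, ha]; unfold heightProd; rw [Fin.prod_univ_castSucc]
    have hD1 : (1 : ℝ) ≤ D := by exact_mod_cast hD
    set u : ℚ_[p] := evL s (lo c) with hu
    set v : ℚ_[p] := evL s (hi c) with hv
    set r : ℚ_[p] := s' (Fin.last k) with hr
    have hrr : r * r = (a : ℚ_[p]) := hs' (Fin.last k)
    have hx : evL s' c = u + r * v := evL_succ s' c
    -- sums of the parts
    have hsum := sum_abs_succ c
    have hlo_le : ∑ S, |(lo c S : ℝ)| ≤ M := by
      have : 0 ≤ ∑ S, |(hi c S : ℝ)| := Finset.sum_nonneg fun S _ => abs_nonneg _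
      linarith
    have hhi_le : ∑ S, |(hi c S : ℝ)| ≤ M := by
      have : 0 ≤ ∑ S, |(lo c S : ℝ)| := Finset.sum_nonneg fun S _ => abs_nonneg _
      linarith
    have hden_lo : ∀ S, ∃ z : ℤ, (D : ℚ) * lo c S = z := fun S => hden _
    have hden_hi : ∀ S, ∃ z : ℤ, (D : ℚ) * hi c S = z := fun S => hden _
    have hE : 4 ^ (k + 1 + 1) = 4 * 4 ^ (k + 1) := by ring
    rcases eq_or_ne (hi c) 0 with hhi0 | hhi0
    · -- no last root: the induction hypothesis for `lo c`
      have hlo0 : lo c ≠ 0 := (lo_hi_ne_zero hc).resolve_right (fun h => h hhi0)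
      have key := ih α hindα s hs hs1 (lo c) hlo0 D hD hden_lo M hM hlo_le
      have hv0 : v = 0 := by rw [hv, hhi0, evL_zero]
      have hx' : evL s' c = u := by rw [hx, hv0]; ring
      rw [hx']
      refine le_trans ?_ key
      rw [hP']
      have hb1 : (1 : ℝ) ≤ 2 * D * M * P := by
        have := one_le_mul_of_one_le_of_one_le (one_le_mul_of_one_le_of_one_le hD1 hM) hP1
        nlinarith
      have hb : 2 * (D : ℝ) * M * P ≤ 2 * D * M * (P * H) := by
        have : 2 * (D : ℝ) * M * P * 1 ≤ 2 * D * M * P * H :=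
          mul_le_mul_of_nonneg_left hH1 (by positivity)
        linarith
      apply one_div_le_one_div_of_le (by positivity)
      calc (2 * (D : ℝ) * M * P) ^ 4 ^ (k + 1) ≤ (2 * D * M * (P * H)) ^ 4 ^ (k + 1) :=
            pow_le_pow_left₀ (by positivity) hb _
        _ ≤ (2 * D * M * (P * H)) ^ 4 ^ (k + 1 + 1) :=
            pow_le_pow_right₀ (hb1.trans hb) (Nat.pow_le_pow_right (by norm_num) (by omega))
    · -- the conjugate and the norm
      set c'' : Finset (Fin k) → ℚ := cmul α (lo c) (lo c) - a • cmul α (hi c) (hi c) with hc''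
      have hev'' : evL s c'' = u * u - (a : ℚ_[p]) * (v * v) := by
        rw [hc'', evL_sub, evL_smul, evL_cmul α s hs, evL_cmul α s hs]
      have hxbar : evL s' (conjLast c) = u - r * v := evL_conjLast s' c
      have hxbar0 : evL s' (conjLast c) ≠ 0 := evL_ne_zero α' hind s' hs' (conjLast_ne_zero hc)
      have hx0 : evL s' c ≠ 0 := evL_ne_zero α' hind s' hs' hc
      have hnorm : evL s' c * evL s' (conjLast c) = evL s c'' := by
        rw [hx, hxbar, hev'', ← hrr]; ring
      have hc''0 : c'' ≠ 0 := by
        intro h0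
        have : evL s c'' = 0 := by rw [h0, evL_zero]
        rw [← hnorm] at this
        rcases mul_eq_zero.mp this with h | h
        · exact hx0 h
        · exact hxbar0 h
      -- denominators and sizes of `c''` (verbatim from the archimedean file)
      set Dd : ℕ := D * D * ∏ j, (α j).den with hDd
      set D'' : ℕ := Dd * a.den with hD''
      have hden'' : ∀ U, ∃ z : ℤ, (D'' : ℚ) * c'' U = z := by
        intro U
        obtain ⟨z₁, hz₁⟩ := exists_int_cmul α (lo c) (lo c) hden_lo hden_lo U
        obtain ⟨z₂, hz₂⟩ := exists_int_cmul α (hi c) (hi c) hden_hi hden_hi U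
        refine ⟨a.den * z₁ - a.num * z₂, ?_⟩
        rw [hc'', hD'']
        simp only [Pi.sub_apply, Pi.smul_apply, smul_eq_mul]
        push_cast
        rw [← hDd] at hz₁ hz₂
        have ha' : (a.den : ℚ) * a = a.num := by rw [mul_comm]; exact Rat.mul_den_eq_num a
        calc ((Dd : ℚ) * a.den) * (cmul α (lo c) (lo c) U - a * cmul α (hi c) (hi c) U)
            = (a.den : ℚ) * ((Dd : ℚ) * cmul α (lo c) (lo c) U) -
              ((a.den : ℚ) * a) * ((Dd : ℚ) * cmul α (hi c) (hi c) U) := by ring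
          _ = (a.den : ℚ) * z₁ - (a.num : ℚ) * z₂ := by rw [hz₁, hz₂, ha']
      have hD''1 : 1 ≤ D'' := by
        rw [hD'', hDd]
        have h1 : 1 ≤ ∏ j, (α j).den := Finset.one_le_prod' fun j _ => (α j).pos
        have := a.pos
        have : 1 ≤ D * D := Nat.one_le_iff_ne_zero.mpr (by positivity)
        exact Nat.one_le_iff_ne_zero.mpr (by positivity)
      have hD''le : (D'' : ℝ) ≤ D ^ 2 * P * H := by
        rw [hD'', hDd]; push_cast
        have h1 : ((∏ j, ((α j).den : ℝ))) ≤ P := by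
          have := prod_den_le α; push_cast at this; exact this
        have h2 : ((a.den : ℝ)) ≤ H := den_le_hgt a
        calc (D : ℝ) * D * (∏ j, ((α j).den : ℝ)) * a.den ≤ (D : ℝ) * D * P * H :=
            mul_le_mul (mul_le_mul_of_nonneg_left h1 (by positivity)) h2 (by positivity)
              (by positivity)
          _ = (D : ℝ) ^ 2 * P * H := by ring
      set M'' : ℝ := 2 * H * P * M ^ 2 with hM''
      have hPabs : ∏ j, max 1 |(α j : ℝ)| ≤ P := prod_max_one_abs_le α
      have hc''M : ∑ U, |(c'' U : ℝ)| ≤ M'' := by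
        have h1 := l1_cmul_le α (lo c) (lo c)
        have h2 := l1_cmul_le α (hi c) (hi c)
        have hlo2 : (∑ S, |(lo c S : ℝ)|) * ∑ S, |(lo c S : ℝ)| ≤ M ^ 2 := by
          rw [sq]; exact mul_le_mul hlo_le hlo_le (Finset.sum_nonneg fun _ _ => abs_nonneg _)
            (by linarith)
        have hhi2 : (∑ S, |(hi c S : ℝ)|) * ∑ S, |(hi c S : ℝ)| ≤ M ^ 2 := by
          rw [sq]; exact mul_le_mul hhi_le hhi_le (Finset.sum_nonneg fun _ _ => abs_nonneg _)
            (by linarith)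
        have hA : ∑ U, |(cmul α (lo c) (lo c) U : ℝ)| ≤ P * M ^ 2 :=
          h1.trans (mul_le_mul hPabs hlo2 (by positivity) (by positivity))
        have hB : ∑ U, |(cmul α (hi c) (hi c) U : ℝ)| ≤ P * M ^ 2 :=
          h2.trans (mul_le_mul hPabs hhi2 (by positivity) (by positivity))
        have haH : |(a : ℝ)| ≤ H := abs_le_hgt a
        calc ∑ U, |(c'' U : ℝ)|
            ≤ ∑ U, (|(cmul α (lo c) (lo c) U : ℝ)| + |(a : ℝ)| * |(cmul α (hi c) (hi c) U : ℝ)|) := by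
              refine Finset.sum_le_sum fun U _ => ?_
              rw [hc'']
              simp only [Pi.sub_apply, Pi.smul_apply, smul_eq_mul, Rat.cast_sub, Rat.cast_mul]
              calc |(cmul α (lo c) (lo c) U : ℝ) - (a : ℝ) * cmul α (hi c) (hi c) U|
                  ≤ |(cmul α (lo c) (lo c) U : ℝ)| + |(a : ℝ) * cmul α (hi c) (hi c) U| :=
                    abs_sub _ _
                _ = _ := by rw [abs_mul]
          _ = ∑ U, |(cmul α (lo c) (lo c) U : ℝ)| +
                |(a : ℝ)| * ∑ U, |(cmul α (hi c) (hi c) U : ℝ)| := by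
              rw [Finset.sum_add_distrib, Finset.mul_sum]
          _ ≤ P * M ^ 2 + H * (P * M ^ 2) :=
              add_le_add hA (mul_le_mul haH hB (by positivity) (by positivity))
          _ ≤ M'' := by
              have : P * M ^ 2 ≤ H * (P * M ^ 2) := le_mul_of_one_le_left (by positivity) hH1
              rw [hM'']; linarith
      have hM''1 : 1 ≤ M'' := by
        rw [hM'']
        have h1 : 1 ≤ H * P * M ^ 2 :=
          one_le_mul_of_one_le_of_one_le (one_le_mul_of_one_le_of_one_le hH1 hP1) (one_le_pow₀ hM)
        linarith
      -- the induction hypothesis for `c''`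
      have key := ih α hindα s hs hs1 c'' hc''0 D'' hD''1 hden'' M'' hM''1 hc''M
      -- `‖x̄‖_p ≤ D`
      have hden_conj : ∀ S, ∃ z : ℤ, (D : ℚ) * conjLast c S = z := by
        intro S
        obtain ⟨z, hz⟩ := hden S
        unfold conjLast
        split_ifs
        · exact ⟨-z, by rw [mul_neg, hz]; push_cast; ring⟩
        · exact ⟨z, hz⟩
      have hxbar_le : ‖evL s' (conjLast c)‖ ≤ D := norm_evL_le_natCast s' hs1' hD hden_conj
      -- assemble
      have hy : 1 / (4 * (D : ℝ) ^ 2 * M ^ 2 * H ^ 2 * P ^ 3) ^ 4 ^ (k + 1) ≤ ‖evL s c''‖ := by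
        refine le_trans ?_ key
        apply one_div_le_one_div_of_le (by positivity)
        apply pow_le_pow_left₀ (by positivity)
        calc 2 * (D'' : ℝ) * M'' * P ≤ 2 * ((D : ℝ) ^ 2 * P * H) * (2 * H * P * M ^ 2) * P := by
              rw [hM'']
              apply mul_le_mul_of_nonneg_right _ (by positivity)
              apply mul_le_mul_of_nonneg_right _ (by positivity)
              exact mul_le_mul_of_nonneg_left hD''le (by norm_num)
          _ = 4 * (D : ℝ) ^ 2 * M ^ 2 * H ^ 2 * P ^ 3 := by ring
      have hxyz : ‖evL s c''‖ ≤ ‖evL s' c‖ * D := by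
        rw [← hnorm, norm_mul]
        exact mul_le_mul_of_nonneg_left hxbar_le (norm_nonneg _)
      rw [hP', hE]
      exact padic_numeric_step hD1 hM hH1 hP1 (Nat.one_le_pow _ _ (by norm_num)) hy hxyz

end Multiquad

end Literature.NumberTheory.Transcendental.StewartYu

end Part5

/-!
## Part 6 — port of `Summits/ABC/StewartYu/PadicMultiquadraticLiouvilleSharp.lean`

# Cell abc-stewartyu, WP-A3 (ii′): the SHARP `p`-adic Liouville inequality in `ℚ(√α₁, …, √αₖ) ⊂ ℚ_p`
# (exponent `2ᵏ`)

`Summits/ABC/StewartYu/PadicMultiquadraticLiouvilleSharp.lean` — cell `abc-stewartyu` (HOME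
`run/shared/lean/pub/abc-stewartyu/`, seat p3, work package WP-A3 of `HOME/p2/PADIC-CORE.md` and
row "W80Liouville" of `HOME/plan/PORT-MAP.md`; theorems only, no definition, no named fact), sequel to
`PadicMultiquadraticLiouville.lean` (exponent `4^{k+1}`, the Cijsouw–Waldschmidt 1977 quality).

The `p`-adic twin of the tree's `Waldschmidt1980.abs_ev_ge_sharp` (file
`Waldschmidt1980Liouville.lean`, potential `M/(4 D M P²)^{2ᵏ}`): under the hypotheses of
`Multiquad.norm_evL_ge` (rationals `αⱼ` with `𝔽₂`-independent square classes, `p`-adic integers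
`sⱼ ∈ ℚ_p` with `sⱼ² = αⱼ`, a non-zero coefficient vector `c` with `D c_S ∈ ℤ`, `∑ |c_S| ≤ M`, `M ≥ 1`)

  `‖∑_S c_S ∏_{j∈S} sⱼ‖_p ≥ D / (4 D² M (∏ⱼ H(αⱼ))³)^{2ᵏ}`   (`norm_evL_ge_sharp`),

`H(α) = max(|num α|, den α)`. The induction on `k` is the same as in the archimedean file (norm
`x x̄ = u² − αₖ v²` via `evL_cmul`, conjugate `x̄ ≠ 0` by `evL_ne_zero`); what changes is the
book-keeping of the potential: the archimedean step credits the numerator `M` against the SIZE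
`|x̄| ≤ H M P` of the conjugate, whereas `p`-adically the conjugate costs `‖x̄‖_p ≤ D`
(`norm_evL_le_natCast`), so the credit is the numerator `D`, renewed at each level by `D'' ≥ D²`,
and the potential carries `D²` and `P³` (`padic_numeric_step_sharp`). The base `k = 0` is the product
formula for a rational `z/D` with `|z| ≤ D M`: `‖z/D‖_p ≥ ‖z‖_p ≥ 1/|z| ≥ 1/(D M)` (`norm_evL_ge_base`).
Consequence for the parameter files of the `p`-adic core (PORT-MAP §1b): the order of zeros `T` may
carry W80's factor `2^m` instead of `4^{m+1}`. Everything is [folklore]; nothing is claimed in print.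
-/

section Part6

open _root_.Finset Literature.NumberTheory.Transcendental.CW77

namespace Literature.NumberTheory.Transcendental.StewartYu

namespace Multiquad

open Literature.NumberTheory.Transcendental

variable {p : ℕ} [Fact p.Prime] {k : ℕ}

/-- The base of the induction (no roots): a non-zero rational `c_∅ = z/D` with `|c_∅| ≤ M` has
`‖c_∅‖_p ≥ ‖z‖_p ≥ 1/|z| ≥ 1/(DM)`. [folklore]
[cite: Waldschmidt1980, Lemma 3.5 (p. 271) (source FOLLOWED; the sharp p-adic form is the cell’s adaptation, NOT a printed statement)] -/
theorem norm_evL_ge_base (s : Fin 0 → ℚ_[p]) {c : Finset (Fin 0) → ℚ} (hc : c ≠ 0) {D : ℕ}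
    (hD : 1 ≤ D) (hden : ∀ S, ∃ z : ℤ, (D : ℚ) * c S = z) {M : ℝ} (hcM : ∑ S, |(c S : ℝ)| ≤ M) :
    1 / ((D : ℝ) * M) ≤ ‖evL s c‖ := by
  have huniv : (univ : Finset (Finset (Fin 0))) = {∅} := by
    ext S
    simp only [Finset.mem_univ, Finset.mem_singleton, true_iff]
    exact Finset.eq_empty_of_isEmpty S
  have hev : evL s c = ((c ∅ : ℚ) : ℚ_[p]) := by
    unfold evL
    rw [huniv, Finset.sum_singleton]
    unfold monoL
    rw [Finset.prod_empty, mul_one]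
  have hc0 : c ∅ ≠ 0 := by
    intro h; apply hc; funext S
    have : S = ∅ := Finset.eq_empty_of_isEmpty S
    rw [this, h]; rfl
  obtain ⟨z, hz⟩ := hden ∅
  have hD0 : (D : ℚ) ≠ 0 := by exact_mod_cast (show D ≠ 0 by omega)
  have hz0 : z ≠ 0 := by
    rintro rfl
    rw [Int.cast_zero, mul_eq_zero] at hz
    rcases hz with h | h
    · exact hD0 h
    · exact hc0 h
  have hcz : c ∅ = (z : ℚ) / D := by
    field_simp; rw [mul_comm]; exact hz
  have hcM' : |((c ∅ : ℚ) : ℝ)| ≤ M := by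
    have : |((c ∅ : ℚ) : ℝ)| ≤ ∑ S, |(c S : ℝ)| := by
      rw [huniv, Finset.sum_singleton]
    exact this.trans hcM
  have hDR : (0 : ℝ) < D := by exact_mod_cast (show 0 < D by omega)
  have hzle : |(z : ℝ)| ≤ D * M := by
    have h1 : ((c ∅ : ℚ) : ℝ) = (z : ℝ) / D := by rw [hcz]; push_cast; rfl
    rw [h1, abs_div, abs_of_pos hDR, div_le_iff₀ hDR] at hcM'
    linarith [hcM']
  have hzabs : (0 : ℝ) < |(z : ℝ)| := by
    have : (z : ℝ) ≠ 0 := by exact_mod_cast hz0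
    exact abs_pos.mpr this
  have hnormD : ‖(D : ℚ_[p])‖ ≤ 1 := by
    have := Padic.norm_int_le_one (p := p) (D : ℤ)
    simpa using this
  have hnormD0 : 0 < ‖(D : ℚ_[p])‖ :=
    norm_pos_iff.mpr (Nat.cast_ne_zero.mpr (show D ≠ 0 by omega))
  have hge : ‖((z : ℚ) : ℚ_[p])‖ ≤ ‖evL s c‖ := by
    rw [hev, hcz, Rat.cast_div, Rat.cast_intCast, Rat.cast_natCast, norm_div]
    rw [le_div_iff₀ hnormD0]
    calc ‖((z : ℚ) : ℚ_[p])‖ * ‖(D : ℚ_[p])‖ ≤ ‖((z : ℚ) : ℚ_[p])‖ * 1 :=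
          mul_le_mul_of_nonneg_left hnormD (norm_nonneg _)
      _ = ‖((z : ℤ) : ℚ_[p])‖ := by rw [mul_one, Rat.cast_intCast]
  have hz1 : 1 / |(z : ℝ)| ≤ ‖((z : ℚ) : ℚ_[p])‖ := by
    rw [Rat.cast_intCast]; exact inv_abs_le_norm_intCast hz0
  calc 1 / ((D : ℝ) * M) ≤ 1 / |(z : ℝ)| := one_div_le_one_div_of_le hzabs hzle
    _ ≤ ‖((z : ℚ) : ℚ_[p])‖ := hz1
    _ ≤ ‖evL s c‖ := hge

/-- The numerical step of the SHARP `p`-adic induction: from `D''/(4 D''² M'' P³)^E ≤ y`,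
`D² ≤ D'' ≤ D² P H`, `M'' = 2 H P M²` and `y ≤ x · D` we get `D/(4 D² M (PH)³)^{2E} ≤ x`
(`4 D''² M'' P³ ≤ 8 D⁴ M² P⁶ H³ ≤ (4 D² M P³ H³)² = 16 D⁴ M² P⁶ H⁶`; the numerator `D''` pays
the `p`-adic loss `‖x̄‖_p ≤ D` and renews the credit `D`). [folklore]
[cite: Waldschmidt1980, Lemma 3.5 (p. 271) (source FOLLOWED; the sharp p-adic form is the cell’s adaptation, NOT a printed statement)] -/
theorem padic_numeric_step_sharp {D M H P y x D'' : ℝ} {E : ℕ} (hD : 1 ≤ D) (hM : 1 ≤ M)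
    (hH : 1 ≤ H) (hP : 1 ≤ P) (hD''ge : D ^ 2 ≤ D'') (hD''le : D'' ≤ D ^ 2 * P * H)
    (hy : D'' / (4 * D'' ^ 2 * (2 * H * P * M ^ 2) * P ^ 3) ^ E ≤ y) (hxy : y ≤ x * D) :
    D / (4 * D ^ 2 * M * (P * H) ^ 3) ^ (2 * E) ≤ x := by
  have hD0 : 0 < D := by linarith
  set old : ℝ := 4 * D'' ^ 2 * (2 * H * P * M ^ 2) * P ^ 3 with hold
  have hD''0 : 0 < D'' := lt_of_lt_of_le (by positivity) hD''ge
  have hold0 : 0 < old := by positivity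
  -- `x ≥ y / D ≥ D''/(old^E D) ≥ D/old^E`
  have hx : D / old ^ E ≤ x := by
    have h1 : D'' / old ^ E ≤ x * D := hy.trans hxy
    have h2 : D * D ≤ D'' := by rw [← sq]; exact hD''ge
    have h3 : D / old ^ E * D ≤ x * D := by
      calc D / old ^ E * D = (D * D) / old ^ E := by ring
        _ ≤ D'' / old ^ E := div_le_div_of_nonneg_right h2 (by positivity)
        _ ≤ x * D := h1
    exact le_of_mul_le_mul_right h3 hD0
  refine le_trans ?_ hx
  -- `old ≤ (4 D² M (PH)³)²`
  have hbase : old ≤ (4 * D ^ 2 * M * (P * H) ^ 3) ^ 2 := by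
    have h1 : old ≤ 4 * (D ^ 2 * P * H) ^ 2 * (2 * H * P * M ^ 2) * P ^ 3 := by
      rw [hold]
      have : 0 ≤ (2 * H * P * M ^ 2) * P ^ 3 := by positivity
      have hsq : D'' ^ 2 ≤ (D ^ 2 * P * H) ^ 2 := pow_le_pow_left₀ hD''0.le hD''le 2
      nlinarith
    have h2 : 4 * (D ^ 2 * P * H) ^ 2 * (2 * H * P * M ^ 2) * P ^ 3 =
        8 * D ^ 4 * M ^ 2 * P ^ 6 * H ^ 3 := by ring
    have h3 : (4 * D ^ 2 * M * (P * H) ^ 3) ^ 2 = 16 * D ^ 4 * M ^ 2 * P ^ 6 * H ^ 6 := by ring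
    rw [h2] at h1; rw [h3]
    have hH3 : H ^ 3 ≤ H ^ 6 := pow_le_pow_right₀ hH (by norm_num)
    have h0 : 0 ≤ 8 * D ^ 4 * M ^ 2 * P ^ 6 := by positivity
    nlinarith
  have hpow : old ^ E ≤ (4 * D ^ 2 * M * (P * H) ^ 3) ^ (2 * E) := by
    rw [pow_mul]; exact pow_le_pow_left₀ hold0.le hbase E
  exact div_le_div_of_nonneg_left hD0.le (by positivity) hpow

set_option maxHeartbeats 800000 in
/-- **The SHARP `p`-adic Liouville inequality in `ℚ(√α₁, …, √αₖ) ⊂ ℚ_p`** (exponent `2ᵏ`): under the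
hypotheses of `norm_evL_ge`,
`‖∑_S c_S ∏_{j∈S} sⱼ‖_p ≥ D / (4 D² M (∏ⱼ H(αⱼ))³)^{2ᵏ}`.
The `p`-adic twin of the tree's `Waldschmidt1980.abs_ev_ge_sharp` (`M/(4 D M P²)^{2ᵏ}`): the
archimedean induction credits the numerator `M` against the size `|x̄| ≤ HMP` of the conjugate; here
the conjugate costs `‖x̄‖_p ≤ D` instead, so the credit is the numerator `D` (renewed by `D'' ≥ D²`)
and the potential carries `D²` and `P³`. [folklore]
[cite: Waldschmidt1980, Lemma 3.5 (p. 271) (source FOLLOWED; the sharp p-adic form is the cell’s adaptation, NOT a printed statement)] -/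
theorem norm_evL_ge_sharp : ∀ (k : ℕ) (α : Fin k → ℚ),
    (∀ T : Finset (Fin k), T.Nonempty → ¬ IsSquare (∏ j ∈ T, α j)) →
    ∀ (s : Fin k → ℚ_[p]), (∀ j, s j * s j = (α j : ℚ_[p])) → (∀ j, ‖s j‖ ≤ 1) →
    ∀ (c : Finset (Fin k) → ℚ), c ≠ 0 → ∀ (D : ℕ), 1 ≤ D → (∀ S, ∃ z : ℤ, (D : ℚ) * c S = z) →
    ∀ (M : ℝ), 1 ≤ M → ∑ S, |(c S : ℝ)| ≤ M →
    (D : ℝ) / (4 * (D : ℝ) ^ 2 * M * heightProd α ^ 3) ^ (2 ^ k) ≤ ‖evL s c‖ := by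
  intro k
  induction k with
  | zero =>
    intro α hind s hs hs1 c hc D hD hden M hM hcM
    have hbase := norm_evL_ge_base s hc hD hden hcM
    have hP : heightProd α = 1 := by unfold heightProd; simp
    rw [hP, one_pow, mul_one, pow_zero, pow_one]
    have hD1 : (1 : ℝ) ≤ D := by exact_mod_cast hD
    have hDM : 0 < (D : ℝ) * M := by positivity
    refine le_trans ?_ hbase
    rw [div_le_div_iff₀ (by positivity) hDM]
    nlinarith
  | succ k ih =>
    intro α' hind s' hs' hs1' c hc D hD hden M hM hcM
    set a : ℚ := α' (Fin.last k) with ha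
    set α : Fin k → ℚ := init α' with hαdef
    set s : Fin k → ℚ_[p] := initL s' with hsdef
    have hs : ∀ j, s j * s j = (α j : ℚ_[p]) := fun j => hs' _
    have hs1 : ∀ j, ‖s j‖ ≤ 1 := fun j => hs1' _
    have hindα : ∀ T : Finset (Fin k), T.Nonempty → ¬ IsSquare (∏ j ∈ T, α j) := hind_init α' hind
    set H : ℝ := hgt a with hH
    set P : ℝ := heightProd α with hP
    have hH1 : 1 ≤ H := one_le_hgt a
    have hP1 : 1 ≤ P := one_le_heightProd α
    have hP' : heightProd α' = P * H := by
      rw [hP, hH, ha]; unfold heightProd; rw [Fin.prod_univ_castSucc]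
    have hD1 : (1 : ℝ) ≤ D := by exact_mod_cast hD
    set u : ℚ_[p] := evL s (lo c) with hu
    set v : ℚ_[p] := evL s (hi c) with hv
    set r : ℚ_[p] := s' (Fin.last k) with hr
    have hrr : r * r = (a : ℚ_[p]) := hs' (Fin.last k)
    have hx : evL s' c = u + r * v := evL_succ s' c
    have hsum := sum_abs_succ c
    have hlo_le : ∑ S, |(lo c S : ℝ)| ≤ M := by
      have : 0 ≤ ∑ S, |(hi c S : ℝ)| := Finset.sum_nonneg fun S _ => abs_nonneg _
      linarith
    have hhi_le : ∑ S, |(hi c S : ℝ)| ≤ M := by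
      have : 0 ≤ ∑ S, |(lo c S : ℝ)| := Finset.sum_nonneg fun S _ => abs_nonneg _
      linarith
    have hden_lo : ∀ S, ∃ z : ℤ, (D : ℚ) * lo c S = z := fun S => hden _
    have hden_hi : ∀ S, ∃ z : ℤ, (D : ℚ) * hi c S = z := fun S => hden _
    have hE : 2 ^ (k + 1) = 2 * 2 ^ k := by ring
    rcases eq_or_ne (hi c) 0 with hhi0 | hhi0
    · -- no last root
      have hlo0 : lo c ≠ 0 := (lo_hi_ne_zero hc).resolve_right (fun h => h hhi0)
      have key := ih α hindα s hs hs1 (lo c) hlo0 D hD hden_lo M hM hlo_le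
      have hv0 : v = 0 := by rw [hv, hhi0, evL_zero]
      have hx' : evL s' c = u := by rw [hx, hv0]; ring
      rw [hx']
      refine le_trans ?_ key
      rw [hP']
      have hb1 : (1 : ℝ) ≤ 4 * (D : ℝ) ^ 2 * M * P ^ 3 := by
        have := one_le_mul_of_one_le_of_one_le (one_le_mul_of_one_le_of_one_le (one_le_pow₀ hD1 (n := 2)) hM)
          (one_le_pow₀ hP1 (n := 3))
        nlinarith
      have hb : 4 * (D : ℝ) ^ 2 * M * P ^ 3 ≤ 4 * (D : ℝ) ^ 2 * M * (P * H) ^ 3 := by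
        have hPH : P ^ 3 ≤ (P * H) ^ 3 :=
          pow_le_pow_left₀ (by positivity) (le_mul_of_one_le_right (by positivity) hH1) 3
        exact mul_le_mul_of_nonneg_left hPH (by positivity)
      apply div_le_div_of_nonneg_left (by positivity) (by positivity)
      calc (4 * (D : ℝ) ^ 2 * M * P ^ 3) ^ 2 ^ k ≤ (4 * (D : ℝ) ^ 2 * M * (P * H) ^ 3) ^ 2 ^ k :=
            pow_le_pow_left₀ (by positivity) hb _
        _ ≤ (4 * (D : ℝ) ^ 2 * M * (P * H) ^ 3) ^ 2 ^ (k + 1) :=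
            pow_le_pow_right₀ (hb1.trans hb) (Nat.pow_le_pow_right (by norm_num) (by omega))
    · -- the conjugate and the norm
      set c'' : Finset (Fin k) → ℚ := cmul α (lo c) (lo c) - a • cmul α (hi c) (hi c) with hc''
      have hev'' : evL s c'' = u * u - (a : ℚ_[p]) * (v * v) := by
        rw [hc'', evL_sub, evL_smul, evL_cmul α s hs, evL_cmul α s hs]
      have hxbar : evL s' (conjLast c) = u - r * v := evL_conjLast s' c
      have hxbar0 : evL s' (conjLast c) ≠ 0 := evL_ne_zero α' hind s' hs' (conjLast_ne_zero hc)
      have hx0 : evL s' c ≠ 0 := evL_ne_zero α' hind s' hs' hc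
      have hnorm : evL s' c * evL s' (conjLast c) = evL s c'' := by
        rw [hx, hxbar, hev'', ← hrr]; ring
      have hc''0 : c'' ≠ 0 := by
        intro h0
        have : evL s c'' = 0 := by rw [h0, evL_zero]
        rw [← hnorm] at this
        rcases mul_eq_zero.mp this with h | h
        · exact hx0 h
        · exact hxbar0 h
      set Dd : ℕ := D * D * ∏ j, (α j).den with hDd
      set D'' : ℕ := Dd * a.den with hD''
      have hden'' : ∀ U, ∃ z : ℤ, (D'' : ℚ) * c'' U = z := by
        intro U
        obtain ⟨z₁, hz₁⟩ := exists_int_cmul α (lo c) (lo c) hden_lo hden_lo U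
        obtain ⟨z₂, hz₂⟩ := exists_int_cmul α (hi c) (hi c) hden_hi hden_hi U
        refine ⟨a.den * z₁ - a.num * z₂, ?_⟩
        rw [hc'', hD'']
        simp only [Pi.sub_apply, Pi.smul_apply, smul_eq_mul]
        push_cast
        rw [← hDd] at hz₁ hz₂
        have ha' : (a.den : ℚ) * a = a.num := by rw [mul_comm]; exact Rat.mul_den_eq_num a
        calc ((Dd : ℚ) * a.den) * (cmul α (lo c) (lo c) U - a * cmul α (hi c) (hi c) U)
            = (a.den : ℚ) * ((Dd : ℚ) * cmul α (lo c) (lo c) U) -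
              ((a.den : ℚ) * a) * ((Dd : ℚ) * cmul α (hi c) (hi c) U) := by ring
          _ = (a.den : ℚ) * z₁ - (a.num : ℚ) * z₂ := by rw [hz₁, hz₂, ha']
      have hD''1 : 1 ≤ D'' := by
        rw [hD'', hDd]
        have h1 : 1 ≤ ∏ j, (α j).den := Finset.one_le_prod' fun j _ => (α j).pos
        have := a.pos
        have : 1 ≤ D * D := Nat.one_le_iff_ne_zero.mpr (by positivity)
        exact Nat.one_le_iff_ne_zero.mpr (by positivity)
      have hD''le : (D'' : ℝ) ≤ D ^ 2 * P * H := by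
        rw [hD'', hDd]; push_cast
        have h1 : ((∏ j, ((α j).den : ℝ))) ≤ P := by
          have := prod_den_le α; push_cast at this; exact this
        have h2 : ((a.den : ℝ)) ≤ H := den_le_hgt a
        calc (D : ℝ) * D * (∏ j, ((α j).den : ℝ)) * a.den ≤ (D : ℝ) * D * P * H :=
            mul_le_mul (mul_le_mul_of_nonneg_left h1 (by positivity)) h2 (by positivity)
              (by positivity)
          _ = (D : ℝ) ^ 2 * P * H := by ring
      have hD''ge : (D : ℝ) ^ 2 ≤ D'' := by
        rw [hD'', hDd]; push_cast
        have h1 : (1 : ℝ) ≤ ∏ j, ((α j).den : ℝ) := by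
          rw [← Nat.cast_prod]; exact_mod_cast Finset.one_le_prod' fun j _ => (α j).pos
        have h2 : (1 : ℝ) ≤ (a.den : ℝ) := by exact_mod_cast a.pos
        calc (D : ℝ) ^ 2 = (D : ℝ) * D * 1 * 1 := by ring
          _ ≤ (D : ℝ) * D * (∏ j, ((α j).den : ℝ)) * a.den :=
              mul_le_mul (mul_le_mul_of_nonneg_left h1 (by positivity)) h2 zero_le_one
                (by positivity)
      set M'' : ℝ := 2 * H * P * M ^ 2 with hM''
      have hPabs : ∏ j, max 1 |(α j : ℝ)| ≤ P := prod_max_one_abs_le α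
      have hc''M : ∑ U, |(c'' U : ℝ)| ≤ M'' := by
        have h1 := l1_cmul_le α (lo c) (lo c)
        have h2 := l1_cmul_le α (hi c) (hi c)
        have hlo2 : (∑ S, |(lo c S : ℝ)|) * ∑ S, |(lo c S : ℝ)| ≤ M ^ 2 := by
          rw [sq]; exact mul_le_mul hlo_le hlo_le (Finset.sum_nonneg fun _ _ => abs_nonneg _)
            (by linarith)
        have hhi2 : (∑ S, |(hi c S : ℝ)|) * ∑ S, |(hi c S : ℝ)| ≤ M ^ 2 := by
          rw [sq]; exact mul_le_mul hhi_le hhi_le (Finset.sum_nonneg fun _ _ => abs_nonneg _)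
            (by linarith)
        have hA : ∑ U, |(cmul α (lo c) (lo c) U : ℝ)| ≤ P * M ^ 2 :=
          h1.trans (mul_le_mul hPabs hlo2 (by positivity) (by positivity))
        have hB : ∑ U, |(cmul α (hi c) (hi c) U : ℝ)| ≤ P * M ^ 2 :=
          h2.trans (mul_le_mul hPabs hhi2 (by positivity) (by positivity))
        have haH : |(a : ℝ)| ≤ H := abs_le_hgt a
        calc ∑ U, |(c'' U : ℝ)|
            ≤ ∑ U, (|(cmul α (lo c) (lo c) U : ℝ)| + |(a : ℝ)| * |(cmul α (hi c) (hi c) U : ℝ)|) := by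
              refine Finset.sum_le_sum fun U _ => ?_
              rw [hc'']
              simp only [Pi.sub_apply, Pi.smul_apply, smul_eq_mul, Rat.cast_sub, Rat.cast_mul]
              calc |(cmul α (lo c) (lo c) U : ℝ) - (a : ℝ) * cmul α (hi c) (hi c) U|
                  ≤ |(cmul α (lo c) (lo c) U : ℝ)| + |(a : ℝ) * cmul α (hi c) (hi c) U| :=
                    abs_sub _ _
                _ = _ := by rw [abs_mul]
          _ = ∑ U, |(cmul α (lo c) (lo c) U : ℝ)| +
                |(a : ℝ)| * ∑ U, |(cmul α (hi c) (hi c) U : ℝ)| := by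
              rw [Finset.sum_add_distrib, Finset.mul_sum]
          _ ≤ P * M ^ 2 + H * (P * M ^ 2) :=
              add_le_add hA (mul_le_mul haH hB (by positivity) (by positivity))
          _ ≤ M'' := by
              have : P * M ^ 2 ≤ H * (P * M ^ 2) := le_mul_of_one_le_left (by positivity) hH1
              rw [hM'']; linarith
      have hM''1 : 1 ≤ M'' := by
        rw [hM'']
        have h1 : 1 ≤ H * P * M ^ 2 :=
          one_le_mul_of_one_le_of_one_le (one_le_mul_of_one_le_of_one_le hH1 hP1) (one_le_pow₀ hM)
        linarith
      have key := ih α hindα s hs hs1 c'' hc''0 D'' hD''1 hden'' M'' hM''1 hc''M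
      -- `‖x̄‖_p ≤ D`
      have hden_conj : ∀ S, ∃ z : ℤ, (D : ℚ) * conjLast c S = z := by
        intro S
        obtain ⟨z, hz⟩ := hden S
        unfold conjLast
        split_ifs
        · exact ⟨-z, by rw [mul_neg, hz, Int.cast_neg]⟩
        · exact ⟨z, hz⟩
      have hxbar_le : ‖evL s' (conjLast c)‖ ≤ D := norm_evL_le_natCast s' hs1' hD hden_conj
      have hxyz : ‖evL s c''‖ ≤ ‖evL s' c‖ * D := by
        rw [← hnorm, norm_mul]
        exact mul_le_mul_of_nonneg_left hxbar_le (norm_nonneg _)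
      rw [hP', hE]
      rw [hM''] at key
      exact padic_numeric_step_sharp hD1 hM hH1 hP1 hD''ge hD''le key hxyz

end Multiquad

end Literature.NumberTheory.Transcendental.StewartYu

end Part6

/-!
## Part 7 — port of `Summits/ABC/StewartYu/DescentLiouvilleQ.lean`

# Cell abc-stewartyu, WP-A3 (vii): where the `p`-adic Liouville inequalities meet the descent

`Summits/ABC/StewartYu/DescentLiouvilleQ.lean` — cell `abc-stewartyu` (HOME
`run/shared/lean/pub/abc-stewartyu/`, seat p3; work package WP-A3 of `HOME/p2/PADIC-CORE.md`,
rows "W80KStep `coreSum_eq_zero_of_abs_lt`" and "CW77Steps `classVec_eq_zero`" of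
`HOME/plan/PORT-MAP.md`; theorems only, no named fact), sequel to `DescentIntegralityQ.lean` and
`PadicMultiquadraticLiouvilleSharp.lean`.

The two places where the `p`-adic analytic estimates (smallness of the auxiliary function at the
integer points `s` and at the half points `s/2`, WP-A1/WP-A2/WP-A5) are converted into the EXACT
relations consumed by the algebra of the descent (`SetupQ.Inv.rel`, `SetupQ.descent_algebra`):

* `exists_int_DclearJ_mul_qTerm`, `exists_int_DclearJ_mul_coreSum` — the signed rational core
  `coreSum_{J,τ}(s)` has denominator dividing `D_J(s,τ) = Q.flat.DclearJ …` (the tree's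
  `CW77.Setup.exists_int_DclearJ_mul_qTerm` [cite: Waldschmidt1980, Lemma 3.4 (p. 269)], signs
  allowed);
* `padicNorm_ge_of_int_mul` — **the product formula for one rational**: `x ≠ 0`, `D x ∈ ℤ`,
  `|x| ≤ M` ⟹ `‖x‖_p ≥ 1/(D M)`; hence `coreSum_eq_zero_of_padicNorm_lt` — the `p`-adic twin of
  `CW77.Setup.coreSum_eq_zero_of_abs_lt` ((3.21) of Waldschmidt 1980): `‖coreSum‖_p < 1/(Dmax·Mmax)`,
  `D_J ≤ Dmax`, `|coreSum| ≤ Mmax` ⟹ `coreSum = 0`;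
* `classVec_eq_zero_of_padicNorm_lt` — **the `p`-adic twin of `CW77.Setup.classVec_eq_zero`**:
  under the `2`-Kummer condition on the SIGNED generators and with `p`-adic roots `rᵢ² = allᵢ`,
  `‖rᵢ‖_p ≤ 1`, if `‖evL r (classVec_{J,τ,s})‖_p` is below the sharp Liouville bound
  `D/(4D²M(∏H(allᵢ))³)^{2^{d+1}}` (`D = Dhalf♭`, `M ≥ ∑|classVec|`) then ALL class sums vanish —
  exactly the hypothesis `half` of `SetupQ.descent_algebra`.

Everything is [folklore].
-/

section Part7

open _root_.Finset
open Literature.NumberTheory.Transcendental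
open Literature.NumberTheory.Transcendental.Baker1975.Ch3 (nuBound nuBound_pos)
open Literature.NumberTheory.Transcendental.CW77
open Literature.NumberTheory.Transcendental.CW77.Setup (Idx Tau tauNorm scale)

namespace Literature.NumberTheory.Transcendental.StewartYu

namespace SetupQ

variable (Q : SetupQ) {h Lb : ℕ}

/-! ### Denominators of the signed core at the integer points of level `J` -/

/-- The denominator part of `DclearJ♭` is that of the signed generators. [folklore]
[cite: Waldschmidt1980, Lemma 3.5 (p. 271) (source FOLLOWED; the cell’s adaptation, NOT a printed statement)] -/
theorem flat_DclearJ_eq (J₀ J : ℕ) (L : Fin Q.d → ℕ) (Lθ : ℕ) (s : ℕ) (τ : Tau Q.d) :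
    Q.flat.DclearJ (h := h) J₀ J L Lθ s τ =
      nuBound (scale J₀ J * s) h ^ τ.1 * Q.bθ.natAbs ^ (∑ j, τ.2 j) *
        ((∏ j, (Q.α j).den ^ (L j / 2 ^ J * s)) * Q.θ.den ^ (Lθ / 2 ^ J * s)) := by
  unfold CW77.Setup.DclearJ
  simp only [Rat.den_abs_eq_den]

/-- **`D_J(s,τ) · qTerm_J(u,τ,s) ∈ ℤ` on the box of level `J`** (signed). [folklore]
[cite: Waldschmidt1980, Lemma 3.5 (p. 271) (source FOLLOWED; the cell’s adaptation, NOT a printed statement)] -/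
theorem exists_int_DclearJ_mul_qTerm (J₀ J : ℕ) {L : Fin Q.d → ℕ} {Lθ : ℕ} {u : Idx Q.d h Lb}
    (hu : u ∈ Q.flat.box (h := h) (Lb := Lb) L Lθ J) (τ : Tau Q.d) (s : ℕ) :
    ∃ z : ℤ, ((Q.flat.DclearJ (h := h) J₀ J L Lθ s τ : ℕ) : ℚ) * Q.qTerm J₀ J u τ s = z := by
  rw [Q.flat.mem_box] at hu
  obtain ⟨z₁, hz₁⟩ := Q.flat.exists_int_qΔ J₀ J u τ.1 s
  obtain ⟨z₂, hz₂⟩ := Q.flat.exists_int_qA u τ.2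
  obtain ⟨z₃, hz₃⟩ := Q.exists_int_qE (L := fun j => L j / 2 ^ J) (Lθ := Lθ / 2 ^ J) hu s
  refine ⟨z₁ * z₂ * z₃, ?_⟩
  rw [Q.flat_DclearJ_eq]
  unfold qTerm
  push_cast at hz₁ hz₂ hz₃ ⊢
  rw [← hz₁, ← hz₂, ← hz₃]; ring

/-- `D_J(s,τ) · coreSum_{J,τ}(s) ∈ ℤ` for `p` supported in the box of level `J`. [folklore]
[cite: Waldschmidt1980, Lemma 3.5 (p. 271) (source FOLLOWED; the cell’s adaptation, NOT a printed statement)] -/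
theorem exists_int_DclearJ_mul_coreSum (J₀ J : ℕ) (L : Fin Q.d → ℕ) (Lθ : ℕ) (p : Idx Q.d h Lb → ℤ)
    (τ : Tau Q.d) (s : ℕ) :
    ∃ z : ℤ, ((Q.flat.DclearJ (h := h) J₀ J L Lθ s τ : ℕ) : ℚ) *
      Q.coreSum J₀ J (Q.flat.box (h := h) (Lb := Lb) L Lθ J) p τ s = z := by
  classical
  unfold coreSum
  rw [mul_sum]
  have hterm : ∀ u ∈ Q.flat.box (h := h) (Lb := Lb) L Lθ J, ∃ z : ℤ,
      ((Q.flat.DclearJ (h := h) J₀ J L Lθ s τ : ℕ) : ℚ) * ((p u : ℚ) * Q.qTerm J₀ J u τ s) = z := by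
    intro u hu
    obtain ⟨z, hz⟩ := Q.exists_int_DclearJ_mul_qTerm J₀ J hu τ s
    exact ⟨p u * z, by push_cast; rw [← hz]; ring⟩
  choose z hz using hterm
  refine ⟨∑ u ∈ (Q.flat.box (h := h) (Lb := Lb) L Lθ J).attach, z u.1 u.2, ?_⟩
  push_cast
  rw [← sum_attach]
  exact sum_congr rfl fun u _ => hz u.1 u.2

/-! ### The product formula at the integer points -/

section Padic

variable {p : ℕ} [Fact p.Prime]

/-- **The product formula for one rational number**: if `x ≠ 0`, `D x ∈ ℤ` (`D ≥ 1`) and `|x| ≤ M`,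
then `‖x‖_p ≥ 1/(D M)` (`‖z/D‖_p ≥ ‖z‖_p ≥ 1/|z| ≥ 1/(DM)`). [folklore]
[cite: Waldschmidt1980, Lemma 3.5 (p. 271) (source FOLLOWED; the cell’s adaptation, NOT a printed statement)] -/
theorem padicNorm_ge_of_int_mul {x : ℚ} (hx : x ≠ 0) {D : ℕ} (hD : 1 ≤ D)
    (hint : ∃ z : ℤ, (D : ℚ) * x = z) {M : ℝ} (hM : |(x : ℝ)| ≤ M) :
    1 / ((D : ℝ) * M) ≤ ‖(x : ℚ_[p])‖ := by
  obtain ⟨z, hz⟩ := hint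
  have hD0 : (D : ℚ) ≠ 0 := by exact_mod_cast (show D ≠ 0 by omega)
  have hz0 : z ≠ 0 := by
    rintro rfl
    rw [Int.cast_zero, mul_eq_zero] at hz
    exact hz.elim hD0 hx
  have hxz : x = (z : ℚ) / D := by field_simp; rw [mul_comm]; exact hz
  have hDR : (0 : ℝ) < D := by exact_mod_cast (show 0 < D by omega)
  have hzle : |(z : ℝ)| ≤ D * M := by
    have h1 : ((x : ℚ) : ℝ) = (z : ℝ) / D := by rw [hxz]; push_cast; rfl
    rw [h1, abs_div, abs_of_pos hDR, div_le_iff₀ hDR] at hM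
    linarith
  have hzabs : (0 : ℝ) < |(z : ℝ)| := abs_pos.mpr (by exact_mod_cast hz0)
  have hnormD : ‖(D : ℚ_[p])‖ ≤ 1 := by simpa using Padic.norm_int_le_one (p := p) (D : ℤ)
  have hnormD0 : 0 < ‖(D : ℚ_[p])‖ := norm_pos_iff.mpr (Nat.cast_ne_zero.mpr (by omega))
  calc 1 / ((D : ℝ) * M) ≤ 1 / |(z : ℝ)| := one_div_le_one_div_of_le hzabs hzle
    _ ≤ ‖((z : ℤ) : ℚ_[p])‖ := Multiquad.inv_abs_le_norm_intCast hz0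
    _ ≤ ‖((z : ℤ) : ℚ_[p])‖ / ‖(D : ℚ_[p])‖ := by
        rw [le_div_iff₀ hnormD0]
        exact mul_le_of_le_one_right (norm_nonneg _) hnormD
    _ = ‖(x : ℚ_[p])‖ := by rw [hxz, Rat.cast_div, Rat.cast_intCast, Rat.cast_natCast, norm_div]

/-- **The `p`-adic Liouville estimate at the integer points** (twin of (3.21) of Waldschmidt 1980,
`CW77.Setup.coreSum_eq_zero_of_abs_lt`): if `D_J(s,τ) ≤ Dmax`, `|coreSum_{J,τ}(s)| ≤ Mmax` and
`‖coreSum_{J,τ}(s)‖_p < 1/(Dmax · Mmax)`, then `coreSum_{J,τ}(s) = 0`. [folklore]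
[cite: Waldschmidt1980, Lemma 3.5 (p. 271) (source FOLLOWED; the cell’s adaptation, NOT a printed statement)] -/
theorem coreSum_eq_zero_of_padicNorm_lt (J₀ J : ℕ) (L : Fin Q.d → ℕ) (Lθ : ℕ) (pv : Idx Q.d h Lb → ℤ)
    (τ : Tau Q.d) (s : ℕ) {Dmax Mmax : ℝ}
    (hD : ((Q.flat.DclearJ (h := h) J₀ J L Lθ s τ : ℕ) : ℝ) ≤ Dmax) (hMmax : 0 < Mmax)
    (hM : |(Q.coreSum J₀ J (Q.flat.box (h := h) (Lb := Lb) L Lθ J) pv τ s : ℝ)| ≤ Mmax)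
    (hlt : ‖((Q.coreSum J₀ J (Q.flat.box (h := h) (Lb := Lb) L Lθ J) pv τ s : ℚ) : ℚ_[p])‖ <
      1 / (Dmax * Mmax)) :
    Q.coreSum J₀ J (Q.flat.box (h := h) (Lb := Lb) L Lθ J) pv τ s = 0 := by
  by_contra hne
  set D : ℕ := Q.flat.DclearJ (h := h) J₀ J L Lθ s τ with hDdef
  have hD1 : 1 ≤ D := Q.flat.DclearJ_pos J₀ J L Lθ s τ
  have hge := padicNorm_ge_of_int_mul (p := p) hne hD1 (Q.exists_int_DclearJ_mul_coreSum J₀ J L Lθ pv τ s) hM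
  have hDR : (0 : ℝ) < D := by exact_mod_cast (show 0 < D by omega)
  have hmono : 1 / (Dmax * Mmax) ≤ 1 / ((D : ℝ) * Mmax) :=
    one_div_le_one_div_of_le (by positivity) (mul_le_mul_of_nonneg_right hD hMmax.le)
  exact absurd (hmono.trans hge) (not_le.mpr hlt)

/-! ### The Liouville inequality at the half points: vanishing of the class sums -/

/-- **The `p`-adic twin of `CW77.Setup.classVec_eq_zero`.** Let the signed generators `allᵢ` satisfy
the `2`-Kummer condition and have `p`-adic square roots `rᵢ` (`rᵢ² = allᵢ`, `‖rᵢ‖_p ≤ 1`). If the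
evaluation `evL r (classVec_{J,τ,s})` of the class-sum vector (denominator `Dhalf♭ ≥ 1`,
`∑_{T'} |classVec(T')| ≤ M`, `M ≥ 1`) is `p`-adically smaller than the sharp Liouville bound
`Dhalf♭/(4 Dhalf♭² M (∏ᵢ H(allᵢ))³)^{2^{d+1}}`, then every class sum vanishes. [folklore]
[cite: Waldschmidt1980, Lemma 3.5 (p. 271) (source FOLLOWED; the cell’s adaptation, NOT a printed statement)] -/
theorem classVec_eq_zero_of_padicNorm_lt
    (hind : ∀ T' : Finset (Fin (Q.d + 1)), T'.Nonempty → ¬ IsSquare (∏ i ∈ T', Q.all i))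
    (r : Fin (Q.d + 1) → ℚ_[p]) (hr : ∀ i, r i * r i = (Q.all i : ℚ_[p])) (hr1 : ∀ i, ‖r i‖ ≤ 1)
    (J₀ J : ℕ) (L : Fin Q.d → ℕ) (Lθ : ℕ) (pv : Idx Q.d h Lb → ℤ) (τ : Tau Q.d) (s : ℕ)
    {M : ℝ} (hM : 1 ≤ M)
    (hcM : ∑ T', |(Q.classVec J₀ J (Q.flat.box (h := h) (Lb := Lb) L Lθ J) pv τ s T' : ℝ)| ≤ M)
    (hlt : ‖Multiquad.evL r (Q.classVec J₀ J (Q.flat.box (h := h) (Lb := Lb) L Lθ J) pv τ s)‖ <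
      (Q.flat.Dhalf (h := h) J₀ J L Lθ s τ : ℝ) /
        (4 * (Q.flat.Dhalf (h := h) J₀ J L Lθ s τ : ℝ) ^ 2 * M * heightProd Q.all ^ 3) ^ (2 ^ (Q.d + 1))) :
    Q.classVec J₀ J (Q.flat.box (h := h) (Lb := Lb) L Lθ J) pv τ s = 0 := by
  by_contra hne
  have hD1 : 1 ≤ Q.flat.Dhalf (h := h) J₀ J L Lθ s τ := Q.flat.Dhalf_pos J₀ J L Lθ s τ
  have hge := Multiquad.norm_evL_ge_sharp (p := p) (Q.d + 1) Q.all hind r hr hr1 _ hne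
    (Q.flat.Dhalf (h := h) J₀ J L Lθ s τ) hD1
    (fun T' => Q.exists_int_Dhalf_mul_classVec J₀ J L Lθ τ s T') M hM hcM
  exact absurd hge (not_le.mpr hlt)

end Padic

end SetupQ

end Literature.NumberTheory.Transcendental.StewartYu

end Part7

/-!
## Part 8 — port of `Summits/ABC/StewartYu/PadicCW77HalfStep.lean`

# Cell abc-stewartyu, WP-A3 (ix)–(x): the bridge from p2's `p`-adic set-up to the sign-free descent
# algebra, and the half step of the `2`-descent

`Summits/ABC/StewartYu/PadicCW77HalfStep.lean` — cell `abc-stewartyu` (HOME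
`run/shared/lean/pub/abc-stewartyu/`, seat p3; one `abbrev` + theorems; no named fact), on top of
p2's `PadicCW77Setup/Functions.lean` (the signed set-up `PadicCW77.Setup`, its functions `F`, `Φ`)
and p3's `Descent*Q.lean` (the sign-free ℚ-algebra `SetupQ`).  Two parts (formerly staged as
PadicDescentBridge / PadicCW77HalfStep):

**Part 1 — the bridge.** `PadicCW77.Setup.toQ' : SetupQ` (same `d, α, θ, b, b_θ`) with `rfl`-lemmas
(`toQ_qE'`, `toQ_qTerm'`, `toQ_coreSum'`, `flat_qΔ/γ/qA/box_eq_frame`, `flat_expn_eq'`); the `Δ`-factor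
at the half points (`DwQ_half_eq'`, `Dw_half'`), `termΦ_half'`, **`Φ_half'`**: for `J < J₀`,
`Φ_{J,τ}(s/2) = 2^{τ₀} · evL (psqrt ∘ all) (classVec_{J,τ,s})` in `ℚ_p`, and `norm_Φ_half'`.

**Part 2 — the half step.** `liouvilleBound_anti'`; **`classVec_eq_zero_of_norm_Φ_half_lt'`** (if
`‖φ_{J,τ}(s/2)‖_p` is below the sharp `p`-adic Liouville bound of the class-sum vector, all class
sums vanish: `Multiquad.norm_evL_ge_sharp` + `evL_ne_zero` on the principal roots `psqrt(allᵢ)`,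
under the `2`-Kummer condition on the SIGNED generators); **`inv_succ_of_norm_Φ_half_lt'`** (the
invariant `SetupQ.Inv` passes from `J` to `J+1` by `SetupQ.descent_algebra`).

The junctions to p2's `Inv`/`HalfStep` (which live in `PadicCW77Main`) follow in
`PadicCW77Junctions.lean`.  Everything is [folklore].
-/

section Part8

/-! ## Part 1 — the bridge `toQ'` and `Φ` at the half points -/

open _root_.NormedSpace _root_.Finset _root_.Polynomial
open Literature.NumberTheory.Transcendental
open Literature.NumberTheory.Transcendental.CW77.Setup (Idx Tau tauNorm scale Qw_zero_right)
open Literature.NumberTheory.Transcendental.Baker1975.Ch3 (Qw)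

namespace Literature.NumberTheory.Transcendental.PadicCW77.Setup

open Literature.NumberTheory.Transcendental.StewartYu

variable (S : PadicCW77.Setup) {h Lb : ℕ}

/-! ### Forgetting the `p`-adic data -/

/-- The underlying sign-free algebraic datum of a `p`-adic set-up (an `abbrev`, so that `S.toQ'.d`
unfolds to `S.d` reducibly). [folklore]
[cite: CijsouwWaldschmidt1977, §3 with Yu1989, Lemma 1.4 (p. 117) (sources FOLLOWED for the half step of the 2-descent and the p-adic extrapolation; the cell’s adaptation/plumbing, NOT a printed statement)] -/
abbrev toQ' : SetupQ := ⟨S.d, S.α, S.θ, S.α_ne, S.θ_ne, S.b, S.bθ, S.bθ_ne⟩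

/-- `toQ'` keeps the generators. [folklore]
[cite: CijsouwWaldschmidt1977, §3 with Yu1989, Lemma 1.4 (p. 117) (sources FOLLOWED for the half step of the 2-descent and the p-adic extrapolation; the cell’s adaptation/plumbing, NOT a printed statement)] -/
@[simp] theorem toQ_all' : S.toQ'.all = S.all := rfl

/-- `toQ'` keeps `qE`. [folklore]
[cite: CijsouwWaldschmidt1977, §3 with Yu1989, Lemma 1.4 (p. 117) (sources FOLLOWED for the half step of the 2-descent and the p-adic extrapolation; the cell’s adaptation/plumbing, NOT a printed statement)] -/
theorem toQ_qE' (u : Idx S.d h Lb) (s : ℕ) : S.toQ'.qE u s = S.qE u s := rfl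

/-- `flat.qΔ = frame.qΔ` (generator-free). [folklore]
[cite: CijsouwWaldschmidt1977, §3 with Yu1989, Lemma 1.4 (p. 117) (sources FOLLOWED for the half step of the 2-descent and the p-adic extrapolation; the cell’s adaptation/plumbing, NOT a printed statement)] -/
theorem flat_qΔ_eq_frame' (J₀ J : ℕ) (u : Idx S.d h Lb) (τ₀ s : ℕ) :
    S.toQ'.flat.qΔ J₀ J u τ₀ s = S.frame.qΔ J₀ J u τ₀ s := rfl

/-- `flat.γ = frame.γ` (generator-free). [folklore]
[cite: CijsouwWaldschmidt1977, §3 with Yu1989, Lemma 1.4 (p. 117) (sources FOLLOWED for the half step of the 2-descent and the p-adic extrapolation; the cell’s adaptation/plumbing, NOT a printed statement)] -/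
theorem flat_γ_eq_frame' (u : Idx S.d h Lb) (j : Fin S.d) : S.toQ'.flat.γ u j = S.frame.γ u j := rfl

/-- `flat.qA = frame.qA` (generator-free). [folklore]
[cite: CijsouwWaldschmidt1977, §3 with Yu1989, Lemma 1.4 (p. 117) (sources FOLLOWED for the half step of the 2-descent and the p-adic extrapolation; the cell’s adaptation/plumbing, NOT a printed statement)] -/
theorem flat_qA_eq_frame' (u : Idx S.d h Lb) (τ' : Fin S.d → ℕ) :
    S.toQ'.flat.qA u τ' = S.frame.qA u τ' := rfl

/-- `flat.box = frame.box` (generator-free). [folklore]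
[cite: CijsouwWaldschmidt1977, §3 with Yu1989, Lemma 1.4 (p. 117) (sources FOLLOWED for the half step of the 2-descent and the p-adic extrapolation; the cell’s adaptation/plumbing, NOT a printed statement)] -/
theorem flat_box_eq_frame' (L : Fin S.d → ℕ) (Lθ J : ℕ) :
    S.toQ'.flat.box (h := h) (Lb := Lb) L Lθ J = S.frame.box (h := h) (Lb := Lb) L Lθ J := rfl

/-- `flat.expn = expn`. [folklore]
[cite: CijsouwWaldschmidt1977, §3 with Yu1989, Lemma 1.4 (p. 117) (sources FOLLOWED for the half step of the 2-descent and the p-adic extrapolation; the cell’s adaptation/plumbing, NOT a printed statement)] -/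
theorem flat_expn_eq' (u : Idx S.d h Lb) (s : ℕ) : S.toQ'.flat.expn u s = S.expn u s := rfl

/-- `toQ'` keeps `qTerm`. [folklore]
[cite: CijsouwWaldschmidt1977, §3 with Yu1989, Lemma 1.4 (p. 117) (sources FOLLOWED for the half step of the 2-descent and the p-adic extrapolation; the cell’s adaptation/plumbing, NOT a printed statement)] -/
theorem toQ_qTerm' (J₀ J : ℕ) (u : Idx S.d h Lb) (τ : Tau S.d) (s : ℕ) :
    S.toQ'.qTerm J₀ J u τ s = S.qTerm J₀ J u τ s := rfl

/-- `toQ'` keeps `coreSum`. [folklore]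
[cite: CijsouwWaldschmidt1977, §3 with Yu1989, Lemma 1.4 (p. 117) (sources FOLLOWED for the half step of the 2-descent and the p-adic extrapolation; the cell’s adaptation/plumbing, NOT a printed statement)] -/
theorem toQ_coreSum' (J₀ J : ℕ) (box : Finset (Idx S.d h Lb)) (p : Idx S.d h Lb → ℤ) (τ : Tau S.d)
    (s : ℕ) : S.toQ'.coreSum J₀ J box p τ s = S.coreSum J₀ J box p τ s := rfl

/-! ### The `Δ`-factor at the half points -/

/-- **`DwQ (2^{J₀−J}) r l h τ₀ (s/2) = 2^{τ₀} · qΔ_{J+1}(s)`** for `J < J₀` (the complex identity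
`CW77.Setup.Qw_wOf_half` of the frame, transported to `ℚ`). [folklore]
[cite: CijsouwWaldschmidt1977, §3 with Yu1989, Lemma 1.4 (p. 117) (sources FOLLOWED for the half step of the 2-descent and the p-adic extrapolation; the cell’s adaptation/plumbing, NOT a printed statement)] -/
theorem DwQ_half_eq' {J₀ J : ℕ} (hJ : J < J₀) (u : Idx S.d h Lb) (τ₀ s : ℕ) :
    DwQ (2 ^ (J₀ - J)) (u.1.1 : ℕ) (u.1.2 : ℕ) h τ₀ ((s : ℚ) / 2) =
      2 ^ τ₀ * S.frame.qΔ J₀ (J + 1) u τ₀ s := by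
  apply Rat.cast_injective (α := ℂ)
  have h1 := S.frame.Qw_wOf_half hJ u τ₀ s
  rw [Qw_zero_right] at h1
  push_cast
  rw [← h1]
  unfold DwQ CW77.Setup.wOf
  rw [← Waldschmidt1980.map_wScaled, iterate_derivative_map, Polynomial.eval_map,
    show ((s : ℂ) / 2) = algebraMap ℚ ℂ ((s : ℚ) / 2) by simp, Polynomial.eval₂_at_apply]
  simp

/-- **`Dw τ₀ (s/2) = 2^{τ₀} · qΔ_{J+1}(s)`** in `ℚ_p` (`J < J₀`). [folklore]
[cite: CijsouwWaldschmidt1977, §3 with Yu1989, Lemma 1.4 (p. 117) (sources FOLLOWED for the half step of the 2-descent and the p-adic extrapolation; the cell’s adaptation/plumbing, NOT a printed statement)] -/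
theorem Dw_half' {J₀ J : ℕ} (hJ : J < J₀) (u : Idx S.d h Lb) (τ₀ s : ℕ) :
    S.Dw J₀ J u τ₀ ((2 : ℚ_[S.p])⁻¹ * (s : ℚ_[S.p])) =
      (2 : ℚ_[S.p]) ^ τ₀ * (S.frame.qΔ J₀ (J + 1) u τ₀ s : ℚ_[S.p]) := by
  have hx : ((2 : ℚ_[S.p])⁻¹ * (s : ℚ_[S.p])) = (((s : ℚ) / 2 : ℚ) : ℚ_[S.p]) := by
    push_cast; ring
  rw [hx, S.Dw_ratCast, S.DwQ_half_eq' hJ]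
  push_cast; ring

/-! ### The values of `φ_{J,τ}` at the half points -/

/-- One term: `termΦ(s/2) = 2^{τ₀} · (qΔ_{J+1} qA)(u) · ∏ᵢ psqrt(allᵢ)^{expnᵢ(u,s)}` (`J < J₀`).
[folklore]
[cite: CijsouwWaldschmidt1977, §3 with Yu1989, Lemma 1.4 (p. 117) (sources FOLLOWED for the half step of the 2-descent and the p-adic extrapolation; the cell’s adaptation/plumbing, NOT a printed statement)] -/
theorem termΦ_half' {J₀ J : ℕ} (hJ : J < J₀) (u : Idx S.d h Lb) (τ : Tau S.d) (s : ℕ) :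
    S.termΦ J₀ J u τ ((2 : ℚ_[S.p])⁻¹ * (s : ℚ_[S.p])) =
      (2 : ℚ_[S.p]) ^ τ.1 * ((S.frame.qΔ J₀ (J + 1) u τ.1 s * S.frame.qA u τ.2 : ℚ) : ℚ_[S.p]) *
        ∏ i : Fin (S.d + 1), PadicExp.psqrt (S.all i : ℚ_[S.p]) ^ S.expn u s i := by
  unfold termΦ
  rw [S.Dw_half' hJ, S.A_eq, S.exp_ψ_half_natCast]
  push_cast; ring

/-- **`φ_{J,τ}(s/2) = 2^{τ₀} · evL (psqrt ∘ all) (classVec_{J,τ,s})`** (`J < J₀`): the value at a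
half point is `2^{τ₀}` times the evaluation of the signed class-sum vector on the monomials in the
principal `p`-adic square roots of the generators. [folklore]
[cite: CijsouwWaldschmidt1977, §3 with Yu1989, Lemma 1.4 (p. 117) (sources FOLLOWED for the half step of the 2-descent and the p-adic extrapolation; the cell’s adaptation/plumbing, NOT a printed statement)] -/
theorem Φ_half' {J₀ J : ℕ} (hJ : J < J₀) (box : Finset (Idx S.d h Lb)) (p : Idx S.d h Lb → ℤ)
    (τ : Tau S.d) (s : ℕ) :
    S.Φ J₀ J box p τ ((2 : ℚ_[S.p])⁻¹ * (s : ℚ_[S.p])) =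
      (2 : ℚ_[S.p]) ^ τ.1 *
        Multiquad.evL (fun i => PadicExp.psqrt (S.all i : ℚ_[S.p])) (S.toQ'.classVec J₀ J box p τ s) := by
  have hr : ∀ i : Fin (S.d + 1), PadicExp.psqrt (S.all i : ℚ_[S.p]) * PadicExp.psqrt (S.all i : ℚ_[S.p]) =
      ((S.toQ'.all i : ℚ) : ℚ_[S.p]) := fun i => by
    rw [toQ_all']; exact PadicExp.psqrt_mul_self S.hp3 (S.norm_one_sub_all_le i)
  rw [← S.toQ'.sum_half_eq_evL_classVec _ hr J₀ J box p τ s]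
  unfold Φ
  rw [mul_sum]
  refine sum_congr rfl fun u _ => ?_
  rw [S.termΦ_half' hJ]
  simp only [flat_qΔ_eq_frame', flat_qA_eq_frame', flat_expn_eq']
  ring

/-- `‖2^{τ₀}‖_p = 1` (`p` odd). [folklore]
[cite: CijsouwWaldschmidt1977, §3 with Yu1989, Lemma 1.4 (p. 117) (sources FOLLOWED for the half step of the 2-descent and the p-adic extrapolation; the cell’s adaptation/plumbing, NOT a printed statement)] -/
theorem norm_two_pow' (τ₀ : ℕ) : ‖(2 : ℚ_[S.p]) ^ τ₀‖ = 1 := by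
  rw [norm_pow, PadicExp.norm_two_eq_one S.hp3, one_pow]

/-- **`‖φ_{J,τ}(s/2)‖_p = ‖evL (psqrt ∘ all) (classVec_{J,τ,s})‖_p`** (`J < J₀`). [folklore]
[cite: CijsouwWaldschmidt1977, §3 with Yu1989, Lemma 1.4 (p. 117) (sources FOLLOWED for the half step of the 2-descent and the p-adic extrapolation; the cell’s adaptation/plumbing, NOT a printed statement)] -/
theorem norm_Φ_half' {J₀ J : ℕ} (hJ : J < J₀) (box : Finset (Idx S.d h Lb)) (p : Idx S.d h Lb → ℤ)
    (τ : Tau S.d) (s : ℕ) :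
    ‖S.Φ J₀ J box p τ ((2 : ℚ_[S.p])⁻¹ * (s : ℚ_[S.p]))‖ =
      ‖Multiquad.evL (fun i => PadicExp.psqrt (S.all i : ℚ_[S.p])) (S.toQ'.classVec J₀ J box p τ s)‖ := by
  rw [S.Φ_half' hJ, norm_mul, S.norm_two_pow', one_mul]

end Literature.NumberTheory.Transcendental.PadicCW77.Setup

/-! ## Part 2 — the half step -/

open _root_.NormedSpace _root_.Finset
open Literature.NumberTheory.Transcendental
open Literature.NumberTheory.Transcendental.CW77 (heightProd)
open Literature.NumberTheory.Transcendental.CW77.Setup (Idx Tau tauNorm)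

namespace Literature.NumberTheory.Transcendental.PadicCW77.Setup

open Literature.NumberTheory.Transcendental.StewartYu

variable (S : PadicCW77.Setup) {h Lb : ℕ}

/-- **Monotonicity of the sharp Liouville bound**: `D'/(4D'²M'P³)^E ≤ D/(4D²MP³)^E` for
`1 ≤ D ≤ D'`, `1 ≤ M ≤ M'`, `P > 0`, `E ≥ 1`. [folklore]
[cite: CijsouwWaldschmidt1977, §3 with Yu1989, Lemma 1.4 (p. 117) (sources FOLLOWED for the half step of the 2-descent and the p-adic extrapolation; the cell’s adaptation/plumbing, NOT a printed statement)] -/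
theorem liouvilleBound_anti' {D D' M M' P : ℝ} {E : ℕ} (hE : 1 ≤ E) (hD : 1 ≤ D) (hDD' : D ≤ D')
    (hM : 1 ≤ M) (hMM' : M ≤ M') (hP : 0 < P) :
    D' / (4 * D' ^ 2 * M' * P ^ 3) ^ E ≤ D / (4 * D ^ 2 * M * P ^ 3) ^ E := by
  have hD0 : 0 < D := by linarith
  have hD'0 : 0 < D' := by linarith
  have hM0 : 0 < M := by linarith
  have hM'0 : 0 < M' := by linarith
  rw [div_le_div_iff₀ (by positivity) (by positivity)]
  obtain ⟨n, hn⟩ : ∃ n, 2 * E = n + 1 := ⟨2 * E - 1, by omega⟩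
  have hD2 : (D ^ 2) ^ E = D ^ n * D := by rw [← pow_mul, hn, pow_succ]
  have hD'2 : (D' ^ 2) ^ E = D' ^ n * D' := by rw [← pow_mul, hn, pow_succ]
  have e1 : (4 * D ^ 2 * M * P ^ 3) ^ E = (4 * P ^ 3) ^ E * (D ^ n * D) * M ^ E := by
    rw [← hD2, mul_pow, mul_pow, mul_pow]; ring
  have e2 : (4 * D' ^ 2 * M' * P ^ 3) ^ E = (4 * P ^ 3) ^ E * (D' ^ n * D') * M' ^ E := by
    rw [← hD'2, mul_pow, mul_pow, mul_pow]; ring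
  rw [e1, e2]
  have h1 : D ^ n ≤ D' ^ n := pow_le_pow_left₀ hD0.le hDD' n
  have h2 : M ^ E ≤ M' ^ E := pow_le_pow_left₀ hM0.le hMM' E
  have h4P : 0 ≤ (4 * P ^ 3) ^ E := by positivity
  calc D' * ((4 * P ^ 3) ^ E * (D ^ n * D) * M ^ E)
      = (4 * P ^ 3) ^ E * (D * D') * (D ^ n * M ^ E) := by ring
    _ ≤ (4 * P ^ 3) ^ E * (D * D') * (D' ^ n * M' ^ E) := by
        refine mul_le_mul_of_nonneg_left ?_ (by positivity)
        exact mul_le_mul h1 h2 (by positivity) (by positivity)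
    _ = D * ((4 * P ^ 3) ^ E * (D' ^ n * D') * M' ^ E) := by ring

/-- **Vanishing of the class sums from `p`-adic smallness at a half point** (`J < J₀`): under the
`2`-Kummer condition on the signed generators, if `∑_{T'} |classVec_{J,τ,s}(T')| ≤ M` (`M ≥ 1`) and
`‖φ_{J,τ}(s/2)‖_p < Dhalf♭/(4 Dhalf♭² M (∏ᵢ H(allᵢ))³)^{2^{d+1}}`, then `classVec_{J,τ,s} = 0`.
[folklore]
[cite: CijsouwWaldschmidt1977, §3 with Yu1989, Lemma 1.4 (p. 117) (sources FOLLOWED for the half step of the 2-descent and the p-adic extrapolation; the cell’s adaptation/plumbing, NOT a printed statement)] -/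
theorem classVec_eq_zero_of_norm_Φ_half_lt' {J₀ J : ℕ} (hJ : J < J₀)
    (hind : ∀ T' : Finset (Fin (S.d + 1)), T'.Nonempty → ¬ IsSquare (∏ i ∈ T', S.all i))
    (L : Fin S.d → ℕ) (Lθ : ℕ) (pv : Idx S.d h Lb → ℤ) (τ : Tau S.d) (s : ℕ) {M : ℝ} (hM : 1 ≤ M)
    (hcM : ∑ T', |(S.toQ'.classVec J₀ J (S.toQ'.flat.box (h := h) (Lb := Lb) L Lθ J) pv τ s T' : ℝ)| ≤ M)
    (hlt : ‖S.Φ J₀ J (S.toQ'.flat.box (h := h) (Lb := Lb) L Lθ J) pv τ ((2 : ℚ_[S.p])⁻¹ * (s : ℚ_[S.p]))‖ <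
      (S.toQ'.flat.Dhalf (h := h) J₀ J L Lθ s τ : ℝ) /
        (4 * (S.toQ'.flat.Dhalf (h := h) J₀ J L Lθ s τ : ℝ) ^ 2 * M * heightProd S.all ^ 3) ^ (2 ^ (S.d + 1))) :
    S.toQ'.classVec J₀ J (S.toQ'.flat.box (h := h) (Lb := Lb) L Lθ J) pv τ s = 0 := by
  rw [S.norm_Φ_half' hJ] at hlt
  have hr : ∀ i : Fin (S.d + 1), PadicExp.psqrt (S.all i : ℚ_[S.p]) * PadicExp.psqrt (S.all i : ℚ_[S.p]) =
      ((S.toQ'.all i : ℚ) : ℚ_[S.p]) := fun i => by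
    rw [toQ_all']; exact PadicExp.psqrt_mul_self S.hp3 (S.norm_one_sub_all_le i)
  have hr1 : ∀ i : Fin (S.d + 1), ‖PadicExp.psqrt (S.all i : ℚ_[S.p])‖ ≤ 1 := fun i =>
    (PadicExp.norm_psqrt S.hp3 (S.norm_one_sub_all_le i)).le
  have hind' : ∀ T' : Finset (Fin (S.toQ'.d + 1)), T'.Nonempty → ¬ IsSquare (∏ i ∈ T', S.toQ'.all i) := hind
  exact S.toQ'.classVec_eq_zero_of_padicNorm_lt hind' _ hr hr1 J₀ J L Lθ pv τ s hM hcM hlt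

/-- **The half step of the `p`-adic descent** (twin of `CW77.Setup.w80_halfstep`'s logic): from the
invariant at level `J < J₀`, uniform bounds `Dhalf♭(s,τ) ≤ Dmax` and `∑_{T'}|classVec_{J,τ,s}(T')| ≤ Mmax`
for all odd `s < 2^{J+1} S₀`, `|τ| < T/2^{J+1}`, and the `p`-adic smallness
`‖φ_{J,τ}(s/2)‖_p < Dmax/(4 Dmax² Mmax (∏ᵢ H(allᵢ))³)^{2^{d+1}}` at those points (the output of the
ultrametric Schwarz lemma and the parameter inequality), the invariant holds at level `J + 1`.
[folklore]
[cite: CijsouwWaldschmidt1977, §3 with Yu1989, Lemma 1.4 (p. 117) (sources FOLLOWED for the half step of the 2-descent and the p-adic extrapolation; the cell’s adaptation/plumbing, NOT a printed statement)] -/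
theorem inv_succ_of_norm_Φ_half_lt' {J₀ J : ℕ} (hJ : J < J₀)
    (hind : ∀ T' : Finset (Fin (S.d + 1)), T'.Nonempty → ¬ IsSquare (∏ i ∈ T', S.all i))
    {L : Fin S.d → ℕ} {Lθ S₀ T : ℕ} {P : ℤ} {pv : Idx S.d h Lb → ℤ}
    (inv : S.toQ'.Inv J₀ L Lθ S₀ T P J pv) {Dmax Mmax : ℝ} (hMmax : 1 ≤ Mmax)
    (hD : ∀ s, s < 2 ^ (J + 1) * S₀ → Odd s → ∀ τ : Tau S.d, tauNorm τ < T / 2 ^ (J + 1) →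
      ((S.toQ'.flat.Dhalf (h := h) J₀ J L Lθ s τ : ℕ) : ℝ) ≤ Dmax)
    (hM : ∀ s, s < 2 ^ (J + 1) * S₀ → Odd s → ∀ τ : Tau S.d, tauNorm τ < T / 2 ^ (J + 1) →
      ∑ T', |(S.toQ'.classVec J₀ J (S.toQ'.flat.box (h := h) (Lb := Lb) L Lθ J) pv τ s T' : ℝ)| ≤ Mmax)
    (hsmall : ∀ s, s < 2 ^ (J + 1) * S₀ → Odd s → ∀ τ : Tau S.d, tauNorm τ < T / 2 ^ (J + 1) →
      ‖S.Φ J₀ J (S.toQ'.flat.box (h := h) (Lb := Lb) L Lθ J) pv τ ((2 : ℚ_[S.p])⁻¹ * (s : ℚ_[S.p]))‖ <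
        Dmax / (4 * Dmax ^ 2 * Mmax * heightProd S.all ^ 3) ^ (2 ^ (S.d + 1))) :
    ∃ p' : Idx S.d h Lb → ℤ, S.toQ'.Inv J₀ L Lθ S₀ T P (J + 1) p' := by
  refine S.toQ'.descent_algebra inv fun s hs hodd τ hτ => ?_
  have hD1 : (1 : ℝ) ≤ (S.toQ'.flat.Dhalf (h := h) J₀ J L Lθ s τ : ℕ) := by
    exact_mod_cast S.toQ'.flat.Dhalf_pos J₀ J L Lθ s τ
  have hP : 0 < heightProd S.all := lt_of_lt_of_le one_pos (CW77.one_le_heightProd _)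
  have hE : 1 ≤ 2 ^ (S.d + 1) := Nat.one_le_two_pow
  have hmono := liouvilleBound_anti' hE hD1 (hD s hs hodd τ hτ) hMmax le_rfl hP
  -- use `M := Mmax` for the class sums at `(s, τ)`
  refine S.classVec_eq_zero_of_norm_Φ_half_lt' hJ hind L Lθ pv τ s hMmax (hM s hs hodd τ hτ) ?_
  exact lt_of_lt_of_le (hsmall s hs hodd τ hτ) hmono

end Literature.NumberTheory.Transcendental.PadicCW77.Setup

end Part8

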